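import Literature.MathematicalPhysics.QuantumManyBody.GroundStateFeynmanKacExitBound
import Literature.MathematicalPhysics.QuantumManyBody.GroundStateFeynmanKacInteraction
import Literature.MathematicalPhysics.QuantumManyBody.GroundStateFeynmanKacOperator
import Literature.MathematicalPhysics.QuantumManyBody.GroundStateFeynmanKacHeatKernel
import Literature.MathematicalPhysics.QuantumManyBody.GroundStateFeynmanKacTrialState
import Literature.MathematicalPhysics.QuantumManyBody.LiebYngvasonBoxBound
import Literature.MathematicalPhysics.QuantumManyBody.GroundStateFeynmanKacPerronFrobenius
import Literature.MathematicalPhysics.QuantumManyBody.GroundStateFeynmanKacCutLine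
import Literature.MathematicalPhysics.QuantumManyBody.GroundStateFeynmanKacWitnessSymm
import Literature.Probability.Process.BrownianRunningMaxBounds
import Mathlib.Analysis.Calculus.MeanValue
import Mathlib.Topology.UniformSpace.HeineCantor
import HarnessLib

/-!
# Ground-state Feynman–Kac theorem for bounded pair potentials: the proof

Topic `Literature/MathematicalPhysics/QuantumManyBody`; theorems only, no definitions and no
named fact. This file discharges the named fact
`Literature.MathematicalPhysics.QuantumManyBody.BoseGas.GroundStateFeynmanKac` of
`GroundStateFeynmanKac.lean`: its last declaration is
**`theorem GroundStateFeynmanKac_holds : GroundStateFeynmanKac`**.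

It has four parts, each opened by its own section docstring below:

* **Part I — the form upper bound at small times** (`ofReal λ ≤ groundStateEnergy` from the
  Rayleigh bound `⟨f, e^{-tH}f⟩ ≤ e^{-λt}‖f‖²` on `C¹` Dirichlet `f`; Chung–Zhao Prop 3.29, lower
  half): free part by the Gaussian square identity of `GroundStateFeynmanKacFreeForm`, potential
  part, killing part by `GroundStateFeynmanKacExitBound`;
* **Part II — the eigenfunction side of the free form** (from an integrated eigen-relation
  `e^{-λt} ≤ ⟨Ψ₀, e^{-tH}Ψ₀⟩`: `limsup (2t)⁻¹ E∫|Ψ₀(X+√2 b_t) - Ψ₀(X)|² ≤ λ - ∫VΨ₀²`);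
* **Part III — the variational identification** `groundStateEnergy v N L = ofReal λ`
  (`groundStateEnergy ≤ ofReal λ` by the explicit symmetric `C¹` Dirichlet trial functions of
  `GroundStateFeynmanKacTrialState`; Chung–Zhao Thm 3.27 with Prop 3.29 (81));
* **Part IV — the assembly**: the Perron–Frobenius eigenvector of `e^{-H_N}` on `L²(Λ_L^N)`
  (`GroundStateFeynmanKacPerronFrobenius`) read pointwise through the smoothing semigroup,
  continuity up to the boundary, Bose symmetry by nondegeneracy, the Rayleigh bound
  `⟪x, S_t x⟫ ≤ ‖S_1‖ᵗ‖x‖²` for symmetric contraction semigroups, and the pointwise ground-state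
  projection from `GroundStateFeynmanKacSpectral`.

## References

* K. L. Chung, Z. Zhao, *From Brownian Motion to Schrödinger's Equation*, Springer (1995),
  Prop 1.22, Thms 2.4, 3.10, 3.17, 3.27, Prop 3.29 (81), §8.3 (29)–(30), Thm 8.11.
  [cite: ChungZhao1995, Thms 3.17 and 3.27 with Prop 3.29]
* M. Reed, B. Simon, *Methods of Modern Mathematical Physics IV* (1978), §XIII.12 Thm XIII.44.
  [ReedSimonIV1978]
* J. Glimm, A. Jaffe, *Quantum Physics* (1987), §3.3 Thms 3.3.2–3.3.3, §3.4 (3.4.2).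
  [GlimmJaffeQP1987]
* E. H. Lieb, R. Seiringer, J. P. Solovej, J. Yngvason, *The Mathematics of the Bose Gas and its
  Condensation* (2005), §1.2. [LSSY2005]
-/

/-!
# Part I — the form upper bound at small times

## Ground-state Feynman–Kac: the small-time form bound and `λ₀ ≤ E₀` (variational lower bound)

Topic `Literature/MathematicalPhysics/QuantumManyBody`; support file for the proof of the named
fact `Literature.MathematicalPhysics.QuantumManyBody.BoseGas.GroundStateFeynmanKac`. This is one
half of the identification of the top of the spectrum of the Feynman–Kac semigroup
`T_t = e^{-tH_N}` on `Λ_L^N` with the variational ground-state energy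
`groundStateEnergy v N L` (Chung–Zhao (1995), Thm 3.27 with Prop 3.29 (81):
`λ₁ = sup {∫ (-|∇φ|²/2 + qφ²) : φ ∈ C_c^∞(D), ‖φ‖₂ = 1}`), obtained here NOT through the
domain of the generator but by a direct small-time expansion of the killed, weighted path
integral on `C¹` Dirichlet functions:

* `pairing_lower_bound_gsfk` — for a `C¹` real `ψ` vanishing off the box and `t > 0`,
  `‖ψ‖² - ⟨ψ, T_t ψ⟩ ≤ sqIncr t ψ / 2 + (potential term) + (exit term)`, from the pointwise
  weight defect `1 - w_t ≤ 𝟙{exit ≤ t} + ∫₀ᵗ V(B_s) ds` (`one_sub_weight_le_gsfk`);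
* `lintegral_potential_term_le_gsfk` — the potential term is `≤ t ∫ V ψ² + K t^{3/2}` (translation
  invariance of Lebesgue measure under the Gaussian displacement, Lipschitz continuity of `ψ²`
  in `L¹`, `E‖√2 b_s‖ = O(√t)`);
* with `sqIncr t ψ ≤ 2t ∫|∇ψ|²` (`GroundStateFeynmanKacFreeForm`) and the exit bound
  `O(t^{3/2})` (`GroundStateFeynmanKacExitBound`): **`form_upper_bound_gsfk`**
  `‖ψ‖² - ⟨ψ, T_t ψ⟩ ≤ t (∫|∇ψ|² + ∫Vψ²) + K_ψ t^{3/2}`;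
* **`ofReal_le_energy_of_pairing_le`, `ofReal_le_groundStateEnergy_of_pairing_le`** — if the
  semigroup satisfies the Rayleigh bound `⟨f, T_t f⟩ ≤ e^{-λt} ‖f‖²` on `C¹` Dirichlet functions
  (as it does for `λ = λ₀ = -log ‖T_1‖`, the top of the spectrum), then `λ ≤ 𝓔[Ψ]` for every
  admissible trial state, i.e. `ENNReal.ofReal λ ≤ groundStateEnergy v N L`
  (splitting a complex trial state into real and imaginary parts, `energy_eq_re_add_im_gsfk`).

## References

* K. L. Chung, Z. Zhao, *From Brownian Motion to Schrödinger's Equation* (1995), Thm 3.27,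
  Prop 3.29 (81). [ChungZhao1995]
* E. H. Lieb, R. Seiringer, J. P. Solovej, J. Yngvason, *The Mathematics of the Bose Gas and its
  Condensation* (2005), §1.2 (1.16), (2.3). [LSSY2005]
-/

noncomputable section

namespace Literature.MathematicalPhysics.QuantumManyBody.BoseGas

open MeasureTheory ProbabilityTheory Filter Set
open scoped ENNReal NNReal Topology
open Literature.Probability.Process

variable {N : ℕ}

/-! ### `C¹` Dirichlet functions: compact support, bounds, Lipschitz constant -/

/-- A function vanishing off the box has compact support. [folklore] -/
private theorem hasCompactSupport_of_eq_zero_gsfk {ψ : Config N → ℝ} {L : ℝ}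
    (h0 : ∀ X, X ∉ boxN N L → ψ X = 0) : HasCompactSupport ψ :=
  HasCompactSupport.intro (isCompact_closedBall (0 : Config N) (3 * |L|))
    fun X hX => h0 X fun hb => hX (boxN_subset_closedBall N L hb)

/-- A `C¹` function vanishing off the box is Lipschitz: `|ψ Y - ψ Z| ≤ G ‖Y - Z‖` with `G ≥ 0`
(mean value inequality with the bound of the compactly supported continuous gradient).
[folklore] -/
private theorem exists_lipschitz_of_contDiff_gsfk {ψ : Config N → ℝ} {L : ℝ} (hψ : ContDiff ℝ 1 ψ)
    (h0 : ∀ X, X ∉ boxN N L → ψ X = 0) :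
    ∃ G : ℝ, 0 ≤ G ∧ ∀ Y Z, |ψ Y - ψ Z| ≤ G * ‖Y - Z‖ := by
  obtain ⟨C, hC⟩ := ((hasCompactSupport_of_eq_zero_gsfk h0).fderiv (𝕜 := ℝ)).exists_bound_of_continuous
    (hψ.continuous_fderiv one_ne_zero)
  refine ⟨max C 0, le_max_right _ _, fun Y Z => ?_⟩
  have h := Convex.norm_image_sub_le_of_norm_fderiv_le (s := Set.univ) (C := max C 0) (f := ψ)
    (fun x _ => (hψ.differentiable one_ne_zero) x) (fun x _ => (hC x).trans (le_max_left C 0))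
    convex_univ (Set.mem_univ Z) (Set.mem_univ Y)
  rwa [Real.norm_eq_abs] at h

/-- A `C¹` function vanishing off the box is bounded. [folklore] -/
private theorem exists_bound_of_contDiff_gsfk {ψ : Config N → ℝ} {L : ℝ} (hψ : ContDiff ℝ 1 ψ)
    (h0 : ∀ X, X ∉ boxN N L → ψ X = 0) : ∃ M : ℝ, 0 ≤ M ∧ ∀ X, |ψ X| ≤ M := by
  obtain ⟨C, hC⟩ := (hasCompactSupport_of_eq_zero_gsfk h0).exists_bound_of_continuous hψ.continuous
  exact ⟨max C 0, le_max_right _ _, fun X => by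
    rw [← Real.norm_eq_abs]; exact (hC X).trans (le_max_left _ _)⟩

/-! ### The weight defect -/

/-- **Weight defect**: `1 - w_t(X, ω) ≤ 𝟙{exit ≤ t}(ω) + (∫₀ᵗ V(B_s) ds)` for a bounded pair
potential (`e^{-a} ≥ 1 - a`). [folklore] -/
private theorem one_sub_weight_le_gsfk {v : ℝ → ℝ≥0∞} {C : ℝ≥0} (hC : ∀ r, v r ≤ C) (L t : ℝ)
    (X : Config N) (ω : PathSpace N) :
    1 - (fkWeight v L t X ω).toReal ≤
      (survives L t X)ᶜ.indicator (fun _ => (1 : ℝ)) ω + (pathAction v t X ω).toReal := by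
  have hA : pathAction v t X ω ≤ (N * N : ℕ) * (C : ℝ≥0∞) * ENNReal.ofReal t :=
    pathAction_le_of_le (C := (C : ℝ≥0∞)) (fun r => hC r) t X ω
  have hAtop : pathAction v t X ω ≠ ⊤ :=
    ne_top_of_le_ne_top (ENNReal.mul_ne_top (ENNReal.mul_ne_top (ENNReal.natCast_ne_top _)
      ENNReal.coe_ne_top) ENNReal.ofReal_ne_top) hA
  by_cases hω : ω ∈ survives L t X
  · rw [Set.indicator_of_notMem (Set.notMem_compl_iff.2 hω), zero_add, fkWeight,
      Set.indicator_of_mem hω, expNeg, if_neg hAtop, ENNReal.toReal_ofReal (Real.exp_pos _).le]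
    have := Real.add_one_le_exp (-(pathAction v t X ω).toReal)
    linarith
  · rw [Set.indicator_of_mem (Set.mem_compl hω), fkWeight, Set.indicator_of_notMem hω]
    simp only [ENNReal.toReal_zero, sub_zero]
    linarith [ENNReal.toReal_nonneg (a := pathAction v t X ω)]

/-- The weight is in `[0, 1]` (real form; local copy of the tree's `toReal_fkWeight_le_one` of
`HeatFlow.lean`, which is outside this import cone). [folklore] -/
private theorem toReal_fkWeight_le_one_aux_gsfk (v : ℝ → ℝ≥0∞) (L t : ℝ) (X : Config N) (ω : PathSpace N) :
    (fkWeight v L t X ω).toReal ≤ 1 := by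
  have := ENNReal.toReal_mono ENNReal.one_ne_top (fkWeight_le_one v L t X ω)
  simpa using this

/-- **Pointwise lower bound for the pairing integrand**:
`ψ(X) w ψ(B_t) ≥ ψ(X)ψ(B_t) - |ψ(X)||ψ(B_t)| ∫₀ᵗV - |ψ(X)||ψ(B_t)| 𝟙{exit ≤ t}`. [folklore] -/
private theorem pairing_integrand_ge_gsfk {v : ℝ → ℝ≥0∞} {C : ℝ≥0} (hC : ∀ r, v r ≤ C) (L t : ℝ)
    (ψ : Config N → ℝ) (X : Config N) (ω : PathSpace N) (Y : Config N) :
    ψ X * ψ Y - |ψ X| * |ψ Y| * (pathAction v t X ω).toReal -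
        |ψ X| * |ψ Y| * (survives L t X)ᶜ.indicator (fun _ => (1 : ℝ)) ω ≤
      ψ X * ((fkWeight v L t X ω).toReal * ψ Y) := by
  have h1 := one_sub_weight_le_gsfk hC L t X ω
  have hw0 : 0 ≤ (fkWeight v L t X ω).toReal := ENNReal.toReal_nonneg
  have hw1 := toReal_fkWeight_le_one_aux_gsfk v L t X ω
  set w := (fkWeight v L t X ω).toReal
  set a := ψ X * ψ Y
  have hkey : a - w * a ≤ |a| * ((survives L t X)ᶜ.indicator (fun _ => (1 : ℝ)) ω +
      (pathAction v t X ω).toReal) := by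
    calc a - w * a = a * (1 - w) := by ring
      _ ≤ |a| * (1 - w) := mul_le_mul_of_nonneg_right (le_abs_self a) (by linarith)
      _ ≤ _ := mul_le_mul_of_nonneg_left h1 (abs_nonneg a)
  rw [abs_mul] at hkey
  nlinarith [hkey]

/-! ### Measurability -/

/-- The world-lines at all times are jointly measurable in `((X, ω), s)`. [folklore] -/
private theorem measurable_worldLine_prod_time_gsfk :
    Measurable fun p : (Config N × PathSpace N) × ℝ => worldLine p.1.1 p.1.2 p.2.toNNReal := by
  have h : Measurable fun p : (Config N × PathSpace N) × ℝ =>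
      p.1.1 + displacement p.2.toNNReal p.1.2 :=
    (measurable_fst.comp measurable_fst).add (measurable_displacement_uncurry.comp
      ((measurable_real_toNNReal.comp measurable_snd).prodMk (measurable_snd.comp measurable_fst)))
  exact h

/-- **Joint measurability of the action** `(X, ω) ↦ ∫₀ᵗ ∑ v(|Bⁱ_s - Bʲ_s|) ds`. [folklore] -/
private theorem measurable_pathAction_uncurry_gsfk {v : ℝ → ℝ≥0∞} (hv : Measurable v) (t : ℝ) :
    Measurable fun p : Config N × PathSpace N => pathAction v t p.1 p.2 :=
  ((measurable_interaction hv).comp measurable_worldLine_prod_time_gsfk).lintegral_prod_right'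

/-- **Joint measurability of the survival event** `{(X, ω) | ω ∈ survives L t X}` (countable
description through rational times). [folklore] -/
private theorem measurableSet_survives_prod_gsfk (L t : ℝ) :
    MeasurableSet {p : Config N × PathSpace N | p.2 ∈ survives L t p.1} := by
  have hset : {p : Config N × PathSpace N | p.2 ∈ survives L t p.1} =
      ⋃ n : ℕ, ⋂ q : ℚ, {p : Config N × PathSpace N | (q : ℝ) ∈ Set.Icc 0 t →
        ((n : ℝ≥0∞)⁻¹ ≤ Metric.infEDist (worldLine p.1 p.2 (q : ℝ).toNNReal) (boxN N L)ᶜ)} := by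
    ext p
    rw [Set.mem_setOf_eq, survives_eq_iUnion_iInter]
    simp only [Set.mem_iUnion, Set.mem_iInter, Set.mem_setOf_eq]
  rw [hset]
  refine MeasurableSet.iUnion fun n => MeasurableSet.iInter fun q => ?_
  by_cases hq : (q : ℝ) ∈ Set.Icc 0 t
  · simp only [hq, forall_const]
    exact measurableSet_le measurable_const
      (Metric.continuous_infEDist.measurable.comp (measurable_worldLine_uncurry' _))
  · simp [hq]

/-- The exit indicator is jointly measurable. [folklore] -/
private theorem measurable_exit_indicator_gsfk (L t : ℝ) :
    Measurable fun p : Config N × PathSpace N =>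
      (survives L t p.1)ᶜ.indicator (fun _ => (1 : ℝ)) p.2 :=
  (measurable_const.indicator (measurableSet_survives_prod_gsfk L t).compl :
    Measurable ({p : Config N × PathSpace N | p.2 ∈ survives L t p.1}ᶜ.indicator fun _ => (1 : ℝ)))

/-- The exit indicator (in `[0, ∞]`) is jointly measurable. [folklore] -/
private theorem measurable_exit_indicator_ennreal_gsfk (L t : ℝ) :
    Measurable fun p : Config N × PathSpace N =>
      (survives L t p.1)ᶜ.indicator (1 : PathSpace N → ℝ≥0∞) p.2 :=
  (measurable_const.indicator (measurableSet_survives_prod_gsfk L t).compl :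
    Measurable ({p : Config N × PathSpace N | p.2 ∈ survives L t p.1}ᶜ.indicator fun _ => (1 : ℝ≥0∞)))

/-! ### The potential term -/

/-- **`L¹`-Lipschitz continuity of `ψ²` under translation**, weighted by a bounded `V`:
`∫ ψ(X)² V(X + h) dX ≤ ∫ ψ² V + C_V · G‖h‖ · 2‖ψ‖₁`. [folklore] -/
private theorem lintegral_sq_mul_shift_le_gsfk {ψ : Config N → ℝ} (hψm : Measurable ψ) {G : ℝ} (hG : 0 ≤ G)
    (hLip : ∀ Y Z, |ψ Y - ψ Z| ≤ G * ‖Y - Z‖) {V : Config N → ℝ≥0∞} (hV : Measurable V)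
    {CV : ℝ≥0} (hCV : ∀ X, V X ≤ CV) (h : Config N) :
    ∫⁻ X, ENNReal.ofReal (ψ X ^ 2) * V (X + h) ≤
      (∫⁻ X, ENNReal.ofReal (ψ X ^ 2) * V X) +
        (CV : ℝ≥0∞) * ENNReal.ofReal (G * ‖h‖) * (2 * ∫⁻ X, ‖ψ X‖ₑ) := by
  have hm2 : Measurable fun Y : Config N => ENNReal.ofReal (ψ Y ^ 2) * V Y :=
    (ENNReal.measurable_ofReal.comp (hψm.pow_const 2)).mul hV
  -- translate
  have htr : ∫⁻ X, ENNReal.ofReal (ψ X ^ 2) * V (X + h) = ∫⁻ Y, ENNReal.ofReal (ψ (Y - h) ^ 2) * V Y := by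
    have := lintegral_add_right_eq_self (μ := (volume : Measure (Config N)))
      (fun Y => ENNReal.ofReal (ψ (Y - h) ^ 2) * V Y) h
    simp only [add_sub_cancel_right] at this
    exact this
  rw [htr]
  -- pointwise `ψ(Y-h)² ≤ ψ(Y)² + G‖h‖ (|ψ(Y-h)| + |ψ Y|)`
  have hpt : ∀ Y, ENNReal.ofReal (ψ (Y - h) ^ 2) ≤ ENNReal.ofReal (ψ Y ^ 2) +
      ENNReal.ofReal (G * ‖h‖) * (‖ψ (Y - h)‖ₑ + ‖ψ Y‖ₑ) := by
    intro Y
    have hd : |ψ (Y - h) - ψ Y| ≤ G * ‖h‖ := by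
      have := hLip (Y - h) Y
      rwa [sub_sub_cancel_left, norm_neg] at this
    have hsq : ψ (Y - h) ^ 2 ≤ ψ Y ^ 2 + G * ‖h‖ * (|ψ (Y - h)| + |ψ Y|) := by
      have h1 : ψ (Y - h) ^ 2 - ψ Y ^ 2 = (ψ (Y - h) - ψ Y) * (ψ (Y - h) + ψ Y) := by ring
      have h2 : |ψ (Y - h) ^ 2 - ψ Y ^ 2| ≤ G * ‖h‖ * (|ψ (Y - h)| + |ψ Y|) := by
        rw [h1, abs_mul]
        exact mul_le_mul hd (abs_add_le _ _) (abs_nonneg _) (by positivity)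
      linarith [le_abs_self (ψ (Y - h) ^ 2 - ψ Y ^ 2)]
    calc ENNReal.ofReal (ψ (Y - h) ^ 2)
        ≤ ENNReal.ofReal (ψ Y ^ 2 + G * ‖h‖ * (|ψ (Y - h)| + |ψ Y|)) := ENNReal.ofReal_le_ofReal hsq
      _ = ENNReal.ofReal (ψ Y ^ 2) + ENNReal.ofReal (G * ‖h‖) * (‖ψ (Y - h)‖ₑ + ‖ψ Y‖ₑ) := by
          rw [ENNReal.ofReal_add (sq_nonneg _) (by positivity), ENNReal.ofReal_mul (by positivity),
            ENNReal.ofReal_add (abs_nonneg _) (abs_nonneg _), ← Real.enorm_eq_ofReal_abs,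
            ← Real.enorm_eq_ofReal_abs]
  have hme : Measurable fun Y : Config N => ‖ψ Y‖ₑ := hψm.enorm
  have hmeh : Measurable fun Y : Config N => ‖ψ (Y - h)‖ₑ := (hψm.comp (measurable_sub_const h)).enorm
  calc ∫⁻ Y, ENNReal.ofReal (ψ (Y - h) ^ 2) * V Y
      ≤ ∫⁻ Y, (ENNReal.ofReal (ψ Y ^ 2) * V Y +
          (CV : ℝ≥0∞) * ENNReal.ofReal (G * ‖h‖) * (‖ψ (Y - h)‖ₑ + ‖ψ Y‖ₑ)) := by
        refine lintegral_mono fun Y => ?_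
        calc ENNReal.ofReal (ψ (Y - h) ^ 2) * V Y
            ≤ (ENNReal.ofReal (ψ Y ^ 2) + ENNReal.ofReal (G * ‖h‖) * (‖ψ (Y - h)‖ₑ + ‖ψ Y‖ₑ)) * V Y :=
              mul_le_mul' (hpt Y) le_rfl
          _ = ENNReal.ofReal (ψ Y ^ 2) * V Y + ENNReal.ofReal (G * ‖h‖) * (‖ψ (Y - h)‖ₑ + ‖ψ Y‖ₑ) * V Y := by
              rw [add_mul]
          _ ≤ ENNReal.ofReal (ψ Y ^ 2) * V Y +
              ENNReal.ofReal (G * ‖h‖) * (‖ψ (Y - h)‖ₑ + ‖ψ Y‖ₑ) * (CV : ℝ≥0∞) := by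
              gcongr
              exact hCV Y
          _ = _ := by ring
    _ = (∫⁻ Y, ENNReal.ofReal (ψ Y ^ 2) * V Y) +
        (CV : ℝ≥0∞) * ENNReal.ofReal (G * ‖h‖) * ∫⁻ Y, (‖ψ (Y - h)‖ₑ + ‖ψ Y‖ₑ) := by
        have hsum : Measurable fun Y : Config N => ‖ψ (Y - h)‖ₑ + ‖ψ Y‖ₑ := hmeh.add hme
        rw [lintegral_add_left hm2, lintegral_const_mul _ hsum]
    _ = _ := by
        rw [lintegral_add_left hmeh]
        have htr2 : ∫⁻ Y, ‖ψ (Y - h)‖ₑ = ∫⁻ Y, ‖ψ Y‖ₑ :=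
          lintegral_sub_right_eq_self (μ := (volume : Measure (Config N))) (fun Y => ‖ψ Y‖ₑ) h
        rw [htr2, two_mul]

/-- Tonelli for the potential term: `∫dX E[ψ(X)² ∫₀ᵗ V(B_s) ds] = ∫₀ᵗ ds E ∫ ψ(X)² V(X + √2 b_s) dX`.
[folklore] -/
private theorem lintegral_sq_mul_pathAction_eq_gsfk {v : ℝ → ℝ≥0∞} (hv : Measurable v) {ψ : Config N → ℝ}
    (hψm : Measurable ψ) (t : ℝ) :
    ∫⁻ X, ∫⁻ ω, ENNReal.ofReal (ψ X ^ 2) * pathAction v t X ω ∂wienerPaths N ∂volume =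
      ∫⁻ s in Set.Ioc (0 : ℝ) t, ∫⁻ ω, ∫⁻ X, ENNReal.ofReal (ψ X ^ 2) *
        interaction v (X + displacement s.toNNReal ω) ∂volume ∂wienerPaths N ∂volume := by
  have hVm : Measurable (interaction (N := N) v) := measurable_interaction hv
  -- measurability of the triple integrand in its three groupings
  have hXω_s : ∀ X : Config N, Measurable fun p : PathSpace N × ℝ =>
      ENNReal.ofReal (ψ X ^ 2) * interaction v (worldLine X p.1 p.2.toNNReal) := fun X =>
    (hVm.comp (measurable_worldLine_uncurry X)).const_mul _
  have hXs_ω : Measurable fun q : (Config N × ℝ) × PathSpace N =>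
      ENNReal.ofReal (ψ q.1.1 ^ 2) * interaction v (worldLine q.1.1 q.2 q.1.2.toNNReal) := by
    have h1 : Measurable fun q : (Config N × ℝ) × PathSpace N => worldLine q.1.1 q.2 q.1.2.toNNReal :=
      measurable_worldLine_prod_time_gsfk.comp (((measurable_fst.comp measurable_fst).prodMk
        measurable_snd).prodMk (measurable_snd.comp measurable_fst))
    exact (ENNReal.measurable_ofReal.comp ((hψm.comp (measurable_fst.comp measurable_fst)).pow_const
      2)).mul (hVm.comp h1)
  have hX_s : Measurable fun q : Config N × ℝ => ∫⁻ ω, ENNReal.ofReal (ψ q.1 ^ 2) *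
      interaction v (worldLine q.1 ω q.2.toNNReal) ∂wienerPaths N := hXs_ω.lintegral_prod_right'
  have hXω : ∀ s : ℝ, Measurable fun q : Config N × PathSpace N =>
      ENNReal.ofReal (ψ q.1 ^ 2) * interaction v (worldLine q.1 q.2 s.toNNReal) := fun s =>
    (ENNReal.measurable_ofReal.comp ((hψm.comp measurable_fst).pow_const 2)).mul
      (hVm.comp (measurable_worldLine_uncurry' _))
  -- Step 1: the action as an integral in time
  have h1 : ∀ (X : Config N) (ω : PathSpace N), ENNReal.ofReal (ψ X ^ 2) * pathAction v t X ω =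
      ∫⁻ s in Set.Ioc (0 : ℝ) t, ENNReal.ofReal (ψ X ^ 2) *
        interaction v (worldLine X ω s.toNNReal) := by
    intro X ω
    have hm : Measurable fun s : ℝ => interaction v (worldLine X ω s.toNNReal) :=
      hVm.comp (continuous_worldLine_toNNReal X ω).measurable
    rw [pathAction, ← lintegral_const_mul _ hm]
  simp_rw [h1]
  -- Step 2: swap `ω ↔ s` for each `X`
  have h2 : ∀ X : Config N, ∫⁻ ω, ∫⁻ s in Set.Ioc (0 : ℝ) t, ENNReal.ofReal (ψ X ^ 2) *
      interaction v (worldLine X ω s.toNNReal) ∂volume ∂wienerPaths N =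
      ∫⁻ s in Set.Ioc (0 : ℝ) t, ∫⁻ ω, ENNReal.ofReal (ψ X ^ 2) *
        interaction v (worldLine X ω s.toNNReal) ∂wienerPaths N ∂volume := fun X =>
    lintegral_lintegral_swap (hXω_s X).aemeasurable
  simp_rw [h2]
  -- Step 3: swap `X ↔ s`
  rw [lintegral_lintegral_swap hX_s.aemeasurable]
  -- Step 4: swap `X ↔ ω` inside
  refine lintegral_congr fun s => ?_
  rw [lintegral_lintegral_swap (hXω s).aemeasurable]
  rfl

/-- **The potential term**: for measurable `ψ` with Lipschitz constant `G` and a pair potential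
`v ≤ C` (`V = ∑_{i<j} v ≤ N²C`), for `t > 0`,
`∫ dX E[|ψ(X)| |ψ(B_t)| ∫₀ᵗ V(B_s)ds] ≤ t ∫ ψ² V + t · 3 N²C G (√2·3N·2√t) · ‖ψ‖₁`. [folklore] -/
private theorem lintegral_potential_term_le_gsfk {v : ℝ → ℝ≥0∞} (hv : Measurable v) {C : ℝ≥0}
    (hC : ∀ r, v r ≤ C) {ψ : Config N → ℝ} (hψm : Measurable ψ) {G : ℝ} (hG : 0 ≤ G)
    (hLip : ∀ Y Z, |ψ Y - ψ Z| ≤ G * ‖Y - Z‖) {t : ℝ≥0} (ht : t ≠ 0) :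
    ∫⁻ X, ∫⁻ ω, ‖ψ X‖ₑ * ‖ψ (X + displacement t ω)‖ₑ * pathAction v t X ω ∂wienerPaths N ∂volume ≤
      ENNReal.ofReal t * (∫⁻ X, ENNReal.ofReal (ψ X ^ 2) * interaction v X) +
        ENNReal.ofReal (t * (3 * (((N * N : ℕ) : ℝ) * C) * G *
          (Real.sqrt 2 * ((3 * N : ℕ) * (2 * Real.sqrt t))))) * ∫⁻ X, ‖ψ X‖ₑ := by
  have ht' : (0 : ℝ) < t := lt_of_le_of_ne t.coe_nonneg (fun h => ht (by exact_mod_cast h.symm))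
  set CV : ℝ≥0 := (N * N : ℕ) * C with hCVdef
  set m : ℝ := Real.sqrt 2 * ((3 * N : ℕ) * (2 * Real.sqrt t)) with hm
  have hm0 : 0 ≤ m := by positivity
  have hVle : ∀ X : Config N, interaction v X ≤ CV := fun X => by
    have := interaction_le_of_le (C := (C : ℝ≥0∞)) (fun r => hC r) X
    simpa [hCVdef] using this
  have hVm : Measurable (interaction (N := N) v) := measurable_interaction hv
  have hAle : ∀ (X : Config N) (ω : PathSpace N), pathAction v t X ω ≤ (CV : ℝ≥0∞) * ENNReal.ofReal t := by
    intro X ω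
    have := pathAction_le_of_le (C := (C : ℝ≥0∞)) (fun r => hC r) t X ω
    simpa [hCVdef, mul_assoc] using this
  have hme : Measurable fun Y : Config N => ‖ψ Y‖ₑ := hψm.enorm
  set P : ℝ≥0∞ := ∫⁻ X, ENNReal.ofReal (ψ X ^ 2) * interaction v X with hP
  set I : ℝ≥0∞ := ∫⁻ X, ‖ψ X‖ₑ with hI
  -- pointwise: `|ψ(B_t)| ≤ |ψ X| + G ‖D_t‖`
  have hpt : ∀ (X : Config N) (ω : PathSpace N),
      ‖ψ X‖ₑ * ‖ψ (X + displacement t ω)‖ₑ * pathAction v t X ω ≤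
        ENNReal.ofReal (ψ X ^ 2) * pathAction v t X ω +
          ‖ψ X‖ₑ * ENNReal.ofReal G * ‖displacement t ω‖ₑ * ((CV : ℝ≥0∞) * ENNReal.ofReal t) := by
    intro X ω
    have h1 : ‖ψ (X + displacement t ω)‖ₑ ≤ ‖ψ X‖ₑ + ENNReal.ofReal G * ‖displacement t ω‖ₑ := by
      have := hLip (X + displacement t ω) X
      rw [add_sub_cancel_left] at this
      have h2 : |ψ (X + displacement t ω)| ≤ |ψ X| + G * ‖displacement t ω‖ := by
        linarith [abs_sub_abs_le_abs_sub (ψ (X + displacement t ω)) (ψ X)]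
      calc ‖ψ (X + displacement t ω)‖ₑ = ENNReal.ofReal |ψ (X + displacement t ω)| :=
            Real.enorm_eq_ofReal_abs _
        _ ≤ ENNReal.ofReal (|ψ X| + G * ‖displacement t ω‖) := ENNReal.ofReal_le_ofReal h2
        _ = _ := by
            rw [ENNReal.ofReal_add (abs_nonneg _) (by positivity), ENNReal.ofReal_mul hG,
              ← Real.enorm_eq_ofReal_abs, ofReal_norm]
    calc ‖ψ X‖ₑ * ‖ψ (X + displacement t ω)‖ₑ * pathAction v t X ω
        ≤ ‖ψ X‖ₑ * (‖ψ X‖ₑ + ENNReal.ofReal G * ‖displacement t ω‖ₑ) * pathAction v t X ω := by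
          gcongr
      _ = ‖ψ X‖ₑ * ‖ψ X‖ₑ * pathAction v t X ω +
          ‖ψ X‖ₑ * ENNReal.ofReal G * ‖displacement t ω‖ₑ * pathAction v t X ω := by ring
      _ ≤ _ := by
          gcongr
          · rw [Real.enorm_eq_ofReal_abs, ← ENNReal.ofReal_mul (abs_nonneg _), ← sq, sq_abs]
          · exact hAle X ω
  -- part (b): the gradient term
  have hconst : ENNReal.ofReal G * ((CV : ℝ≥0∞) * ENNReal.ofReal t) * ENNReal.ofReal m =
      ENNReal.ofReal (t * (CV * G * m)) := by
    rw [← ENNReal.ofReal_coe_nnreal, ← ENNReal.ofReal_mul (by positivity : (0 : ℝ) ≤ CV),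
      ← ENNReal.ofReal_mul hG, ← ENNReal.ofReal_mul (by positivity : (0 : ℝ) ≤ G * (CV * t))]
    congr 1
    ring
  have hb : ∫⁻ X, ∫⁻ ω, ‖ψ X‖ₑ * ENNReal.ofReal G * ‖displacement t ω‖ₑ * ((CV : ℝ≥0∞) * ENNReal.ofReal t)
      ∂wienerPaths N ∂volume ≤ ENNReal.ofReal (t * (CV * G * m)) * I := by
    have hDm : Measurable fun ω : PathSpace N => ‖displacement t ω‖ₑ :=
      (measurable_displacement (N := N) t).enorm
    have h1 : ∀ X : Config N, ∫⁻ ω, ‖ψ X‖ₑ * ENNReal.ofReal G * ‖displacement t ω‖ₑ *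
        ((CV : ℝ≥0∞) * ENNReal.ofReal t) ∂wienerPaths N =
        ‖ψ X‖ₑ * (ENNReal.ofReal G * ((CV : ℝ≥0∞) * ENNReal.ofReal t) *
          ∫⁻ ω, ‖displacement t ω‖ₑ ∂wienerPaths N) := by
      intro X
      rw [← lintegral_const_mul _ hDm, ← lintegral_const_mul _ (hDm.const_mul _)]
      refine lintegral_congr fun ω => ?_
      ring
    simp_rw [h1]
    rw [lintegral_mul_const _ hme]
    calc I * (ENNReal.ofReal G * ((CV : ℝ≥0∞) * ENNReal.ofReal t) *
          ∫⁻ ω, ‖displacement t ω‖ₑ ∂wienerPaths N)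
        ≤ I * (ENNReal.ofReal G * ((CV : ℝ≥0∞) * ENNReal.ofReal t) * ENNReal.ofReal m) :=
          mul_le_mul' le_rfl (mul_le_mul' le_rfl (lintegral_norm_displacement_le le_rfl))
      _ = ENNReal.ofReal (t * (CV * G * m)) * I := by rw [hconst, mul_comm]
  -- part (a): the main term
  have ha : ∫⁻ X, ∫⁻ ω, ENNReal.ofReal (ψ X ^ 2) * pathAction v t X ω ∂wienerPaths N ∂volume ≤
      ENNReal.ofReal t * P + ENNReal.ofReal (t * (2 * (CV * G * m))) * I := by
    rw [lintegral_sq_mul_pathAction_eq_gsfk hv hψm]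
    have hDm : ∀ s : ℝ≥0, Measurable fun ω : PathSpace N => ‖displacement s ω‖ₑ := fun s =>
      (measurable_displacement (N := N) s).enorm
    -- bound the inner double integral uniformly in `s ∈ (0, t]`
    have hinner : ∀ s ∈ Set.Ioc (0 : ℝ) t, ∫⁻ ω, ∫⁻ X, ENNReal.ofReal (ψ X ^ 2) *
        interaction v (X + displacement s.toNNReal ω) ∂volume ∂wienerPaths N ≤
        P + (CV : ℝ≥0∞) * ENNReal.ofReal G * ENNReal.ofReal m * (2 * I) := by
      intro s hs
      have hs' : s.toNNReal ≤ t := Real.toNNReal_le_iff_le_coe.2 hs.2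
      calc ∫⁻ ω, ∫⁻ X, ENNReal.ofReal (ψ X ^ 2) * interaction v (X + displacement s.toNNReal ω)
            ∂volume ∂wienerPaths N
          ≤ ∫⁻ ω, (P + (CV : ℝ≥0∞) * ENNReal.ofReal (G * ‖displacement s.toNNReal ω‖) * (2 * I))
              ∂wienerPaths N :=
            lintegral_mono fun ω => lintegral_sq_mul_shift_le_gsfk hψm hG hLip hVm hVle _
        _ = P + (CV : ℝ≥0∞) * ENNReal.ofReal G * (2 * I) *
              ∫⁻ ω, ‖displacement s.toNNReal ω‖ₑ ∂wienerPaths N := by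
            rw [lintegral_add_left (f := fun _ => P) measurable_const, lintegral_const, measure_univ,
              mul_one]
            congr 1
            rw [← lintegral_const_mul _ (hDm _)]
            refine lintegral_congr fun ω => ?_
            rw [ENNReal.ofReal_mul hG, ofReal_norm]
            ring
        _ ≤ P + (CV : ℝ≥0∞) * ENNReal.ofReal G * (2 * I) * ENNReal.ofReal m := by
            gcongr
            exact lintegral_norm_displacement_le hs'
        _ = _ := by ring
    have hconst2 : ENNReal.ofReal t * ((CV : ℝ≥0∞) * ENNReal.ofReal G * ENNReal.ofReal m * (2 * I)) =
        ENNReal.ofReal (t * (2 * (CV * G * m))) * I := by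
      rw [← ENNReal.ofReal_coe_nnreal, ← ENNReal.ofReal_ofNat 2,
        ← ENNReal.ofReal_mul (by positivity : (0 : ℝ) ≤ CV), ← ENNReal.ofReal_mul (by positivity : (0 : ℝ) ≤ CV * G),
        ENNReal.ofReal_mul (by positivity : (0 : ℝ) ≤ t)]
      have h2m : ENNReal.ofReal (2 * (CV * G * m)) = ENNReal.ofReal 2 * ENNReal.ofReal (CV * G * m) :=
        ENNReal.ofReal_mul zero_le_two
      rw [h2m]
      ring
    calc ∫⁻ s in Set.Ioc (0 : ℝ) t, ∫⁻ ω, ∫⁻ X, ENNReal.ofReal (ψ X ^ 2) *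
          interaction v (X + displacement s.toNNReal ω) ∂volume ∂wienerPaths N ∂volume
        ≤ ∫⁻ _s in Set.Ioc (0 : ℝ) t, (P + (CV : ℝ≥0∞) * ENNReal.ofReal G * ENNReal.ofReal m * (2 * I))
            ∂volume := setLIntegral_mono measurable_const hinner
      _ = ENNReal.ofReal t * (P + (CV : ℝ≥0∞) * ENNReal.ofReal G * ENNReal.ofReal m * (2 * I)) := by
          rw [setLIntegral_const, Real.volume_Ioc, sub_zero, mul_comm]
      _ = _ := by rw [mul_add, hconst2]
  -- assemble
  have hmA : ∀ X : Config N, Measurable fun ω : PathSpace N =>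
      ENNReal.ofReal (ψ X ^ 2) * pathAction v t X ω := fun X =>
    (measurable_pathAction hv t X).const_mul _
  have hmA' : Measurable fun X : Config N => ∫⁻ ω, ENNReal.ofReal (ψ X ^ 2) * pathAction v t X ω
      ∂wienerPaths N :=
    ((ENNReal.measurable_ofReal.comp ((hψm.comp measurable_fst).pow_const 2)).mul
      (measurable_pathAction_uncurry_gsfk hv t)).lintegral_prod_right'
  calc ∫⁻ X, ∫⁻ ω, ‖ψ X‖ₑ * ‖ψ (X + displacement t ω)‖ₑ * pathAction v t X ω ∂wienerPaths N ∂volume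
      ≤ ∫⁻ X, ∫⁻ ω, (ENNReal.ofReal (ψ X ^ 2) * pathAction v t X ω +
          ‖ψ X‖ₑ * ENNReal.ofReal G * ‖displacement t ω‖ₑ * ((CV : ℝ≥0∞) * ENNReal.ofReal t))
          ∂wienerPaths N ∂volume := lintegral_mono fun X => lintegral_mono fun ω => hpt X ω
    _ = ∫⁻ X, ∫⁻ ω, ENNReal.ofReal (ψ X ^ 2) * pathAction v t X ω ∂wienerPaths N ∂volume +
        ∫⁻ X, ∫⁻ ω, ‖ψ X‖ₑ * ENNReal.ofReal G * ‖displacement t ω‖ₑ * ((CV : ℝ≥0∞) * ENNReal.ofReal t)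
          ∂wienerPaths N ∂volume := by
        rw [← lintegral_add_left hmA']
        refine lintegral_congr fun X => ?_
        rw [lintegral_add_left (hmA X)]
    _ ≤ (ENNReal.ofReal t * P + ENNReal.ofReal (t * (2 * (CV * G * m))) * I) +
        ENNReal.ofReal (t * (CV * G * m)) * I := add_le_add ha hb
    _ = ENNReal.ofReal t * P + ENNReal.ofReal (t * (3 * (((N * N : ℕ) : ℝ) * C) * G *
          (Real.sqrt 2 * ((3 * N : ℕ) * (2 * Real.sqrt t))))) * I := by
        rw [add_assoc, ← add_mul, ← ENNReal.ofReal_add (by positivity) (by positivity)]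
        congr 3
        simp only [hCVdef, hm]
        push_cast
        ring

/-! ### The pairing lower bound -/

/-- Uniform bound on the real Feynman–Kac functional of a bounded observable:
`|(e^{-tH} ψ)(X)| ≤ sup |ψ|`. [folklore] -/
private theorem abs_fkReal_le_of_bound_gsfk (v : ℝ → ℝ≥0∞) (L t : ℝ) {ψ : Config N → ℝ} {M : ℝ}
    (hM : ∀ X, |ψ X| ≤ M) (X : Config N) : |fkReal v L t ψ X| ≤ M := by
  have h := norm_integral_le_of_norm_le_const (μ := wienerPaths N) (C := M)
    (f := fun ω => (fkWeight v L t X ω).toReal * ψ (worldLine X ω t.toNNReal))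
    (Eventually.of_forall fun ω => by
      rw [norm_mul, Real.norm_of_nonneg ENNReal.toReal_nonneg, Real.norm_eq_abs]
      calc (fkWeight v L t X ω).toReal * |ψ (worldLine X ω t.toNNReal)| ≤ 1 * M :=
            mul_le_mul (toReal_fkWeight_le_one_aux_gsfk v L t X ω) (hM _) (abs_nonneg _) zero_le_one
        _ = M := one_mul M)
  rw [probReal_univ, mul_one, Real.norm_eq_abs] at h
  exact h

/-- **The pairing lower bound**: for a bounded, Lipschitz, square-integrable, integrable `ψ`, a
bounded pair potential and `t > 0`,
`‖ψ‖² - ⟨ψ, e^{-tH}ψ⟩ ≤ sqIncr t ψ / 2 + (potential term) + (exit term)`. [folklore] -/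
private theorem pairing_lower_bound_gsfk {v : ℝ → ℝ≥0∞} (hv : Measurable v) {C : ℝ≥0} (hC : ∀ r, v r ≤ C)
    (L : ℝ) {ψ : Config N → ℝ} (hψm : Measurable ψ) {M : ℝ} (hM : ∀ X, |ψ X| ≤ M)
    (hint : Integrable ψ volume) (hψ2 : MemLp ψ 2 volume) (t : ℝ≥0) :
    (∫ X, ψ X ^ 2) - ∫ X, ψ X * fkReal v L t ψ X ≤
      (sqIncr t ψ).toReal / 2 +
      (∫⁻ X, ∫⁻ ω, ‖ψ X‖ₑ * ‖ψ (X + displacement t ω)‖ₑ * pathAction v t X ω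
        ∂wienerPaths N ∂volume).toReal +
      (∫⁻ X, ∫⁻ ω, (survives L t X)ᶜ.indicator (1 : PathSpace N → ℝ≥0∞) ω *
        (‖ψ X‖ₑ * ‖ψ (X + displacement t ω)‖ₑ) ∂wienerPaths N ∂volume).toReal := by
  have ht0 : (0 : ℝ) ≤ t := t.coe_nonneg
  have hM0 : 0 ≤ M := (abs_nonneg _).trans (hM 0)
  set CV : ℝ≥0 := (N * N : ℕ) * C with hCVdef
  have hAle : ∀ (X : Config N) (ω : PathSpace N), pathAction v t X ω ≤ (CV : ℝ≥0∞) * ENNReal.ofReal t := by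
    intro X ω
    have := pathAction_le_of_le (C := (C : ℝ≥0∞)) (fun r => hC r) t X ω
    simpa [hCVdef, mul_assoc] using this
  have hAtop : ∀ (X : Config N) (ω : PathSpace N), pathAction v t X ω ≠ ⊤ := fun X ω =>
    ne_top_of_le_ne_top (ENNReal.mul_ne_top ENNReal.coe_ne_top ENNReal.ofReal_ne_top) (hAle X ω)
  have hAreal : ∀ (X : Config N) (ω : PathSpace N), (pathAction v t X ω).toReal ≤ CV * t := by
    intro X ω
    have := ENNReal.toReal_mono (ENNReal.mul_ne_top ENNReal.coe_ne_top ENNReal.ofReal_ne_top) (hAle X ω)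
    rwa [ENNReal.toReal_mul, ENNReal.coe_toReal, ENNReal.toReal_ofReal ht0] at this
  -- the world-line at time `t` (real time `↑t`) is `X + displacement t ω`
  have hwl : ∀ (X : Config N) (ω : PathSpace N), worldLine X ω ((t : ℝ)).toNNReal = X + displacement t ω := by
    intro X ω; rw [Real.toNNReal_coe]; rfl
  -- notation for the three integrands
  set a : Config N → PathSpace N → ℝ := fun X ω => ψ X * ψ (X + displacement t ω) with ha
  set b : Config N → PathSpace N → ℝ := fun X ω =>
    |ψ X| * |ψ (X + displacement t ω)| * (pathAction v t X ω).toReal with hb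
  set c : Config N → PathSpace N → ℝ := fun X ω =>
    |ψ X| * |ψ (X + displacement t ω)| * (survives L t X)ᶜ.indicator (fun _ => (1 : ℝ)) ω with hc
  -- joint measurability
  have hcompm : Measurable fun p : Config N × PathSpace N => ψ (p.1 + displacement t p.2) :=
    hψm.comp (measurable_fst.add ((measurable_displacement t).comp measurable_snd))
  have ham : Measurable fun p : Config N × PathSpace N => a p.1 p.2 := (hψm.comp measurable_fst).mul hcompm
  have hbm : Measurable fun p : Config N × PathSpace N => b p.1 p.2 :=
    ((hψm.comp measurable_fst).abs.mul hcompm.abs).mul (measurable_pathAction_uncurry_gsfk hv t).ennreal_toReal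
  have hcm : Measurable fun p : Config N × PathSpace N => c p.1 p.2 :=
    ((hψm.comp measurable_fst).abs.mul hcompm.abs).mul (measurable_exit_indicator_gsfk L t)
  have hwm : Measurable fun p : Config N × PathSpace N =>
      ψ p.1 * ((fkWeight v L t p.1 p.2).toReal * ψ (p.1 + displacement t p.2)) :=
    (hψm.comp measurable_fst).mul ((measurable_fkWeight_uncurry hv L t).ennreal_toReal.mul hcompm)
  -- pointwise bounds
  have hab : ∀ X ω, |a X ω| ≤ M * M := fun X ω => by
    simp only [ha, abs_mul]; exact mul_le_mul (hM _) (hM _) (abs_nonneg _) hM0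
  have hbb : ∀ X ω, |b X ω| ≤ |ψ X| * (M * (CV * t)) := fun X ω => by
    simp only [hb, abs_mul, abs_abs, abs_of_nonneg ENNReal.toReal_nonneg, mul_assoc]
    exact mul_le_mul_of_nonneg_left (mul_le_mul (hM _) (hAreal X ω) ENNReal.toReal_nonneg hM0)
      (abs_nonneg _)
  have hcb : ∀ X ω, |c X ω| ≤ |ψ X| * M := fun X ω => by
    simp only [hc, abs_mul, abs_abs, mul_assoc]
    refine mul_le_mul_of_nonneg_left ?_ (abs_nonneg _)
    calc |ψ (X + displacement t ω)| * |(survives L t X)ᶜ.indicator (fun _ => (1 : ℝ)) ω| ≤ M * 1 := by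
          refine mul_le_mul (hM _) ?_ (abs_nonneg _) hM0
          by_cases hω : ω ∈ (survives L t X)ᶜ <;> simp [hω]
      _ = M := mul_one M
  have hwb : ∀ X ω, |ψ X * ((fkWeight v L t X ω).toReal * ψ (X + displacement t ω))| ≤ M * M := by
    intro X ω
    rw [abs_mul, abs_mul, abs_of_nonneg ENNReal.toReal_nonneg]
    calc |ψ X| * ((fkWeight v L t X ω).toReal * |ψ (X + displacement t ω)|) ≤ M * (1 * M) :=
          mul_le_mul (hM _) (mul_le_mul (toReal_fkWeight_le_one_aux_gsfk _ _ _ _ _) (hM _) (abs_nonneg _)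
            zero_le_one) (by positivity) hM0
      _ = M * M := by ring
  -- inner integrability (fixed `X`)
  have hia : ∀ X, Integrable (a X) (wienerPaths N) := fun X =>
    Integrable.of_bound (ham.comp measurable_prodMk_left).aestronglyMeasurable (M * M)
      (Eventually.of_forall fun ω => by rw [Real.norm_eq_abs]; exact hab X ω)
  have hib : ∀ X, Integrable (b X) (wienerPaths N) := fun X =>
    Integrable.of_bound (hbm.comp measurable_prodMk_left).aestronglyMeasurable (|ψ X| * (M * (CV * t)))
      (Eventually.of_forall fun ω => by rw [Real.norm_eq_abs]; exact hbb X ω)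
  have hic : ∀ X, Integrable (c X) (wienerPaths N) := fun X =>
    Integrable.of_bound (hcm.comp measurable_prodMk_left).aestronglyMeasurable (|ψ X| * M)
      (Eventually.of_forall fun ω => by rw [Real.norm_eq_abs]; exact hcb X ω)
  have hiw : ∀ X, Integrable (fun ω => ψ X * ((fkWeight v L t X ω).toReal * ψ (X + displacement t ω)))
      (wienerPaths N) := fun X =>
    Integrable.of_bound (hwm.comp measurable_prodMk_left).aestronglyMeasurable (M * M)
      (Eventually.of_forall fun ω => by rw [Real.norm_eq_abs]; exact hwb X ω)
  -- Step 1: the pairing as a double integral, and the inner lower bound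
  have hpair : ∀ X, ψ X * fkReal v L t ψ X =
      ∫ ω, ψ X * ((fkWeight v L t X ω).toReal * ψ (X + displacement t ω)) ∂wienerPaths N := by
    intro X
    rw [fkReal, ← MeasureTheory.integral_const_mul]
    refine integral_congr_ae (Eventually.of_forall fun ω => ?_)
    simp only [hwl]
  have hinner : ∀ X, (∫ ω, a X ω ∂wienerPaths N) - (∫ ω, b X ω ∂wienerPaths N) -
      (∫ ω, c X ω ∂wienerPaths N) ≤ ψ X * fkReal v L t ψ X := by
    intro X
    have hiab : Integrable (fun ω => a X ω - b X ω) (wienerPaths N) := (hia X).sub (hib X)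
    have hiabc : Integrable (fun ω => a X ω - b X ω - c X ω) (wienerPaths N) := hiab.sub (hic X)
    rw [hpair X, ← integral_sub (hia X) (hib X), ← integral_sub hiab (hic X)]
    refine integral_mono hiabc (hiw X) fun ω => ?_
    exact pairing_integrand_ge_gsfk hC L _ ψ X ω (X + displacement t ω)
  -- Step 2: outer integrability (everything is dominated by a multiple of `|ψ X|`)
  have hdom : ∀ (F : Config N → PathSpace N → ℝ) (K : ℝ), (Measurable fun p : Config N × PathSpace N =>
      F p.1 p.2) → (∀ X ω, |F X ω| ≤ |ψ X| * K) →
      Integrable (fun X => ∫ ω, F X ω ∂wienerPaths N) volume := by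
    intro F K hFm hFb
    refine Integrable.mono' (hint.norm.mul_const K)
      (hFm.stronglyMeasurable.integral_prod_right' (ν := wienerPaths N)).aestronglyMeasurable
      (Eventually.of_forall fun X => ?_)
    have h := norm_integral_le_of_norm_le_const (μ := wienerPaths N) (C := |ψ X| * K) (f := F X)
      (Eventually.of_forall fun ω => by rw [Real.norm_eq_abs]; exact hFb X ω)
    rwa [probReal_univ, mul_one, ← Real.norm_eq_abs (ψ X)] at h
  have hIa : Integrable (fun X => ∫ ω, a X ω ∂wienerPaths N) volume :=
    hdom a M ham fun X ω => by
      simp only [ha, abs_mul]; exact mul_le_mul_of_nonneg_left (hM _) (abs_nonneg _)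
  have hIb : Integrable (fun X => ∫ ω, b X ω ∂wienerPaths N) volume := hdom b _ hbm hbb
  have hIc : Integrable (fun X => ∫ ω, c X ω ∂wienerPaths N) volume := hdom c _ hcm hcb
  have hIw : Integrable (fun X => ψ X * fkReal v L t ψ X) volume := by
    refine Integrable.mono' (hint.norm.mul_const M) (hψm.mul (measurable_fkReal hv L _ hψm)).aestronglyMeasurable
      (Eventually.of_forall fun X => ?_)
    simp only [norm_mul, Real.norm_eq_abs]
    exact mul_le_mul_of_nonneg_left (abs_fkReal_le_of_bound_gsfk v L _ hM X) (abs_nonneg _)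
  -- Step 3: integrate the inner bound
  have houter : (∫ X, ∫ ω, a X ω ∂wienerPaths N) - (∫ X, ∫ ω, b X ω ∂wienerPaths N) -
      (∫ X, ∫ ω, c X ω ∂wienerPaths N) ≤ ∫ X, ψ X * fkReal v L t ψ X := by
    have hIab : Integrable (fun X => (∫ ω, a X ω ∂wienerPaths N) - ∫ ω, b X ω ∂wienerPaths N) volume :=
      hIa.sub hIb
    have hIabc : Integrable (fun X => (∫ ω, a X ω ∂wienerPaths N) - (∫ ω, b X ω ∂wienerPaths N) -
        ∫ ω, c X ω ∂wienerPaths N) volume := hIab.sub hIc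
    rw [← integral_sub hIa hIb, ← integral_sub hIab hIc]
    exact integral_mono hIabc hIw hinner
  -- Step 4: identify the three double integrals
  have hA : ∫ X, ∫ ω, a X ω ∂wienerPaths N = (∫ X, ψ X ^ 2) - (sqIncr t ψ).toReal / 2 := by
    rw [← integral_mul_integral_shift_eq hψm hψ2 t]
    refine integral_congr_ae (Eventually.of_forall fun X => ?_)
    simp only [ha]
    exact MeasureTheory.integral_const_mul _ _
  -- `b` and `c` are nonnegative with `ofReal` equal to the `[0,∞]` integrands
  have hbof : ∀ X ω, ENNReal.ofReal (b X ω) =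
      ‖ψ X‖ₑ * ‖ψ (X + displacement t ω)‖ₑ * pathAction v t X ω := by
    intro X ω
    simp only [hb]
    rw [ENNReal.ofReal_mul (by positivity), ENNReal.ofReal_mul (abs_nonneg _),
      ENNReal.ofReal_toReal (hAtop X ω), ← Real.enorm_eq_ofReal_abs, ← Real.enorm_eq_ofReal_abs]
  have hcof : ∀ X ω, ENNReal.ofReal (c X ω) =
      (survives L t X)ᶜ.indicator (1 : PathSpace N → ℝ≥0∞) ω *
        (‖ψ X‖ₑ * ‖ψ (X + displacement t ω)‖ₑ) := by
    intro X ω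
    simp only [hc]
    rw [ENNReal.ofReal_mul (by positivity), ENNReal.ofReal_mul (abs_nonneg _),
      ← Real.enorm_eq_ofReal_abs, ← Real.enorm_eq_ofReal_abs]
    by_cases hω : ω ∈ (survives L t X)ᶜ
    · rw [Set.indicator_of_mem hω, Set.indicator_of_mem hω]; simp
    · rw [Set.indicator_of_notMem hω, Set.indicator_of_notMem hω]; simp
  have hB : ∫ X, ∫ ω, b X ω ∂wienerPaths N =
      (∫⁻ X, ∫⁻ ω, ‖ψ X‖ₑ * ‖ψ (X + displacement t ω)‖ₑ * pathAction v t X ω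
        ∂wienerPaths N ∂volume).toReal := by
    have hin : ∀ X, ∫ ω, b X ω ∂wienerPaths N =
        (∫⁻ ω, ‖ψ X‖ₑ * ‖ψ (X + displacement t ω)‖ₑ * pathAction v t X ω ∂wienerPaths N).toReal := by
      intro X
      have hbX : AEStronglyMeasurable (b X) (wienerPaths N) :=
        (hbm.comp measurable_prodMk_left).aestronglyMeasurable
      have hb0 : 0 ≤ᵐ[wienerPaths N] b X := Eventually.of_forall fun ω => by
        simp only [hb, Pi.zero_apply]
        exact mul_nonneg (mul_nonneg (abs_nonneg _) (abs_nonneg _)) ENNReal.toReal_nonneg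
      rw [integral_eq_lintegral_of_nonneg_ae hb0 hbX]
      simp_rw [hbof]
    simp_rw [hin]
    have hFm : Measurable fun X : Config N => ∫⁻ ω, ‖ψ X‖ₑ * ‖ψ (X + displacement t ω)‖ₑ *
        pathAction v t X ω ∂wienerPaths N := by
      have : Measurable fun p : Config N × PathSpace N => ENNReal.ofReal (b p.1 p.2) :=
        ENNReal.measurable_ofReal.comp hbm
      simp_rw [hbof] at this
      exact this.lintegral_prod_right'
    refine integral_toReal hFm.aemeasurable (Eventually.of_forall fun X => ?_)
    calc ∫⁻ ω, ‖ψ X‖ₑ * ‖ψ (X + displacement t ω)‖ₑ * pathAction v t X ω ∂wienerPaths N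
        ≤ ∫⁻ _ω, ‖ψ X‖ₑ * ENNReal.ofReal M * ((CV : ℝ≥0∞) * ENNReal.ofReal t) ∂wienerPaths N := by
          refine lintegral_mono fun ω => ?_
          gcongr
          · rw [Real.enorm_eq_ofReal_abs]; exact ENNReal.ofReal_le_ofReal (hM _)
          · exact hAle X ω
      _ < ⊤ := by
          rw [lintegral_const, measure_univ, mul_one]
          exact ENNReal.mul_lt_top (ENNReal.mul_lt_top enorm_lt_top ENNReal.ofReal_lt_top)
            (ENNReal.mul_lt_top ENNReal.coe_lt_top ENNReal.ofReal_lt_top)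
  have hCc : ∫ X, ∫ ω, c X ω ∂wienerPaths N =
      (∫⁻ X, ∫⁻ ω, (survives L t X)ᶜ.indicator (1 : PathSpace N → ℝ≥0∞) ω *
        (‖ψ X‖ₑ * ‖ψ (X + displacement t ω)‖ₑ) ∂wienerPaths N ∂volume).toReal := by
    have hin : ∀ X, ∫ ω, c X ω ∂wienerPaths N =
        (∫⁻ ω, (survives L t X)ᶜ.indicator (1 : PathSpace N → ℝ≥0∞) ω *
          (‖ψ X‖ₑ * ‖ψ (X + displacement t ω)‖ₑ) ∂wienerPaths N).toReal := by
      intro X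
      have hcX : AEStronglyMeasurable (c X) (wienerPaths N) :=
        (hcm.comp measurable_prodMk_left).aestronglyMeasurable
      have hc0 : 0 ≤ᵐ[wienerPaths N] c X := Eventually.of_forall fun ω => by
        simp only [hc, Pi.zero_apply]
        refine mul_nonneg (mul_nonneg (abs_nonneg _) (abs_nonneg _)) ?_
        exact Set.indicator_nonneg (fun _ _ => zero_le_one) _
      rw [integral_eq_lintegral_of_nonneg_ae hc0 hcX]
      simp_rw [hcof]
    simp_rw [hin]
    have hFm : Measurable fun X : Config N => ∫⁻ ω, (survives L t X)ᶜ.indicator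
        (1 : PathSpace N → ℝ≥0∞) ω * (‖ψ X‖ₑ * ‖ψ (X + displacement t ω)‖ₑ) ∂wienerPaths N := by
      have : Measurable fun p : Config N × PathSpace N => ENNReal.ofReal (c p.1 p.2) :=
        ENNReal.measurable_ofReal.comp hcm
      simp_rw [hcof] at this
      exact this.lintegral_prod_right'
    refine integral_toReal hFm.aemeasurable (Eventually.of_forall fun X => ?_)
    calc ∫⁻ ω, (survives L t X)ᶜ.indicator (1 : PathSpace N → ℝ≥0∞) ω *
          (‖ψ X‖ₑ * ‖ψ (X + displacement t ω)‖ₑ) ∂wienerPaths N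
        ≤ ∫⁻ _ω, 1 * (‖ψ X‖ₑ * ENNReal.ofReal M) ∂wienerPaths N := by
          refine lintegral_mono fun ω => ?_
          gcongr
          · exact Set.indicator_le_self' (fun _ _ => zero_le_one) ω
          · rw [Real.enorm_eq_ofReal_abs]; exact ENNReal.ofReal_le_ofReal (hM _)
      _ < ⊤ := by
          rw [lintegral_const, measure_univ, mul_one, one_mul]
          exact ENNReal.mul_lt_top enorm_lt_top ENNReal.ofReal_lt_top
  rw [hA, hB, hCc] at houter
  linarith

/-! ### The form bound -/

/-- **Small-time upper bound of the killed Feynman–Kac form on `C¹` Dirichlet functions.**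
For a `C¹` real `ψ` vanishing off `Λ_L^N` (`L ≥ 0`), with `∫|∇ψ|² < ∞` and `∫Vψ² < ∞`, and a
measurable pair potential `v ≤ C`, there is `K ≥ 0` with, for all `t > 0`,
`‖ψ‖² - ⟨ψ, e^{-tH_N} ψ⟩ ≤ t (∫|∇ψ|² + ∫ V ψ²) + K t^{3/2}`. This is the upper bound
`lim sup t⁻¹⟨ψ - T_tψ, ψ⟩ ≤ 𝓔[ψ]` of Chung–Zhao's Prop 3.29 for the class of trial functions of
`groundStateEnergy`. [cite: ChungZhao1995, Thm 3.27 and Prop 3.29 (81)] -/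
private theorem form_upper_bound_gsfk {v : ℝ → ℝ≥0∞} (hv : Measurable v) {C : ℝ≥0} (hC : ∀ r, v r ≤ C)
    {L : ℝ} (hL : 0 ≤ L) {ψ : Config N → ℝ} (hψ : ContDiff ℝ 1 ψ)
    (h0 : ∀ X, X ∉ boxN N L → ψ X = 0) (hkin : ∫⁻ X, realKinetic ψ X ≠ ⊤)
    (hpot : ∫⁻ X, ENNReal.ofReal (ψ X ^ 2) * interaction v X ≠ ⊤) :
    ∃ K : ℝ, 0 ≤ K ∧ ∀ t : ℝ≥0, t ≠ 0 →
      (∫ X, ψ X ^ 2) - ∫ X, ψ X * fkReal v L t ψ X ≤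
        t * ((∫⁻ X, realKinetic ψ X).toReal + (∫⁻ X, ENNReal.ofReal (ψ X ^ 2) * interaction v X).toReal)
          + K * (t * Real.sqrt t) := by
  have hcs := hasCompactSupport_of_eq_zero_gsfk h0
  have hψm : Measurable ψ := hψ.continuous.measurable
  obtain ⟨G, hG, hLip⟩ := exists_lipschitz_of_contDiff_gsfk hψ h0
  obtain ⟨M, hM0, hM⟩ := exists_bound_of_contDiff_gsfk hψ h0
  have hint : Integrable ψ volume := hψ.continuous.integrable_of_hasCompactSupport hcs
  have hψ2 : MemLp ψ 2 volume := hψ.continuous.memLp_of_hasCompactSupport hcs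
  have hL1 : ∫⁻ X, ‖ψ X‖ₑ ≠ ⊤ := hint.2.ne
  set I1 : ℝ := (∫⁻ X, ‖ψ X‖ₑ).toReal with hI1
  set K2 : ℝ := 3 * (((N * N : ℕ) : ℝ) * C) * G * (Real.sqrt 2 * ((3 * N : ℕ) * 2)) * I1 with hK2
  set K3 : ℝ := 792 * Real.sqrt 2 * (N : ℝ) ^ 2 * G ^ 2 * L ^ (3 * N - 1) with hK3
  have hK2nn : 0 ≤ K2 := by positivity
  have hK3nn : 0 ≤ K3 := by positivity
  refine ⟨K2 + K3, by positivity, fun t ht => ?_⟩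
  have ht' : (0 : ℝ) < t := lt_of_le_of_ne t.coe_nonneg (fun h => ht (by exact_mod_cast h.symm))
  have hpair := pairing_lower_bound_gsfk hv hC L hψm hM hint hψ2 t
  -- the free term
  have h1 : (sqIncr t ψ).toReal / 2 ≤ t * (∫⁻ X, realKinetic ψ X).toReal := by
    have h := sqIncr_le_kinetic hψ t
    have hfin : ENNReal.ofReal (2 * t) * ∫⁻ Y, realKinetic ψ Y ≠ ⊤ :=
      ENNReal.mul_ne_top ENNReal.ofReal_ne_top hkin
    have := ENNReal.toReal_mono hfin h
    rw [ENNReal.toReal_mul, ENNReal.toReal_ofReal (by positivity)] at this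
    linarith
  -- the potential term
  have h2 : (∫⁻ X, ∫⁻ ω, ‖ψ X‖ₑ * ‖ψ (X + displacement t ω)‖ₑ * pathAction v t X ω
      ∂wienerPaths N ∂volume).toReal ≤
      t * (∫⁻ X, ENNReal.ofReal (ψ X ^ 2) * interaction v X).toReal + K2 * (t * Real.sqrt t) := by
    have h := lintegral_potential_term_le_gsfk hv hC hψm hG hLip ht
    have hfin : ENNReal.ofReal t * (∫⁻ X, ENNReal.ofReal (ψ X ^ 2) * interaction v X) +
        ENNReal.ofReal (t * (3 * (((N * N : ℕ) : ℝ) * C) * G *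
          (Real.sqrt 2 * ((3 * N : ℕ) * (2 * Real.sqrt t))))) * ∫⁻ X, ‖ψ X‖ₑ ≠ ⊤ :=
      ENNReal.add_ne_top.2 ⟨ENNReal.mul_ne_top ENNReal.ofReal_ne_top hpot,
        ENNReal.mul_ne_top ENNReal.ofReal_ne_top hL1⟩
    have := ENNReal.toReal_mono hfin h
    rw [ENNReal.toReal_add (ENNReal.mul_ne_top ENNReal.ofReal_ne_top hpot)
      (ENNReal.mul_ne_top ENNReal.ofReal_ne_top hL1), ENNReal.toReal_mul, ENNReal.toReal_mul,
      ENNReal.toReal_ofReal ht'.le, ENNReal.toReal_ofReal (by positivity)] at this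
    have heq : t * (3 * (((N * N : ℕ) : ℝ) * C) * G * (Real.sqrt 2 * ((3 * N : ℕ) * (2 * Real.sqrt t)))) *
        I1 = K2 * (t * Real.sqrt t) := by
      simp only [hK2]; ring
    linarith
  -- the exit term
  have h3 : (∫⁻ X, ∫⁻ ω, (survives L t X)ᶜ.indicator (1 : PathSpace N → ℝ≥0∞) ω *
      (‖ψ X‖ₑ * ‖ψ (X + displacement t ω)‖ₑ) ∂wienerPaths N ∂volume).toReal ≤ K3 * (t * Real.sqrt t) := by
    have h := lintegral_exit_le hL h0 hLip hG ht
    have := ENNReal.toReal_mono ENNReal.ofReal_ne_top h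
    rwa [ENNReal.toReal_ofReal (by positivity)] at this
  calc (∫ X, ψ X ^ 2) - ∫ X, ψ X * fkReal v L t ψ X ≤ _ := hpair
    _ ≤ t * (∫⁻ X, realKinetic ψ X).toReal +
        (t * (∫⁻ X, ENNReal.ofReal (ψ X ^ 2) * interaction v X).toReal + K2 * (t * Real.sqrt t)) +
        K3 * (t * Real.sqrt t) := add_le_add (add_le_add h1 h2) h3
    _ = _ := by ring

/-! ### Real and imaginary parts of a trial state -/

/-- `‖z‖² = (re z)² + (im z)²` in `[0, ∞]`. [folklore] -/
private theorem ennnorm_sq_eq_re_add_im_gsfk (z : ℂ) :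
    ((‖z‖₊ : ℝ≥0∞)) ^ 2 = ENNReal.ofReal (z.re ^ 2) + ENNReal.ofReal (z.im ^ 2) := by
  rw [← ENNReal.ofReal_add (sq_nonneg _) (sq_nonneg _), ← enorm_eq_nnnorm, ← ofReal_norm,
    ← ENNReal.ofReal_pow (norm_nonneg _)]
  congr 1
  rw [Complex.sq_norm, Complex.normSq_apply]
  ring

/-- Real part of a `C¹` complex function: derivative. [folklore] -/
private theorem fderiv_re_comp_gsfk {Ψ : Config N → ℂ} (hΨ : Differentiable ℝ Ψ) (X e : Config N) :
    fderiv ℝ (fun Y => (Ψ Y).re) X e = (fderiv ℝ Ψ X e).re := by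
  have h := (Complex.reCLM.hasFDerivAt.comp X (hΨ X).hasFDerivAt).fderiv
  rw [show (fun Y => (Ψ Y).re) = Complex.reCLM ∘ Ψ from rfl, h]
  rfl

/-- Imaginary part of a `C¹` complex function: derivative. [folklore] -/
private theorem fderiv_im_comp_gsfk {Ψ : Config N → ℂ} (hΨ : Differentiable ℝ Ψ) (X e : Config N) :
    fderiv ℝ (fun Y => (Ψ Y).im) X e = (fderiv ℝ Ψ X e).im := by
  have h := (Complex.imCLM.hasFDerivAt.comp X (hΨ X).hasFDerivAt).fderiv
  rw [show (fun Y => (Ψ Y).im) = Complex.imCLM ∘ Ψ from rfl, h]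
  rfl

/-- **The kinetic density splits into real and imaginary parts.** [folklore] -/
private theorem kineticDensity_eq_re_add_im_gsfk {Ψ : Config N → ℂ} (hΨ : Differentiable ℝ Ψ) (X : Config N) :
    kineticDensity Ψ X = realKinetic (fun Y => (Ψ Y).re) X + realKinetic (fun Y => (Ψ Y).im) X := by
  unfold kineticDensity realKinetic
  rw [← Finset.sum_add_distrib]
  refine Finset.sum_congr rfl fun i _ => ?_
  rw [← Finset.sum_add_distrib]
  refine Finset.sum_congr rfl fun k _ => ?_
  rw [ennnorm_sq_eq_re_add_im_gsfk, fderiv_re_comp_gsfk hΨ, fderiv_im_comp_gsfk hΨ]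
  congr 1
  · rw [← ENNReal.coe_pow, ← ENNReal.ofReal_coe_nnreal]
    congr 1; push_cast; rw [Real.norm_eq_abs, sq_abs]
  · rw [← ENNReal.coe_pow, ← ENNReal.ofReal_coe_nnreal]
    congr 1; push_cast; rw [Real.norm_eq_abs, sq_abs]

/-- **The energy of a trial state is the sum of the energies of its real and imaginary parts**,
`𝓔[Ψ] = 𝓔ℝ[re Ψ] + 𝓔ℝ[im Ψ]` with `𝓔ℝ[f] = ∫|∇f|² + ∫ V f²`, and the masses add up to one.
[cite: LSSY2005, §1.2 (1.16)] -/
private theorem energy_eq_re_add_im_gsfk {L : ℝ} {v : ℝ → ℝ≥0∞} (hv : Measurable v) (Ψ : TrialState N L) :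
    energy v Ψ =
      ((∫⁻ X, realKinetic (fun Y => (Ψ.ψ Y).re) X) +
        ∫⁻ X, ENNReal.ofReal ((Ψ.ψ X).re ^ 2) * interaction v X) +
      ((∫⁻ X, realKinetic (fun Y => (Ψ.ψ Y).im) X) +
        ∫⁻ X, ENNReal.ofReal ((Ψ.ψ X).im ^ 2) * interaction v X) := by
  have hd : Differentiable ℝ Ψ.ψ := Ψ.contDiff.differentiable one_ne_zero
  have hre : ContDiff ℝ 1 fun Y => (Ψ.ψ Y).re := Complex.reCLM.contDiff.comp Ψ.contDiff
  have him : ContDiff ℝ 1 fun Y => (Ψ.ψ Y).im := Complex.imCLM.contDiff.comp Ψ.contDiff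
  have hVm : Measurable (interaction (N := N) v) := measurable_interaction hv
  have hmr : Measurable fun Y => (Ψ.ψ Y).re := hre.continuous.measurable
  have hmi : Measurable fun Y => (Ψ.ψ Y).im := him.continuous.measurable
  have h1 : ∀ X, kineticDensity Ψ.ψ X + interaction v X * (‖Ψ.ψ X‖₊ : ℝ≥0∞) ^ 2 =
      (realKinetic (fun Y => (Ψ.ψ Y).re) X + ENNReal.ofReal ((Ψ.ψ X).re ^ 2) * interaction v X) +
      (realKinetic (fun Y => (Ψ.ψ Y).im) X + ENNReal.ofReal ((Ψ.ψ X).im ^ 2) * interaction v X) := by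
    intro X
    rw [kineticDensity_eq_re_add_im_gsfk hd, ennnorm_sq_eq_re_add_im_gsfk]
    ring
  unfold energy
  simp_rw [h1]
  have hm1 : Measurable fun X => realKinetic (fun Y => (Ψ.ψ Y).re) X +
      ENNReal.ofReal ((Ψ.ψ X).re ^ 2) * interaction v X :=
    (measurable_realKinetic hre).add ((ENNReal.measurable_ofReal.comp (hmr.pow_const 2)).mul hVm)
  rw [lintegral_add_left hm1, lintegral_add_left (measurable_realKinetic hre),
    lintegral_add_left (measurable_realKinetic him)]

/-- The masses of the real and imaginary parts of a trial state add up to one. [folklore] -/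
private theorem lintegral_re_sq_add_im_sq_gsfk {L : ℝ} (Ψ : TrialState N L) :
    (∫⁻ X, ENNReal.ofReal ((Ψ.ψ X).re ^ 2)) + ∫⁻ X, ENNReal.ofReal ((Ψ.ψ X).im ^ 2) = 1 := by
  have hmr : Measurable fun Y => (Ψ.ψ Y).re :=
    (Complex.reCLM.contDiff.comp Ψ.contDiff).continuous.measurable
  have hm : Measurable fun X => ENNReal.ofReal ((Ψ.ψ X).re ^ 2) :=
    ENNReal.measurable_ofReal.comp (hmr.pow_const 2)
  rw [← lintegral_add_left hm, ← Ψ.norm_eq]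
  refine lintegral_congr fun X => ?_
  rw [ennnorm_sq_eq_re_add_im_gsfk]

/-! ### `λ ≤ 𝓔[Ψ]` from the Rayleigh bound of the semigroup -/

/-- The slope of `1 - e^{-λt}` at `0⁺` is `λ`. [folklore] -/
private theorem tendsto_one_sub_exp_div_gsfk (lam : ℝ) :
    Tendsto (fun t : ℝ => (1 - Real.exp (-(lam * t))) / t) (𝓝[>] 0) (𝓝 lam) := by
  have hd : HasDerivAt (fun t : ℝ => 1 - Real.exp (-(lam * t))) lam 0 := by
    have hfun : (fun t : ℝ => -(lam * t)) = fun t => (-lam) * t := by funext t; ring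
    have h1 : HasDerivAt (fun t : ℝ => -(lam * t)) (-lam) 0 := by
      rw [hfun]
      simpa using (hasDerivAt_id (0 : ℝ)).const_mul (-lam)
    have h2 : HasDerivAt (fun t : ℝ => Real.exp (-(lam * t))) (Real.exp (-(lam * 0)) * (-lam)) 0 :=
      h1.exp
    have h3 := h2.const_sub 1
    simp only [mul_zero, neg_zero, Real.exp_zero, one_mul, neg_neg] at h3
    exact h3
  have h := hd.tendsto_slope_zero_right
  refine h.congr' ?_
  filter_upwards [self_mem_nhdsWithin] with t ht
  simp only [zero_add, mul_zero, neg_zero, Real.exp_zero, sub_self, sub_zero, smul_eq_mul]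
  rw [div_eq_inv_mul]

/-- **`λ ≤ 𝓔[Ψ]` for every admissible trial state**, provided the Feynman–Kac semigroup obeys
the Rayleigh bound `⟨f, e^{-tH_N} f⟩ ≤ e^{-λt}‖f‖²` on `C¹` real functions vanishing off the box
(true for `λ` = the top of its spectrum): the variational side of Chung–Zhao's Prop 3.29
(`λ₁ ≤ -inf 𝓔`, here with `H_N = -Δ + V ≥ 0`). [cite: ChungZhao1995, Prop 3.29 (81)] -/
theorem ofReal_le_energy_of_pairing_le {L : ℝ} (hL : 0 ≤ L) {v : ℝ → ℝ≥0∞} (hv : Measurable v)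
    {C : ℝ≥0} (hC : ∀ r, v r ≤ C) {lam : ℝ}
    (htop : ∀ f : Config N → ℝ, ContDiff ℝ 1 f → (∀ X, X ∉ boxN N L → f X = 0) →
      ∀ t : ℝ, 0 < t → ∫ X, f X * fkReal v L t f X ≤ Real.exp (-(lam * t)) * ∫ X, f X ^ 2)
    (Ψ : TrialState N L) : ENNReal.ofReal lam ≤ energy v Ψ := by
  by_cases hE : energy v Ψ = ⊤
  · rw [hE]; exact le_top
  -- the two real components
  set f : Config N → ℝ := fun Y => (Ψ.ψ Y).re with hf
  set g : Config N → ℝ := fun Y => (Ψ.ψ Y).im with hg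
  have hfC : ContDiff ℝ 1 f := Complex.reCLM.contDiff.comp Ψ.contDiff
  have hgC : ContDiff ℝ 1 g := Complex.imCLM.contDiff.comp Ψ.contDiff
  have hf0 : ∀ X, X ∉ boxN N L → f X = 0 := fun X hX => by simp [hf, Ψ.eq_zero X hX]
  have hg0 : ∀ X, X ∉ boxN N L → g X = 0 := fun X hX => by simp [hg, Ψ.eq_zero X hX]
  have hsplit := energy_eq_re_add_im_gsfk hv Ψ
  have hmass := lintegral_re_sq_add_im_sq_gsfk Ψ
  -- finiteness of the pieces
  set Kf := ∫⁻ X, realKinetic f X with hKf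
  set Pf := ∫⁻ X, ENNReal.ofReal (f X ^ 2) * interaction v X with hPf
  set Kg := ∫⁻ X, realKinetic g X with hKg
  set Pg := ∫⁻ X, ENNReal.ofReal (g X ^ 2) * interaction v X with hPg
  have hEeq : energy v Ψ = (Kf + Pf) + (Kg + Pg) := hsplit
  have hfin : (Kf + Pf) + (Kg + Pg) ≠ ⊤ := hEeq ▸ hE
  have hKf' : Kf ≠ ⊤ := fun h => hfin (by simp [h])
  have hPf' : Pf ≠ ⊤ := fun h => hfin (by simp [h])
  have hKg' : Kg ≠ ⊤ := fun h => hfin (by simp [h])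
  have hPg' : Pg ≠ ⊤ := fun h => hfin (by simp [h])
  have hmf : (∫⁻ X, ENNReal.ofReal (f X ^ 2)) ≠ ⊤ := fun h => by
    have := hmass; rw [h] at this; simp at this
  have hmg : (∫⁻ X, ENNReal.ofReal (g X ^ 2)) ≠ ⊤ := fun h => by
    have := hmass; rw [h] at this; simp at this
  -- the real masses
  have hfsq : Integrable (fun X => f X ^ 2) volume :=
    (hfC.continuous.memLp_of_hasCompactSupport (hasCompactSupport_of_eq_zero_gsfk hf0)).integrable_sq
  have hgsq : Integrable (fun X => g X ^ 2) volume :=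
    (hgC.continuous.memLp_of_hasCompactSupport (hasCompactSupport_of_eq_zero_gsfk hg0)).integrable_sq
  have hmass' : (∫ X, f X ^ 2) + ∫ X, g X ^ 2 = 1 := by
    rw [← toReal_lintegral_sq hfsq, ← toReal_lintegral_sq hgsq, ← ENNReal.toReal_add hmf hmg, hmass,
      ENNReal.toReal_one]
  -- the form bounds
  obtain ⟨K1, hK1, hb1⟩ := form_upper_bound_gsfk hv hC hL hfC hf0 hKf' hPf'
  obtain ⟨K2, hK2, hb2⟩ := form_upper_bound_gsfk hv hC hL hgC hg0 hKg' hPg'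
  set E : ℝ := (Kf.toReal + Pf.toReal) + (Kg.toReal + Pg.toReal) with hEdef
  have hEreal : (energy v Ψ).toReal = E := by
    rw [hEeq, ENNReal.toReal_add (ENNReal.add_ne_top.2 ⟨hKf', hPf'⟩) (ENNReal.add_ne_top.2 ⟨hKg', hPg'⟩),
      ENNReal.toReal_add hKf' hPf', ENNReal.toReal_add hKg' hPg']
  -- the key inequality for every `t > 0`
  have hkey : ∀ t : ℝ, 0 < t → (1 - Real.exp (-(lam * t))) / t ≤ E + (K1 + K2) * Real.sqrt t := by
    intro t ht
    set s : ℝ≥0 := ⟨t, ht.le⟩ with hs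
    have hst : (s : ℝ) = t := rfl
    have hs0 : s ≠ 0 := fun h => ht.ne' (by rw [← hst, h]; rfl)
    have h1 := hb1 s hs0
    have h2 := hb2 s hs0
    have h3 := htop f hfC hf0 t ht
    have h4 := htop g hgC hg0 t ht
    rw [hst] at h1 h2
    have hsum : 1 - Real.exp (-(lam * t)) ≤ t * E + (K1 + K2) * (t * Real.sqrt t) := by
      have e1 : (∫ X, f X ^ 2) - ∫ X, f X * fkReal v L t f X ≥
          (1 - Real.exp (-(lam * t))) * ∫ X, f X ^ 2 := by nlinarith [h3]
      have e2 : (∫ X, g X ^ 2) - ∫ X, g X * fkReal v L t g X ≥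
          (1 - Real.exp (-(lam * t))) * ∫ X, g X ^ 2 := by nlinarith [h4]
      have e3 : (1 - Real.exp (-(lam * t))) * ((∫ X, f X ^ 2) + ∫ X, g X ^ 2) =
          1 - Real.exp (-(lam * t)) := by rw [hmass', mul_one]
      nlinarith [e1, e2, e3, h1, h2]
    rw [div_le_iff₀ ht]
    nlinarith [hsum, Real.sqrt_nonneg t]
  -- pass to the limit `t → 0⁺`
  have hlim1 := tendsto_one_sub_exp_div_gsfk lam
  have hlim2 : Tendsto (fun t : ℝ => E + (K1 + K2) * Real.sqrt t) (𝓝[>] 0) (𝓝 E) := by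
    have hc : Continuous fun t : ℝ => E + (K1 + K2) * Real.sqrt t := by fun_prop
    have := hc.tendsto 0
    simp only [Real.sqrt_zero, mul_zero, add_zero] at this
    exact this.mono_left nhdsWithin_le_nhds
  have hle : lam ≤ E := le_of_tendsto_of_tendsto hlim1 hlim2
    (eventually_nhdsWithin_of_forall fun t ht => hkey t ht)
  calc ENNReal.ofReal lam ≤ ENNReal.ofReal E := ENNReal.ofReal_le_ofReal hle
    _ = energy v Ψ := by rw [← hEreal, ENNReal.ofReal_toReal hE]

/-- **`ENNReal.ofReal λ ≤ groundStateEnergy v N L`** under the Rayleigh bound of the Feynman–Kac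
semigroup on `C¹` Dirichlet functions: the variational ground-state energy (infimum of `𝓔` over
the symmetric `C¹` Dirichlet core, [LSSY2005] (2.3)) is at least the top of the spectrum.
[cite: ChungZhao1995, Prop 3.29 (81)] -/
theorem ofReal_le_groundStateEnergy_of_pairing_le {L : ℝ} (hL : 0 ≤ L) {v : ℝ → ℝ≥0∞}
    (hv : Measurable v) {C : ℝ≥0} (hC : ∀ r, v r ≤ C) {lam : ℝ}
    (htop : ∀ f : Config N → ℝ, ContDiff ℝ 1 f → (∀ X, X ∉ boxN N L → f X = 0) →
      ∀ t : ℝ, 0 < t → ∫ X, f X * fkReal v L t f X ≤ Real.exp (-(lam * t)) * ∫ X, f X ^ 2) :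
    ENNReal.ofReal lam ≤ groundStateEnergy v N L :=
  le_iInf fun Ψ => ofReal_le_energy_of_pairing_le hL hv hC htop Ψ

end Literature.MathematicalPhysics.QuantumManyBody.BoseGas

end

/-!
# Part II — the eigenfunction side of the free form

## Ground-state Feynman–Kac: the free form of an eigenfunction (`limsup sqIncr/(2t) ≤ λ - ∫VΨ₀²`)

Topic `Literature/MathematicalPhysics/QuantumManyBody`; support file for the proof of the named
fact `Literature.MathematicalPhysics.QuantumManyBody.BoseGas.GroundStateFeynmanKac`, second half
of the variational identification of the top of the spectrum of the Feynman–Kac semigroup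
(Chung–Zhao (1995) Thm 3.27, Prop 3.29). If a continuous nonnegative normalised `Ψ₀` vanishing
off the box satisfies the (integrated) eigen-relation `e^{-λt} ≤ ⟨Ψ₀, e^{-tH_N} Ψ₀⟩` for all
`t > 0`, then its free small-time form is asymptotically at most `λ - ∫ V Ψ₀²`:

* `eigen_pairing_upper_bound` — the master inequality: for `t > 0` small and any `ε, δ` with
  `‖h‖ < δ ⇒ |Ψ₀(Y + h) - Ψ₀(Y)| ≤ ε`,
  `⟨Ψ₀, T_tΨ₀⟩ ≤ (1 - sqIncr t Ψ₀/2) - t ∫VΨ₀² + t·(explicit small) + (N²C t)²`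
  (weight `w ≤ e^{-∫₀ᵗV} ≤ 1 - ∫₀ᵗV + (∫₀ᵗV)²`, the square identity, translation invariance,
  uniform continuity of `Ψ₀` and Markov's inequality for `‖√2 b_s‖`);
* `sqIncr_div_eventually_le` — consequently, for every `K' > λ - ∫ V Ψ₀²`, eventually as
  `t → 0⁺`, `sqIncr t Ψ₀ / (2t) ≤ K'`.

Since `sqIncr t Ψ₀/(2t)` is the finite-difference kinetic energy of `Ψ₀`, this says
`"∫|∇Ψ₀|²" + ∫VΨ₀² ≤ λ` in the weak sense used by the trial-state construction of
`GroundStateFeynmanKacVariational.lean`.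

## References

* K. L. Chung, Z. Zhao, *From Brownian Motion to Schrödinger's Equation* (1995), Thm 3.27,
  Prop 3.29 (81). [ChungZhao1995]
-/

noncomputable section

namespace Literature.MathematicalPhysics.QuantumManyBody.BoseGas

open MeasureTheory ProbabilityTheory Filter Set
open scoped ENNReal NNReal Topology
open Literature.Probability.Process

variable {N : ℕ}

/-! ### Pointwise weight bounds -/

/-- `w_t(X, ω) ≤ e^{-∫₀ᵗ V}` (killing only decreases the weight). [folklore] -/
private theorem toReal_fkWeight_le_exp_gsfk (v : ℝ → ℝ≥0∞) (L t : ℝ) (X : Config N) (ω : PathSpace N)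
    (hA : pathAction v t X ω ≠ ⊤) :
    (fkWeight v L t X ω).toReal ≤ Real.exp (-(pathAction v t X ω).toReal) := by
  rw [fkWeight]
  by_cases hω : ω ∈ survives L t X
  · rw [Set.indicator_of_mem hω, expNeg, if_neg hA, ENNReal.toReal_ofReal (Real.exp_pos _).le]
  · rw [Set.indicator_of_notMem hω]; simp [(Real.exp_pos _).le]

/-- `e^{-a} ≤ 1 - a + a²` for `0 ≤ a ≤ 1`. [folklore] -/
private theorem exp_neg_le_one_sub_add_sq_gsfk {a : ℝ} (ha0 : 0 ≤ a) (ha1 : a ≤ 1) :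
    Real.exp (-a) ≤ 1 - a + a ^ 2 := by
  have h := Real.abs_exp_sub_one_sub_id_le (x := -a) (by rw [abs_neg, abs_of_nonneg ha0]; exact ha1)
  rw [neg_sq] at h
  linarith [(abs_le.1 h).2]

/-- **Pointwise upper bound for the eigen-pairing integrand** (nonnegative `Ψ₀ ≤ M`, action
`a = ∫₀ᵗV ≤ N²Ct ≤ 1`): `Ψ₀(X) w Ψ₀(Y) ≤ Ψ₀(X)Ψ₀(Y) - Ψ₀(X)² a + Ψ₀(X)|Ψ₀(Y) - Ψ₀(X)| N²Ct
+ Ψ₀(X)Ψ₀(Y) (N²Ct)²`. [folklore] -/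
private theorem eigen_integrand_le_gsfk {v : ℝ → ℝ≥0∞} {C : ℝ≥0} (hC : ∀ r, v r ≤ C) (L : ℝ) {t : ℝ}
    (ht : 0 ≤ t) (hsmall : ((N * N : ℕ) : ℝ) * C * t ≤ 1) {Ψ₀ : Config N → ℝ} (hnn : ∀ X, 0 ≤ Ψ₀ X)
    (X : Config N) (ω : PathSpace N) (Y : Config N) :
    Ψ₀ X * ((fkWeight v L t X ω).toReal * Ψ₀ Y) ≤
      Ψ₀ X * Ψ₀ Y - Ψ₀ X ^ 2 * (pathAction v t X ω).toReal +
        Ψ₀ X * |Ψ₀ Y - Ψ₀ X| * (((N * N : ℕ) : ℝ) * C * t) +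
        Ψ₀ X * Ψ₀ Y * (((N * N : ℕ) : ℝ) * C * t) ^ 2 := by
  set CVt : ℝ := ((N * N : ℕ) : ℝ) * C * t with hCVt
  have hA : pathAction v t X ω ≤ (N * N : ℕ) * (C : ℝ≥0∞) * ENNReal.ofReal t :=
    pathAction_le_of_le (C := (C : ℝ≥0∞)) (fun r => hC r) t X ω
  have hAtop : pathAction v t X ω ≠ ⊤ :=
    ne_top_of_le_ne_top (ENNReal.mul_ne_top (ENNReal.mul_ne_top (ENNReal.natCast_ne_top _)
      ENNReal.coe_ne_top) ENNReal.ofReal_ne_top) hA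
  set a := (pathAction v t X ω).toReal with ha
  have ha0 : 0 ≤ a := ENNReal.toReal_nonneg
  have haCV : a ≤ CVt := by
    have := ENNReal.toReal_mono (ENNReal.mul_ne_top (ENNReal.mul_ne_top (ENNReal.natCast_ne_top _)
      ENNReal.coe_ne_top) ENNReal.ofReal_ne_top) hA
    rw [ENNReal.toReal_mul, ENNReal.toReal_mul, ENNReal.toReal_ofReal ht] at this
    simpa [hCVt] using this
  have ha1 : a ≤ 1 := haCV.trans hsmall
  have hw := toReal_fkWeight_le_exp_gsfk v L t X ω hAtop
  have hexp := exp_neg_le_one_sub_add_sq_gsfk ha0 ha1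
  have hP : 0 ≤ Ψ₀ X * Ψ₀ Y := mul_nonneg (hnn X) (hnn Y)
  -- `Ψ₀X w Ψ₀Y ≤ Ψ₀X Ψ₀Y (1 - a + a²)`
  have h1 : Ψ₀ X * ((fkWeight v L t X ω).toReal * Ψ₀ Y) ≤ Ψ₀ X * Ψ₀ Y * (1 - a + a ^ 2) := by
    calc Ψ₀ X * ((fkWeight v L t X ω).toReal * Ψ₀ Y) = Ψ₀ X * Ψ₀ Y * (fkWeight v L t X ω).toReal := by ring
      _ ≤ Ψ₀ X * Ψ₀ Y * (1 - a + a ^ 2) := mul_le_mul_of_nonneg_left (hw.trans hexp) hP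
  -- `-Ψ₀X Ψ₀Y a ≤ -Ψ₀X² a + Ψ₀X |Ψ₀Y - Ψ₀X| a`
  have h2 : -(Ψ₀ X * Ψ₀ Y * a) ≤ -(Ψ₀ X ^ 2 * a) + Ψ₀ X * |Ψ₀ Y - Ψ₀ X| * CVt := by
    have h3 : Ψ₀ X * (Ψ₀ X - Ψ₀ Y) * a ≤ Ψ₀ X * |Ψ₀ Y - Ψ₀ X| * CVt := by
      calc Ψ₀ X * (Ψ₀ X - Ψ₀ Y) * a ≤ Ψ₀ X * |Ψ₀ Y - Ψ₀ X| * a := by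
            refine mul_le_mul_of_nonneg_right (mul_le_mul_of_nonneg_left ?_ (hnn X)) ha0
            rw [abs_sub_comm]; exact le_abs_self _
        _ ≤ Ψ₀ X * |Ψ₀ Y - Ψ₀ X| * CVt :=
            mul_le_mul_of_nonneg_left haCV (mul_nonneg (hnn X) (abs_nonneg _))
    nlinarith [h3]
  -- `a² ≤ CVt²`
  have h4 : Ψ₀ X * Ψ₀ Y * a ^ 2 ≤ Ψ₀ X * Ψ₀ Y * CVt ^ 2 :=
    mul_le_mul_of_nonneg_left (pow_le_pow_left₀ ha0 haCV 2) hP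
  nlinarith [h1, h2, h4]

/-! ### The translated-mass error and Markov -/

/-- **`L¹`-continuity of `Ψ₀²` under translation, quantitatively**: if `‖h‖ < δ ⇒
|Ψ₀(Y + h) - Ψ₀(Y)| ≤ ε` and `Ψ₀ ≥ 0`, then for every `h`,
`∫ |Ψ₀(Y - h)² - Ψ₀(Y)²| dY ≤ 2ε‖Ψ₀‖₁ + 𝟙{δ ≤ ‖h‖} · 2∫Ψ₀²`. [folklore] -/
private theorem lintegral_abs_sq_shift_sub_le_gsfk {Ψ₀ : Config N → ℝ} (hΨm : Measurable Ψ₀)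
    {ε δ : ℝ} (hε : 0 ≤ ε) (hUC : ∀ Y h, ‖h‖ < δ → |Ψ₀ (Y + h) - Ψ₀ Y| ≤ ε) (h : Config N) :
    ∫⁻ Y, ‖Ψ₀ (Y - h) ^ 2 - Ψ₀ Y ^ 2‖ₑ ≤
      ENNReal.ofReal (2 * ε) * (∫⁻ Y, ‖Ψ₀ Y‖ₑ) +
        {h : Config N | δ ≤ ‖h‖}.indicator (fun _ => (2 : ℝ≥0∞)) h * ∫⁻ Y, ENNReal.ofReal (Ψ₀ Y ^ 2) := by
  have hme : Measurable fun Y : Config N => ‖Ψ₀ Y‖ₑ := hΨm.enorm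
  have hmeh : Measurable fun Y : Config N => ‖Ψ₀ (Y - h)‖ₑ := (hΨm.comp (measurable_sub_const h)).enorm
  have htr1 : ∫⁻ Y, ‖Ψ₀ (Y - h)‖ₑ = ∫⁻ Y, ‖Ψ₀ Y‖ₑ :=
    lintegral_sub_right_eq_self (μ := (volume : Measure (Config N))) (fun Y => ‖Ψ₀ Y‖ₑ) h
  have htr2 : ∫⁻ Y, ENNReal.ofReal (Ψ₀ (Y - h) ^ 2) = ∫⁻ Y, ENNReal.ofReal (Ψ₀ Y ^ 2) :=
    lintegral_sub_right_eq_self (μ := (volume : Measure (Config N))) (fun Y => ENNReal.ofReal (Ψ₀ Y ^ 2)) h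
  by_cases hh : ‖h‖ < δ
  · -- small shift: uniform continuity
    rw [Set.indicator_of_notMem (show h ∉ {h : Config N | δ ≤ ‖h‖} from fun hm => absurd hm (not_le.2 hh)),
      zero_mul, add_zero]
    have hpt : ∀ Y, ‖Ψ₀ (Y - h) ^ 2 - Ψ₀ Y ^ 2‖ₑ ≤ ENNReal.ofReal ε * (‖Ψ₀ (Y - h)‖ₑ + ‖Ψ₀ Y‖ₑ) := by
      intro Y
      have hd : |Ψ₀ (Y - h) - Ψ₀ Y| ≤ ε := by
        have := hUC (Y - h) h (by simpa using hh)
        rw [sub_add_cancel] at this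
        rwa [abs_sub_comm] at this
      have h1 : |Ψ₀ (Y - h) ^ 2 - Ψ₀ Y ^ 2| ≤ ε * (|Ψ₀ (Y - h)| + |Ψ₀ Y|) := by
        rw [show Ψ₀ (Y - h) ^ 2 - Ψ₀ Y ^ 2 = (Ψ₀ (Y - h) - Ψ₀ Y) * (Ψ₀ (Y - h) + Ψ₀ Y) by ring, abs_mul]
        exact mul_le_mul hd (abs_add_le _ _) (abs_nonneg _) hε
      calc ‖Ψ₀ (Y - h) ^ 2 - Ψ₀ Y ^ 2‖ₑ = ENNReal.ofReal |Ψ₀ (Y - h) ^ 2 - Ψ₀ Y ^ 2| :=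
            Real.enorm_eq_ofReal_abs _
        _ ≤ ENNReal.ofReal (ε * (|Ψ₀ (Y - h)| + |Ψ₀ Y|)) := ENNReal.ofReal_le_ofReal h1
        _ = _ := by
            rw [ENNReal.ofReal_mul hε, ENNReal.ofReal_add (abs_nonneg _) (abs_nonneg _),
              ← Real.enorm_eq_ofReal_abs, ← Real.enorm_eq_ofReal_abs]
    have hsum : Measurable fun Y : Config N => ‖Ψ₀ (Y - h)‖ₑ + ‖Ψ₀ Y‖ₑ := hmeh.add hme
    calc ∫⁻ Y, ‖Ψ₀ (Y - h) ^ 2 - Ψ₀ Y ^ 2‖ₑ ≤ ∫⁻ Y, ENNReal.ofReal ε * (‖Ψ₀ (Y - h)‖ₑ + ‖Ψ₀ Y‖ₑ) :=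
          lintegral_mono hpt
      _ = ENNReal.ofReal ε * ((∫⁻ Y, ‖Ψ₀ (Y - h)‖ₑ) + ∫⁻ Y, ‖Ψ₀ Y‖ₑ) := by
          rw [lintegral_const_mul _ hsum, lintegral_add_left hmeh]
      _ = ENNReal.ofReal (2 * ε) * ∫⁻ Y, ‖Ψ₀ Y‖ₑ := by
          rw [htr1, ← two_mul, ← mul_assoc, ENNReal.ofReal_mul zero_le_two, ENNReal.ofReal_ofNat, mul_comm _ 2]
  · -- large shift: crude bound `|u(Y-h) - u(Y)| ≤ u(Y-h) + u(Y)`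
    rw [Set.indicator_of_mem (show h ∈ {h : Config N | δ ≤ ‖h‖} from not_lt.1 hh)]
    have hpt : ∀ Y, ‖Ψ₀ (Y - h) ^ 2 - Ψ₀ Y ^ 2‖ₑ ≤
        ENNReal.ofReal (Ψ₀ (Y - h) ^ 2) + ENNReal.ofReal (Ψ₀ Y ^ 2) := by
      intro Y
      rw [Real.enorm_eq_ofReal_abs, ← ENNReal.ofReal_add (sq_nonneg _) (sq_nonneg _)]
      refine ENNReal.ofReal_le_ofReal ?_
      have h1 := sq_nonneg (Ψ₀ (Y - h))
      have h2 := sq_nonneg (Ψ₀ Y)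
      exact abs_sub_le_iff.2 ⟨by linarith, by linarith⟩
    have hm2 : Measurable fun Y : Config N => ENNReal.ofReal (Ψ₀ (Y - h) ^ 2) :=
      ENNReal.measurable_ofReal.comp ((hΨm.comp (measurable_sub_const h)).pow_const 2)
    calc ∫⁻ Y, ‖Ψ₀ (Y - h) ^ 2 - Ψ₀ Y ^ 2‖ₑ
        ≤ ∫⁻ Y, (ENNReal.ofReal (Ψ₀ (Y - h) ^ 2) + ENNReal.ofReal (Ψ₀ Y ^ 2)) := lintegral_mono hpt
      _ = 2 * ∫⁻ Y, ENNReal.ofReal (Ψ₀ Y ^ 2) := by rw [lintegral_add_left hm2, htr2, two_mul]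
      _ ≤ _ := le_add_self

/-- **Markov for the displacement**: `P(δ ≤ ‖√2 b_s‖) ≤ (√2 · 3N · 2√t)/δ` for `s ≤ t`, `δ > 0`.
[folklore] -/
private theorem measure_norm_displacement_ge_le_gsfk {s t : ℝ≥0} (hs : s ≤ t) {δ : ℝ} (hδ : 0 < δ) :
    wienerPaths N {ω | δ ≤ ‖displacement s ω‖} ≤
      ENNReal.ofReal (Real.sqrt 2 * ((3 * N : ℕ) * (2 * Real.sqrt t)) / δ) := by
  have hm := mul_meas_ge_le_lintegral (μ := wienerPaths N) (measurable_displacement (N := N) s).enorm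
    (ENNReal.ofReal δ)
  have hset : {ω : PathSpace N | ENNReal.ofReal δ ≤ ‖displacement s ω‖ₑ} = {ω | δ ≤ ‖displacement s ω‖} := by
    ext ω
    simp only [Set.mem_setOf_eq]
    rw [← ofReal_norm, ENNReal.ofReal_le_ofReal_iff (norm_nonneg _)]
  rw [hset] at hm
  have hb := hm.trans (lintegral_norm_displacement_le hs)
  have hδ' : ENNReal.ofReal δ ≠ 0 := (ENNReal.ofReal_pos.2 hδ).ne'
  calc wienerPaths N {ω | δ ≤ ‖displacement s ω‖}
      = (ENNReal.ofReal δ)⁻¹ * (ENNReal.ofReal δ * wienerPaths N {ω | δ ≤ ‖displacement s ω‖}) := by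
        rw [← mul_assoc, ENNReal.inv_mul_cancel hδ' ENNReal.ofReal_ne_top, one_mul]
    _ ≤ (ENNReal.ofReal δ)⁻¹ * ENNReal.ofReal (Real.sqrt 2 * ((3 * N : ℕ) * (2 * Real.sqrt t))) :=
        mul_le_mul' le_rfl hb
    _ = _ := by
        rw [mul_comm, ← div_eq_mul_inv, ENNReal.ofReal_div_of_pos hδ]

/-! ### The main term from below -/

/-- **The potential term of a nonnegative `Ψ₀` from below** (in `[0, ∞]`, everything on one side):
with `P = ∫ Ψ₀² V`, `I₁ = ∫ Ψ₀`, `m = √2·3N·2√t` and `‖h‖<δ ⇒ |Ψ₀(Y+h)-Ψ₀(Y)| ≤ ε`,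
`t · P ≤ ∫dX E[Ψ₀(X)² ∫₀ᵗ V(B_s)ds] + t · N²C · (2εI₁ + 2(∫Ψ₀²) m/δ)`. [folklore] -/
private theorem ofReal_mul_potential_le_gsfk {v : ℝ → ℝ≥0∞} (hv : Measurable v) {C : ℝ≥0} (hC : ∀ r, v r ≤ C)
    {Ψ₀ : Config N → ℝ} (hΨm : Measurable Ψ₀)
    {ε δ : ℝ} (hε : 0 ≤ ε) (hδ : 0 < δ) (hUC : ∀ Y h, ‖h‖ < δ → |Ψ₀ (Y + h) - Ψ₀ Y| ≤ ε)
    (t : ℝ≥0) :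
    ENNReal.ofReal t * ∫⁻ X, ENNReal.ofReal (Ψ₀ X ^ 2) * interaction v X ≤
      (∫⁻ X, ∫⁻ ω, ENNReal.ofReal (Ψ₀ X ^ 2) * pathAction v t X ω ∂wienerPaths N ∂volume) +
        ENNReal.ofReal t * (((N * N : ℕ) * C : ℝ≥0) : ℝ≥0∞) *
          (ENNReal.ofReal (2 * ε) * (∫⁻ Y, ‖Ψ₀ Y‖ₑ) +
            2 * ENNReal.ofReal (Real.sqrt 2 * ((3 * N : ℕ) * (2 * Real.sqrt t)) / δ) *
              ∫⁻ Y, ENNReal.ofReal (Ψ₀ Y ^ 2)) := by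
  set CV : ℝ≥0 := (N * N : ℕ) * C with hCVdef
  set P : ℝ≥0∞ := ∫⁻ X, ENNReal.ofReal (Ψ₀ X ^ 2) * interaction v X with hP
  set I₁ : ℝ≥0∞ := ∫⁻ Y, ‖Ψ₀ Y‖ₑ with hI₁
  set U : ℝ≥0∞ := ∫⁻ Y, ENNReal.ofReal (Ψ₀ Y ^ 2) with hU
  set m : ℝ := Real.sqrt 2 * ((3 * N : ℕ) * (2 * Real.sqrt t)) with hm
  have hVm : Measurable (interaction (N := N) v) := measurable_interaction hv
  have hVle : ∀ X : Config N, interaction v X ≤ CV := fun X => by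
    have := interaction_le_of_le (C := (C : ℝ≥0∞)) (fun r => hC r) X
    simpa [hCVdef] using this
  -- lower bound of the shifted potential integral for a fixed shift `h`
  have hshift : ∀ h : Config N, P ≤ (∫⁻ X, ENNReal.ofReal (Ψ₀ X ^ 2) * interaction v (X + h)) +
      (CV : ℝ≥0∞) * ∫⁻ Y, ‖Ψ₀ (Y - h) ^ 2 - Ψ₀ Y ^ 2‖ₑ := by
    intro h
    have htr : ∫⁻ X, ENNReal.ofReal (Ψ₀ X ^ 2) * interaction v (X + h) =
        ∫⁻ Y, ENNReal.ofReal (Ψ₀ (Y - h) ^ 2) * interaction v Y := by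
      have := lintegral_add_right_eq_self (μ := (volume : Measure (Config N)))
        (fun Y => ENNReal.ofReal (Ψ₀ (Y - h) ^ 2) * interaction v Y) h
      simp only [add_sub_cancel_right] at this
      exact this
    rw [htr]
    have hm1 : Measurable fun Y : Config N => ENNReal.ofReal (Ψ₀ (Y - h) ^ 2) * interaction v Y :=
      (ENNReal.measurable_ofReal.comp ((hΨm.comp (measurable_sub_const h)).pow_const 2)).mul hVm
    have hmd : Measurable fun Y : Config N => ‖Ψ₀ (Y - h) ^ 2 - Ψ₀ Y ^ 2‖ₑ :=
      (((hΨm.comp (measurable_sub_const h)).pow_const 2).sub (hΨm.pow_const 2)).enorm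
    calc P ≤ ∫⁻ Y, (ENNReal.ofReal (Ψ₀ (Y - h) ^ 2) * interaction v Y +
          (CV : ℝ≥0∞) * ‖Ψ₀ (Y - h) ^ 2 - Ψ₀ Y ^ 2‖ₑ) := by
          refine lintegral_mono fun Y => ?_
          have h1 : ENNReal.ofReal (Ψ₀ Y ^ 2) ≤ ENNReal.ofReal (Ψ₀ (Y - h) ^ 2) + ‖Ψ₀ (Y - h) ^ 2 - Ψ₀ Y ^ 2‖ₑ := by
            rw [Real.enorm_eq_ofReal_abs, ← ENNReal.ofReal_add (sq_nonneg _) (abs_nonneg _)]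
            exact ENNReal.ofReal_le_ofReal (by linarith [neg_abs_le (Ψ₀ (Y - h) ^ 2 - Ψ₀ Y ^ 2)])
          calc ENNReal.ofReal (Ψ₀ Y ^ 2) * interaction v Y
              ≤ (ENNReal.ofReal (Ψ₀ (Y - h) ^ 2) + ‖Ψ₀ (Y - h) ^ 2 - Ψ₀ Y ^ 2‖ₑ) * interaction v Y :=
                mul_le_mul' h1 le_rfl
            _ = ENNReal.ofReal (Ψ₀ (Y - h) ^ 2) * interaction v Y +
                ‖Ψ₀ (Y - h) ^ 2 - Ψ₀ Y ^ 2‖ₑ * interaction v Y := add_mul _ _ _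
            _ ≤ _ := by
                gcongr ?_ + ?_
                · exact le_rfl
                · rw [mul_comm]; exact mul_le_mul' (hVle Y) le_rfl
      _ = _ := by rw [lintegral_add_left hm1, lintegral_const_mul _ hmd]
  -- expectation of the translation error along the displacement, `s ≤ t`
  have hE : ∀ s : ℝ≥0, s ≤ t → ∫⁻ ω, ∫⁻ Y, ‖Ψ₀ (Y - displacement s ω) ^ 2 - Ψ₀ Y ^ 2‖ₑ ∂volume ∂wienerPaths N ≤
      ENNReal.ofReal (2 * ε) * I₁ + 2 * ENNReal.ofReal (m / δ) * U := by
    intro s hs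
    have hset : MeasurableSet {ω : PathSpace N | δ ≤ ‖displacement s ω‖} :=
      measurableSet_le measurable_const (measurable_displacement s).norm
    calc ∫⁻ ω, ∫⁻ Y, ‖Ψ₀ (Y - displacement s ω) ^ 2 - Ψ₀ Y ^ 2‖ₑ ∂volume ∂wienerPaths N
        ≤ ∫⁻ ω, (ENNReal.ofReal (2 * ε) * I₁ +
            {h : Config N | δ ≤ ‖h‖}.indicator (fun _ => (2 : ℝ≥0∞)) (displacement s ω) * U) ∂wienerPaths N :=
          lintegral_mono fun ω => lintegral_abs_sq_shift_sub_le_gsfk hΨm hε hUC _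
      _ = ENNReal.ofReal (2 * ε) * I₁ + 2 * wienerPaths N {ω | δ ≤ ‖displacement s ω‖} * U := by
          rw [lintegral_add_left (f := fun _ => ENNReal.ofReal (2 * ε) * I₁) measurable_const, lintegral_const,
            measure_univ, mul_one]
          congr 1
          have hind : (fun ω : PathSpace N => {h : Config N | δ ≤ ‖h‖}.indicator (fun _ => (2 : ℝ≥0∞))
              (displacement s ω) * U) = {ω : PathSpace N | δ ≤ ‖displacement s ω‖}.indicator (fun _ => 2 * U) := by
            funext ω
            by_cases hω : δ ≤ ‖displacement s ω‖
            · rw [Set.indicator_of_mem (show displacement s ω ∈ {h : Config N | δ ≤ ‖h‖} from hω),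
                Set.indicator_of_mem (show ω ∈ {ω : PathSpace N | δ ≤ ‖displacement s ω‖} from hω)]
            · rw [Set.indicator_of_notMem (show displacement s ω ∉ {h : Config N | δ ≤ ‖h‖} from hω),
                Set.indicator_of_notMem (show ω ∉ {ω : PathSpace N | δ ≤ ‖displacement s ω‖} from hω), zero_mul]
          rw [hind, lintegral_indicator_const hset]
          ring
      _ ≤ ENNReal.ofReal (2 * ε) * I₁ + 2 * ENNReal.ofReal (m / δ) * U := by
          gcongr
          exact measure_norm_displacement_ge_le_gsfk hs hδ
  -- Tonelli and the time integral
  have hJ := lintegral_sq_mul_pathAction_eq_gsfk hv hΨm (t : ℝ) (ψ := Ψ₀)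
  -- for `s ∈ (0, t]`: `P ≤ E ∫ Ψ₀² V(· + D_s) + CV · (error)`
  have hstep : ∀ s ∈ Set.Ioc (0 : ℝ) t, P ≤ (∫⁻ ω, ∫⁻ X, ENNReal.ofReal (Ψ₀ X ^ 2) *
      interaction v (X + displacement s.toNNReal ω) ∂volume ∂wienerPaths N) +
      (CV : ℝ≥0∞) * (ENNReal.ofReal (2 * ε) * I₁ + 2 * ENNReal.ofReal (m / δ) * U) := by
    intro s hs
    have hs' : s.toNNReal ≤ t := Real.toNNReal_le_iff_le_coe.2 hs.2
    have hm1 : Measurable fun ω : PathSpace N => ∫⁻ X, ENNReal.ofReal (Ψ₀ X ^ 2) *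
        interaction v (X + displacement s.toNNReal ω) ∂volume := by
      have : Measurable fun q : PathSpace N × Config N => ENNReal.ofReal (Ψ₀ q.2 ^ 2) *
          interaction v (q.2 + displacement s.toNNReal q.1) :=
        (ENNReal.measurable_ofReal.comp ((hΨm.comp measurable_snd).pow_const 2)).mul
          (hVm.comp (measurable_snd.add ((measurable_displacement _).comp measurable_fst)))
      exact this.lintegral_prod_right'
    calc P = ∫⁻ _ω, P ∂wienerPaths N := by rw [lintegral_const, measure_univ, mul_one]
      _ ≤ ∫⁻ ω, ((∫⁻ X, ENNReal.ofReal (Ψ₀ X ^ 2) * interaction v (X + displacement s.toNNReal ω)) +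
          (CV : ℝ≥0∞) * ∫⁻ Y, ‖Ψ₀ (Y - displacement s.toNNReal ω) ^ 2 - Ψ₀ Y ^ 2‖ₑ) ∂wienerPaths N :=
          lintegral_mono fun ω => hshift _
      _ = (∫⁻ ω, ∫⁻ X, ENNReal.ofReal (Ψ₀ X ^ 2) * interaction v (X + displacement s.toNNReal ω)
            ∂volume ∂wienerPaths N) +
          (CV : ℝ≥0∞) * ∫⁻ ω, ∫⁻ Y, ‖Ψ₀ (Y - displacement s.toNNReal ω) ^ 2 - Ψ₀ Y ^ 2‖ₑ ∂volume ∂wienerPaths N := by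
          rw [lintegral_add_left hm1, lintegral_const_mul' _ _ ENNReal.coe_ne_top]
      _ ≤ _ := by
          gcongr
          exact hE _ hs'
  calc ENNReal.ofReal t * P = ∫⁻ _s in Set.Ioc (0 : ℝ) t, P := by
        rw [setLIntegral_const, Real.volume_Ioc, sub_zero, mul_comm]
    _ ≤ ∫⁻ s in Set.Ioc (0 : ℝ) t, ((∫⁻ ω, ∫⁻ X, ENNReal.ofReal (Ψ₀ X ^ 2) *
          interaction v (X + displacement s.toNNReal ω) ∂volume ∂wienerPaths N) +
          (CV : ℝ≥0∞) * (ENNReal.ofReal (2 * ε) * I₁ + 2 * ENNReal.ofReal (m / δ) * U)) :=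
        setLIntegral_mono' measurableSet_Ioc hstep
    _ = (∫⁻ s in Set.Ioc (0 : ℝ) t, ∫⁻ ω, ∫⁻ X, ENNReal.ofReal (Ψ₀ X ^ 2) *
          interaction v (X + displacement s.toNNReal ω) ∂volume ∂wienerPaths N) +
        ENNReal.ofReal t * ((CV : ℝ≥0∞) * (ENNReal.ofReal (2 * ε) * I₁ + 2 * ENNReal.ofReal (m / δ) * U)) := by
        rw [lintegral_add_right _ measurable_const, setLIntegral_const, Real.volume_Ioc, sub_zero, mul_comm _
          (ENNReal.ofReal t)]
    _ = _ := by rw [← hJ, ← mul_assoc]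

/-! ### The master inequality -/

/-- The potential integral of a bounded nonnegative-potential against `Ψ₀²` in real form.
[folklore] -/
private theorem lintegral_sq_mul_interaction_eq_ofReal_gsfk {v : ℝ → ℝ≥0∞} (hv : Measurable v) {C : ℝ≥0}
    (hC : ∀ r, v r ≤ C) {Ψ₀ : Config N → ℝ} (hΨm : Measurable Ψ₀)
    (hsq : Integrable (fun X => Ψ₀ X ^ 2) volume) :
    ∫⁻ X, ENNReal.ofReal (Ψ₀ X ^ 2) * interaction v X =
      ENNReal.ofReal (∫ X, Ψ₀ X ^ 2 * (interaction v X).toReal) := by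
  set CV : ℝ≥0 := (N * N : ℕ) * C with hCVdef
  have hVle : ∀ X : Config N, interaction v X ≤ CV := fun X => by
    have := interaction_le_of_le (C := (C : ℝ≥0∞)) (fun r => hC r) X
    simpa [hCVdef] using this
  have hVtop : ∀ X : Config N, interaction v X ≠ ⊤ := fun X => ne_top_of_le_ne_top ENNReal.coe_ne_top (hVle X)
  have hVm : Measurable (interaction (N := N) v) := measurable_interaction hv
  have hint : Integrable (fun X => Ψ₀ X ^ 2 * (interaction v X).toReal) volume := by
    refine (hsq.mul_const (CV : ℝ)).mono' ((hΨm.pow_const 2).mul hVm.ennreal_toReal).aestronglyMeasurable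
      (Eventually.of_forall fun X => ?_)
    rw [Real.norm_eq_abs, abs_mul, abs_of_nonneg (sq_nonneg _), abs_of_nonneg ENNReal.toReal_nonneg]
    refine mul_le_mul_of_nonneg_left ?_ (sq_nonneg _)
    have := ENNReal.toReal_mono ENNReal.coe_ne_top (hVle X)
    simpa using this
  rw [ofReal_integral_eq_lintegral_ofReal hint (Eventually.of_forall fun X =>
    mul_nonneg (sq_nonneg _) ENNReal.toReal_nonneg)]
  refine lintegral_congr fun X => ?_
  rw [ENNReal.ofReal_mul (sq_nonneg _), ENNReal.ofReal_toReal (hVtop X)]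

/-- **Master inequality for an eigenfunction pairing.** For nonnegative measurable `Ψ₀ ≤ M`,
integrable and square integrable with `∫Ψ₀² = 1`, uniform-continuity data `(ε, δ)`, a bounded
pair potential `v ≤ C` and `0 < t` with `N²C t ≤ 1`:
`⟨Ψ₀, e^{-tH}Ψ₀⟩ ≤ (1 - sqIncr t Ψ₀/2) - t∫Ψ₀²V + t·N²C·(3ε‖Ψ₀‖₁ + (2 + M‖Ψ₀‖₁) m/δ) + (N²Ct)²`,
`m = √2·3N·2√t`. [folklore] -/
theorem eigen_pairing_upper_bound {v : ℝ → ℝ≥0∞} (hv : Measurable v) {C : ℝ≥0} (hC : ∀ r, v r ≤ C)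
    (L : ℝ) {Ψ₀ : Config N → ℝ} (hΨm : Measurable Ψ₀) (hnn : ∀ X, 0 ≤ Ψ₀ X) {M : ℝ}
    (hM : ∀ X, Ψ₀ X ≤ M) (hint : Integrable Ψ₀ volume) (hΨ2 : MemLp Ψ₀ 2 volume)
    (hnorm : ∫ X, Ψ₀ X ^ 2 = 1) {ε δ : ℝ} (hε : 0 ≤ ε) (hδ : 0 < δ)
    (hUC : ∀ Y h, ‖h‖ < δ → |Ψ₀ (Y + h) - Ψ₀ Y| ≤ ε) {t : ℝ≥0} (ht : t ≠ 0)
    (hsmall : ((N * N : ℕ) : ℝ) * C * t ≤ 1) :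
    ∫ X, Ψ₀ X * fkReal v L t Ψ₀ X ≤
      (1 - (sqIncr t Ψ₀).toReal / 2) - t * (∫ X, Ψ₀ X ^ 2 * (interaction v X).toReal) +
        t * ((((N * N : ℕ) : ℝ) * C) * (3 * ε * (∫ X, Ψ₀ X) +
          (2 + M * ∫ X, Ψ₀ X) * (Real.sqrt 2 * ((3 * N : ℕ) * (2 * Real.sqrt t)) / δ))) +
        ((((N * N : ℕ) : ℝ) * C) * t) ^ 2 := by
  have ht0 : (0 : ℝ) ≤ t := t.coe_nonneg
  have ht' : (0 : ℝ) < t := lt_of_le_of_ne ht0 (fun h => ht (by exact_mod_cast h.symm))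
  have hM0 : 0 ≤ M := (hnn 0).trans (hM 0)
  have habs : ∀ X, |Ψ₀ X| = Ψ₀ X := fun X => abs_of_nonneg (hnn X)
  set CV : ℝ≥0 := (N * N : ℕ) * C with hCVdef
  have hCVreal : ((N * N : ℕ) : ℝ) * C = CV := by simp [hCVdef]
  set CVt : ℝ := ((N * N : ℕ) : ℝ) * C * t with hCVtdef
  have hCVt0 : 0 ≤ CVt := by positivity
  set m : ℝ := Real.sqrt 2 * ((3 * N : ℕ) * (2 * Real.sqrt t)) with hm
  have hm0 : 0 ≤ m := by positivity
  set I₁ : ℝ := ∫ X, Ψ₀ X with hI₁def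
  have hI₁0 : 0 ≤ I₁ := integral_nonneg hnn
  have hAle : ∀ (X : Config N) (ω : PathSpace N), pathAction v t X ω ≤ (CV : ℝ≥0∞) * ENNReal.ofReal t := by
    intro X ω
    have := pathAction_le_of_le (C := (C : ℝ≥0∞)) (fun r => hC r) t X ω
    simpa [hCVdef, mul_assoc] using this
  have hAtop : ∀ (X : Config N) (ω : PathSpace N), pathAction v t X ω ≠ ⊤ := fun X ω =>
    ne_top_of_le_ne_top (ENNReal.mul_ne_top ENNReal.coe_ne_top ENNReal.ofReal_ne_top) (hAle X ω)
  have hAreal : ∀ (X : Config N) (ω : PathSpace N), (pathAction v t X ω).toReal ≤ CV * t := by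
    intro X ω
    have := ENNReal.toReal_mono (ENNReal.mul_ne_top ENNReal.coe_ne_top ENNReal.ofReal_ne_top) (hAle X ω)
    rwa [ENNReal.toReal_mul, ENNReal.coe_toReal, ENNReal.toReal_ofReal ht0] at this
  have hwl : ∀ (X : Config N) (ω : PathSpace N), worldLine X ω ((t : ℝ)).toNNReal = X + displacement t ω := by
    intro X ω; rw [Real.toNNReal_coe]; rfl
  -- the four integrands
  set A₁ : Config N → PathSpace N → ℝ := fun X ω => Ψ₀ X * Ψ₀ (X + displacement t ω) with hA₁
  set A₂ : Config N → PathSpace N → ℝ := fun X ω => Ψ₀ X ^ 2 * (pathAction v t X ω).toReal with hA₂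
  set A₃ : Config N → PathSpace N → ℝ := fun X ω =>
    Ψ₀ X * |Ψ₀ (X + displacement t ω) - Ψ₀ X| * CVt with hA₃
  set A₄ : Config N → PathSpace N → ℝ := fun X ω => Ψ₀ X * Ψ₀ (X + displacement t ω) * CVt ^ 2 with hA₄
  -- joint measurability
  have hcompm : Measurable fun p : Config N × PathSpace N => Ψ₀ (p.1 + displacement t p.2) :=
    hΨm.comp (measurable_fst.add ((measurable_displacement t).comp measurable_snd))
  have h1m : Measurable fun p : Config N × PathSpace N => A₁ p.1 p.2 := (hΨm.comp measurable_fst).mul hcompm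
  have h2m : Measurable fun p : Config N × PathSpace N => A₂ p.1 p.2 :=
    ((hΨm.comp measurable_fst).pow_const 2).mul (measurable_pathAction_uncurry_gsfk hv t).ennreal_toReal
  have h3m : Measurable fun p : Config N × PathSpace N => A₃ p.1 p.2 :=
    ((hΨm.comp measurable_fst).mul (hcompm.sub (hΨm.comp measurable_fst)).abs).mul_const _
  have h4m : Measurable fun p : Config N × PathSpace N => A₄ p.1 p.2 :=
    ((hΨm.comp measurable_fst).mul hcompm).mul_const _
  have hwm : Measurable fun p : Config N × PathSpace N =>
      Ψ₀ p.1 * ((fkWeight v L t p.1 p.2).toReal * Ψ₀ (p.1 + displacement t p.2)) :=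
    (hΨm.comp measurable_fst).mul ((measurable_fkWeight_uncurry hv L t).ennreal_toReal.mul hcompm)
  -- pointwise bounds by multiples of `|Ψ₀ X|`
  have hdiff : ∀ X ω, |Ψ₀ (X + displacement t ω) - Ψ₀ X| ≤ M := fun X ω =>
    abs_sub_le_iff.2 ⟨by linarith [hM (X + displacement t ω), hnn X], by linarith [hM X, hnn (X + displacement t ω)]⟩
  have h1b : ∀ X ω, |A₁ X ω| ≤ |Ψ₀ X| * M := fun X ω => by
    simp only [hA₁, abs_mul, habs]; exact mul_le_mul_of_nonneg_left (hM _) (hnn _)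
  have h2b : ∀ X ω, |A₂ X ω| ≤ |Ψ₀ X| * (M * (CV * t)) := fun X ω => by
    simp only [hA₂, abs_mul, abs_of_nonneg ENNReal.toReal_nonneg, habs, sq, mul_assoc]
    exact mul_le_mul_of_nonneg_left (mul_le_mul (hM _) (hAreal X ω) ENNReal.toReal_nonneg hM0) (hnn _)
  have h3b : ∀ X ω, |A₃ X ω| ≤ |Ψ₀ X| * (M * CVt) := fun X ω => by
    simp only [hA₃, abs_mul, abs_abs, habs, abs_of_nonneg hCVt0, mul_assoc]
    exact mul_le_mul_of_nonneg_left (mul_le_mul_of_nonneg_right (hdiff X ω) hCVt0) (hnn _)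
  have h4b : ∀ X ω, |A₄ X ω| ≤ |Ψ₀ X| * (M * CVt ^ 2) := fun X ω => by
    simp only [hA₄, abs_mul, habs, abs_of_nonneg (sq_nonneg CVt), mul_assoc]
    exact mul_le_mul_of_nonneg_left (mul_le_mul_of_nonneg_right (hM _) (sq_nonneg _)) (hnn _)
  have hwb : ∀ X ω, |Ψ₀ X * ((fkWeight v L t X ω).toReal * Ψ₀ (X + displacement t ω))| ≤ |Ψ₀ X| * M := by
    intro X ω
    rw [abs_mul, abs_mul, abs_of_nonneg ENNReal.toReal_nonneg, habs, habs]
    refine mul_le_mul_of_nonneg_left ?_ (hnn X)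
    have hw1 : (fkWeight v L t X ω).toReal ≤ 1 := by
      simpa using ENNReal.toReal_mono ENNReal.one_ne_top (fkWeight_le_one v L t X ω)
    calc (fkWeight v L t X ω).toReal * Ψ₀ (X + displacement t ω) ≤ 1 * M :=
          mul_le_mul hw1 (hM _) (hnn _) zero_le_one
      _ = M := one_mul M
  -- inner integrability
  have hinner_int : ∀ (F : Config N → PathSpace N → ℝ) (K : ℝ), (Measurable fun p : Config N × PathSpace N =>
      F p.1 p.2) → (∀ X ω, |F X ω| ≤ |Ψ₀ X| * K) → ∀ X, Integrable (F X) (wienerPaths N) := by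
    intro F K hFm hFb X
    exact Integrable.of_bound (hFm.comp measurable_prodMk_left).aestronglyMeasurable (|Ψ₀ X| * K)
      (Eventually.of_forall fun ω => by rw [Real.norm_eq_abs]; exact hFb X ω)
  have hi1 := hinner_int A₁ _ h1m h1b
  have hi2 := hinner_int A₂ _ h2m h2b
  have hi3 := hinner_int A₃ _ h3m h3b
  have hi4 := hinner_int A₄ _ h4m h4b
  have hiw := hinner_int (fun X ω => Ψ₀ X * ((fkWeight v L t X ω).toReal * Ψ₀ (X + displacement t ω))) M hwm hwb
  -- outer integrability
  have hdom : ∀ (F : Config N → PathSpace N → ℝ) (K : ℝ), (Measurable fun p : Config N × PathSpace N =>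
      F p.1 p.2) → (∀ X ω, |F X ω| ≤ |Ψ₀ X| * K) →
      Integrable (fun X => ∫ ω, F X ω ∂wienerPaths N) volume := by
    intro F K hFm hFb
    refine Integrable.mono' (hint.norm.mul_const K)
      (hFm.stronglyMeasurable.integral_prod_right' (ν := wienerPaths N)).aestronglyMeasurable
      (Eventually.of_forall fun X => ?_)
    have h := norm_integral_le_of_norm_le_const (μ := wienerPaths N) (C := |Ψ₀ X| * K) (f := F X)
      (Eventually.of_forall fun ω => by rw [Real.norm_eq_abs]; exact hFb X ω)
    rwa [probReal_univ, mul_one, ← Real.norm_eq_abs (Ψ₀ X)] at h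
  have hI1 := hdom A₁ _ h1m h1b
  have hI2 := hdom A₂ _ h2m h2b
  have hI3 := hdom A₃ _ h3m h3b
  have hI4 := hdom A₄ _ h4m h4b
  have hIw : Integrable (fun X => Ψ₀ X * fkReal v L t Ψ₀ X) volume := by
    refine Integrable.mono' (hint.norm.mul_const M) (hΨm.mul (measurable_fkReal hv L _ hΨm)).aestronglyMeasurable
      (Eventually.of_forall fun X => ?_)
    simp only [norm_mul, Real.norm_eq_abs]
    refine mul_le_mul_of_nonneg_left ?_ (abs_nonneg _)
    exact abs_fkReal_le_of_bound_gsfk v L _ (fun Y => by rw [habs]; exact hM Y) X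
  -- Step 1: the pairing and the inner inequality
  have hpair : ∀ X, Ψ₀ X * fkReal v L t Ψ₀ X =
      ∫ ω, Ψ₀ X * ((fkWeight v L t X ω).toReal * Ψ₀ (X + displacement t ω)) ∂wienerPaths N := by
    intro X
    rw [fkReal, ← MeasureTheory.integral_const_mul]
    refine integral_congr_ae (Eventually.of_forall fun ω => ?_)
    simp only [hwl]
  have hinner : ∀ X, Ψ₀ X * fkReal v L t Ψ₀ X ≤ (∫ ω, A₁ X ω ∂wienerPaths N) - (∫ ω, A₂ X ω ∂wienerPaths N) +
      (∫ ω, A₃ X ω ∂wienerPaths N) + (∫ ω, A₄ X ω ∂wienerPaths N) := by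
    intro X
    have hs1 : Integrable (fun ω => A₁ X ω - A₂ X ω) (wienerPaths N) := (hi1 X).sub (hi2 X)
    have hs2 : Integrable (fun ω => A₁ X ω - A₂ X ω + A₃ X ω) (wienerPaths N) := hs1.add (hi3 X)
    have hs3 : Integrable (fun ω => A₁ X ω - A₂ X ω + A₃ X ω + A₄ X ω) (wienerPaths N) := hs2.add (hi4 X)
    rw [hpair X, ← integral_sub (hi1 X) (hi2 X), ← integral_add hs1 (hi3 X), ← integral_add hs2 (hi4 X)]
    refine integral_mono (hiw X) hs3 fun ω => ?_
    have := eigen_integrand_le_gsfk hC L ht0 hsmall hnn X ω (X + displacement t ω)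
    simp only [hA₁, hA₂, hA₃, hA₄, hCVtdef]
    linarith
  -- Step 2: the outer inequality
  have houter : ∫ X, Ψ₀ X * fkReal v L t Ψ₀ X ≤ (∫ X, ∫ ω, A₁ X ω ∂wienerPaths N) -
      (∫ X, ∫ ω, A₂ X ω ∂wienerPaths N) + (∫ X, ∫ ω, A₃ X ω ∂wienerPaths N) +
      (∫ X, ∫ ω, A₄ X ω ∂wienerPaths N) := by
    have hs1 : Integrable (fun X => (∫ ω, A₁ X ω ∂wienerPaths N) - ∫ ω, A₂ X ω ∂wienerPaths N) volume :=
      hI1.sub hI2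
    have hs2 : Integrable (fun X => (∫ ω, A₁ X ω ∂wienerPaths N) - (∫ ω, A₂ X ω ∂wienerPaths N) +
        ∫ ω, A₃ X ω ∂wienerPaths N) volume := hs1.add hI3
    have hs3 : Integrable (fun X => (∫ ω, A₁ X ω ∂wienerPaths N) - (∫ ω, A₂ X ω ∂wienerPaths N) +
        (∫ ω, A₃ X ω ∂wienerPaths N) + ∫ ω, A₄ X ω ∂wienerPaths N) volume := hs2.add hI4
    rw [← integral_sub hI1 hI2, ← integral_add hs1 hI3, ← integral_add hs2 hI4]
    exact integral_mono hIw hs3 hinner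
  -- Step 3: identify the terms
  have hT1 : ∫ X, ∫ ω, A₁ X ω ∂wienerPaths N = 1 - (sqIncr t Ψ₀).toReal / 2 := by
    rw [← hnorm, ← integral_mul_integral_shift_eq hΨm hΨ2 t]
    refine integral_congr_ae (Eventually.of_forall fun X => ?_)
    simp only [hA₁]
    exact MeasureTheory.integral_const_mul _ _
  have hT4 : ∫ X, ∫ ω, A₄ X ω ∂wienerPaths N ≤ CVt ^ 2 := by
    have h4eq : ∫ X, ∫ ω, A₄ X ω ∂wienerPaths N = (∫ X, ∫ ω, A₁ X ω ∂wienerPaths N) * CVt ^ 2 := by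
      rw [← integral_mul_const]
      refine integral_congr_ae (Eventually.of_forall fun X => ?_)
      show ∫ ω, A₄ X ω ∂wienerPaths N = (∫ ω, A₁ X ω ∂wienerPaths N) * CVt ^ 2
      rw [← integral_mul_const]
    rw [h4eq, hT1]
    have hsq0 : 0 ≤ (sqIncr t Ψ₀).toReal := ENNReal.toReal_nonneg
    nlinarith [sq_nonneg CVt]
  -- the potential term from below
  have hsq_int : Integrable (fun X => Ψ₀ X ^ 2) volume := hΨ2.integrable_sq
  have hU : ∫⁻ Y, ENNReal.ofReal (Ψ₀ Y ^ 2) = 1 := by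
    rw [← ofReal_integral_eq_lintegral_ofReal hsq_int (Eventually.of_forall fun X => sq_nonneg _), hnorm,
      ENNReal.ofReal_one]
  have hI₁e : ∫⁻ Y, ‖Ψ₀ Y‖ₑ = ENNReal.ofReal I₁ := by
    rw [hI₁def, ofReal_integral_eq_lintegral_ofReal hint (Eventually.of_forall hnn)]
    refine lintegral_congr fun Y => ?_
    rw [Real.enorm_eq_ofReal (hnn Y)]
  have hPot := lintegral_sq_mul_interaction_eq_ofReal_gsfk hv hC hΨm hsq_int
  set Pot : ℝ := ∫ X, Ψ₀ X ^ 2 * (interaction v X).toReal with hPotdef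
  have hPot0 : 0 ≤ Pot := integral_nonneg fun X => mul_nonneg (sq_nonneg _) ENNReal.toReal_nonneg
  have hT2 : t * Pot ≤ (∫ X, ∫ ω, A₂ X ω ∂wienerPaths N) + t * (CV * (2 * ε * I₁ + 2 * (m / δ))) := by
    -- the double integral of `A₂` as a lower integral
    have h2of : ∀ X ω, ENNReal.ofReal (A₂ X ω) = ENNReal.ofReal (Ψ₀ X ^ 2) * pathAction v t X ω := by
      intro X ω
      simp only [hA₂]
      rw [ENNReal.ofReal_mul (sq_nonneg _), ENNReal.ofReal_toReal (hAtop X ω)]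
    have hJ2 : ∫ X, ∫ ω, A₂ X ω ∂wienerPaths N =
        (∫⁻ X, ∫⁻ ω, ENNReal.ofReal (Ψ₀ X ^ 2) * pathAction v t X ω ∂wienerPaths N ∂volume).toReal := by
      have hin : ∀ X, ∫ ω, A₂ X ω ∂wienerPaths N =
          (∫⁻ ω, ENNReal.ofReal (Ψ₀ X ^ 2) * pathAction v t X ω ∂wienerPaths N).toReal := by
        intro X
        have h2X : AEStronglyMeasurable (A₂ X) (wienerPaths N) :=
          (h2m.comp measurable_prodMk_left).aestronglyMeasurable
        have h20 : 0 ≤ᵐ[wienerPaths N] A₂ X := Eventually.of_forall fun ω => by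
          simp only [hA₂, Pi.zero_apply]; exact mul_nonneg (sq_nonneg _) ENNReal.toReal_nonneg
        rw [integral_eq_lintegral_of_nonneg_ae h20 h2X]
        simp_rw [h2of]
      simp_rw [hin]
      have hFm : Measurable fun X : Config N => ∫⁻ ω, ENNReal.ofReal (Ψ₀ X ^ 2) * pathAction v t X ω
          ∂wienerPaths N :=
        ((ENNReal.measurable_ofReal.comp ((hΨm.comp measurable_fst).pow_const 2)).mul
          (measurable_pathAction_uncurry_gsfk hv t)).lintegral_prod_right'
      refine integral_toReal hFm.aemeasurable (Eventually.of_forall fun X => ?_)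
      calc ∫⁻ ω, ENNReal.ofReal (Ψ₀ X ^ 2) * pathAction v t X ω ∂wienerPaths N
          ≤ ∫⁻ _ω, ENNReal.ofReal (Ψ₀ X ^ 2) * ((CV : ℝ≥0∞) * ENNReal.ofReal t) ∂wienerPaths N :=
            lintegral_mono fun ω => mul_le_mul' le_rfl (hAle X ω)
        _ < ⊤ := by
            rw [lintegral_const, measure_univ, mul_one]
            exact ENNReal.mul_lt_top ENNReal.ofReal_lt_top (ENNReal.mul_lt_top ENNReal.coe_lt_top ENNReal.ofReal_lt_top)
    -- the `[0, ∞]` inequality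
    have hE := ofReal_mul_potential_le_gsfk hv hC hΨm hε hδ hUC t
    rw [hU, mul_one, hI₁e, hPot] at hE
    -- finiteness
    have hJfin : ∫⁻ X, ∫⁻ ω, ENNReal.ofReal (Ψ₀ X ^ 2) * pathAction v t X ω ∂wienerPaths N ∂volume ≠ ⊤ := by
      refine ne_of_lt (lt_of_le_of_lt (lintegral_mono fun X => lintegral_mono fun ω =>
        mul_le_mul' le_rfl (hAle X ω)) ?_)
      simp_rw [lintegral_const, measure_univ, mul_one]
      have hm2 : Measurable fun X : Config N => ENNReal.ofReal (Ψ₀ X ^ 2) :=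
        ENNReal.measurable_ofReal.comp (hΨm.pow_const 2)
      rw [lintegral_mul_const _ hm2, hU, one_mul]
      exact ENNReal.mul_lt_top ENNReal.coe_lt_top ENNReal.ofReal_lt_top
    have hRfin : ENNReal.ofReal t * (CV : ℝ≥0∞) * (ENNReal.ofReal (2 * ε) * ENNReal.ofReal I₁ +
        2 * ENNReal.ofReal (m / δ)) ≠ ⊤ :=
      ENNReal.mul_ne_top (ENNReal.mul_ne_top ENNReal.ofReal_ne_top ENNReal.coe_ne_top)
        (ENNReal.add_ne_top.2 ⟨ENNReal.mul_ne_top ENNReal.ofReal_ne_top ENNReal.ofReal_ne_top,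
          ENNReal.mul_ne_top ENNReal.ofNat_ne_top ENNReal.ofReal_ne_top⟩)
    have hle := ENNReal.toReal_mono (ENNReal.add_ne_top.2 ⟨hJfin, hRfin⟩) hE
    rw [ENNReal.toReal_mul, ENNReal.toReal_ofReal ht0, ENNReal.toReal_ofReal hPot0,
      ENNReal.toReal_add hJfin hRfin, ← hJ2] at hle
    have hRe : (ENNReal.ofReal t * (CV : ℝ≥0∞) * (ENNReal.ofReal (2 * ε) * ENNReal.ofReal I₁ +
        2 * ENNReal.ofReal (m / δ))).toReal = t * (CV * (2 * ε * I₁ + 2 * (m / δ))) := by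
      rw [ENNReal.toReal_mul, ENNReal.toReal_mul, ENNReal.toReal_ofReal ht0, ENNReal.coe_toReal,
        ENNReal.toReal_add (ENNReal.mul_ne_top ENNReal.ofReal_ne_top ENNReal.ofReal_ne_top)
          (ENNReal.mul_ne_top ENNReal.ofNat_ne_top ENNReal.ofReal_ne_top),
        ENNReal.toReal_mul, ENNReal.toReal_mul, ENNReal.toReal_ofReal (by positivity),
        ENNReal.toReal_ofReal hI₁0, ENNReal.toReal_ofReal (by positivity), ENNReal.toReal_ofNat]
      ring
    rw [hRe] at hle
    exact hle
  -- the continuity term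
  have hT3 : ∫ X, ∫ ω, A₃ X ω ∂wienerPaths N ≤ CVt * (I₁ * (ε + M * (m / δ))) := by
    have hset : MeasurableSet {ω : PathSpace N | δ ≤ ‖displacement t ω‖} :=
      measurableSet_le measurable_const (measurable_displacement t).norm
    have hprob : (wienerPaths N).real {ω | δ ≤ ‖displacement t ω‖} ≤ m / δ := by
      have := measure_norm_displacement_ge_le_gsfk (N := N) (le_refl t) hδ
      have h2 := ENNReal.toReal_mono ENNReal.ofReal_ne_top this
      rwa [ENNReal.toReal_ofReal (by positivity), ← measureReal_def] at h2
    have hin : ∀ X, ∫ ω, A₃ X ω ∂wienerPaths N ≤ Ψ₀ X * (ε + M * (m / δ)) * CVt := by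
      intro X
      have hbd : ∀ ω, |Ψ₀ (X + displacement t ω) - Ψ₀ X| ≤
          ε + M * {ω : PathSpace N | δ ≤ ‖displacement t ω‖}.indicator (fun _ => (1 : ℝ)) ω := by
        intro ω
        by_cases hω : ‖displacement t ω‖ < δ
        · rw [Set.indicator_of_notMem (show ω ∉ {ω : PathSpace N | δ ≤ ‖displacement t ω‖} from
            fun h => absurd h (not_le.2 hω))]
          have := hUC X (displacement t ω) hω
          linarith
        · rw [Set.indicator_of_mem (show ω ∈ {ω : PathSpace N | δ ≤ ‖displacement t ω‖} from not_lt.1 hω)]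
          linarith [hdiff X ω]
      have hind_int : Integrable (fun ω => ε + M * {ω : PathSpace N | δ ≤ ‖displacement t ω‖}.indicator
          (fun _ => (1 : ℝ)) ω) (wienerPaths N) :=
        (integrable_const ε).add (((integrable_const (1 : ℝ)).indicator hset).const_mul M)
      calc ∫ ω, A₃ X ω ∂wienerPaths N = Ψ₀ X * CVt * ∫ ω, |Ψ₀ (X + displacement t ω) - Ψ₀ X| ∂wienerPaths N := by
            simp only [hA₃]
            rw [← MeasureTheory.integral_const_mul]
            refine integral_congr_ae (Eventually.of_forall fun ω => ?_)
            ring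
        _ ≤ Ψ₀ X * CVt * ∫ ω, (ε + M * {ω : PathSpace N | δ ≤ ‖displacement t ω‖}.indicator
              (fun _ => (1 : ℝ)) ω) ∂wienerPaths N := by
            refine mul_le_mul_of_nonneg_left (integral_mono ?_ hind_int hbd) (mul_nonneg (hnn X) hCVt0)
            exact Integrable.of_bound ((hcompm.sub (hΨm.comp measurable_fst)).abs.comp
              measurable_prodMk_left).aestronglyMeasurable M (Eventually.of_forall fun ω => by
                rw [Real.norm_eq_abs, abs_abs]; exact hdiff X ω)
        _ = Ψ₀ X * CVt * (ε + M * (wienerPaths N).real {ω | δ ≤ ‖displacement t ω‖}) := by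
            congr 1
            rw [integral_add (integrable_const ε) (((integrable_const (1 : ℝ)).indicator hset).const_mul M),
              MeasureTheory.integral_const, probReal_univ, one_smul, MeasureTheory.integral_const_mul]
            congr 1
            simp only [integral_indicator_const _ hset, smul_eq_mul, mul_one]
        _ ≤ Ψ₀ X * CVt * (ε + M * (m / δ)) :=
            mul_le_mul_of_nonneg_left (add_le_add le_rfl (mul_le_mul_of_nonneg_left hprob hM0))
              (mul_nonneg (hnn X) hCVt0)
        _ = Ψ₀ X * (ε + M * (m / δ)) * CVt := by ring
    calc ∫ X, ∫ ω, A₃ X ω ∂wienerPaths N ≤ ∫ X, Ψ₀ X * (ε + M * (m / δ)) * CVt :=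
          integral_mono hI3 ((hint.mul_const _).mul_const _) hin
      _ = CVt * (I₁ * (ε + M * (m / δ))) := by
          rw [integral_mul_const, integral_mul_const]
          ring
  -- assemble
  have hfinal : ∫ X, Ψ₀ X * fkReal v L t Ψ₀ X ≤ (1 - (sqIncr t Ψ₀).toReal / 2) -
      (t * Pot - t * (CV * (2 * ε * I₁ + 2 * (m / δ)))) + CVt * (I₁ * (ε + M * (m / δ))) + CVt ^ 2 := by
    linarith [houter, hT1, hT2, hT3, hT4]
  have hexpand : (1 - (sqIncr t Ψ₀).toReal / 2) - (t * Pot - t * (CV * (2 * ε * I₁ + 2 * (m / δ)))) +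
      CVt * (I₁ * (ε + M * (m / δ))) + CVt ^ 2 =
      (1 - (sqIncr t Ψ₀).toReal / 2) - t * Pot +
        t * ((((N * N : ℕ) : ℝ) * C) * (3 * ε * I₁ + (2 + M * I₁) * (m / δ))) +
        ((((N * N : ℕ) : ℝ) * C) * t) ^ 2 := by
    simp only [hCVtdef, hCVreal]
    ring
  rw [hexpand] at hfinal
  exact hfinal

/-! ### The eventual bound -/

/-- Positive reals from positive `ℝ≥0`: the coercion maps `𝓝[>] 0` to `𝓝[>] 0`. [folklore] -/
private theorem tendsto_coe_nhdsGT_zero_gsfk :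
    Tendsto (fun t : ℝ≥0 => (t : ℝ)) (𝓝[>] (0 : ℝ≥0)) (𝓝[>] (0 : ℝ)) := by
  refine tendsto_nhdsWithin_iff.2 ⟨?_, ?_⟩
  · have := (NNReal.continuous_coe.tendsto (0 : ℝ≥0))
    simp only [NNReal.coe_zero] at this
    exact this.mono_left nhdsWithin_le_nhds
  · filter_upwards [self_mem_nhdsWithin] with t ht
    exact_mod_cast ht

/-- **The free form of an eigenfunction is asymptotically at most `λ - ∫VΨ₀²`.** For a
continuous nonnegative `Ψ₀` vanishing off `Λ_L^N` with `∫Ψ₀² = 1` and satisfying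
`e^{-λt} ≤ ⟨Ψ₀, e^{-tH_N}Ψ₀⟩` for all `t > 0` (integrated eigen-relation), and any
`K' > λ - ∫ Ψ₀² V`: eventually as `t → 0⁺`, `sqIncr t Ψ₀ / (2t) ≤ K'`.
[cite: ChungZhao1995, Thm 3.27 and Prop 3.29 (81)] -/
theorem sqIncr_toReal_eventually_le {v : ℝ → ℝ≥0∞} (hv : Measurable v) {C : ℝ≥0} (hC : ∀ r, v r ≤ C)
    {L : ℝ} {Ψ₀ : Config N → ℝ} (hcont : Continuous Ψ₀) (h0 : ∀ X, X ∉ boxN N L → Ψ₀ X = 0)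
    (hnn : ∀ X, 0 ≤ Ψ₀ X) (hnorm : ∫ X, Ψ₀ X ^ 2 = 1) {lam : ℝ}
    (heig : ∀ t : ℝ, 0 < t → Real.exp (-(lam * t)) ≤ ∫ X, Ψ₀ X * fkReal v L t Ψ₀ X) {K' : ℝ}
    (hK' : lam - (∫ X, Ψ₀ X ^ 2 * (interaction v X).toReal) < K') :
    ∀ᶠ t : ℝ≥0 in 𝓝[>] 0, (sqIncr t Ψ₀).toReal ≤ 2 * t * K' := by
  -- data of `Ψ₀`
  have hcs := hasCompactSupport_of_eq_zero_gsfk h0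
  have hΨm : Measurable Ψ₀ := hcont.measurable
  obtain ⟨M0, hM0⟩ := hcs.exists_bound_of_continuous hcont
  set M : ℝ := max M0 0 with hMdef
  have hMnn : 0 ≤ M := le_max_right _ _
  have hM : ∀ X, Ψ₀ X ≤ M := fun X => by
    have := hM0 X
    rw [Real.norm_eq_abs, abs_of_nonneg (hnn X)] at this
    exact this.trans (le_max_left _ _)
  have hint : Integrable Ψ₀ volume := hcont.integrable_of_hasCompactSupport hcs
  have hΨ2 : MemLp Ψ₀ 2 volume := hcont.memLp_of_hasCompactSupport hcs
  have hsqfin : ∫⁻ X, ENNReal.ofReal (Ψ₀ X ^ 2) ≠ ⊤ := by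
    rw [← ofReal_integral_eq_lintegral_ofReal hΨ2.integrable_sq (Eventually.of_forall fun X => sq_nonneg _)]
    exact ENNReal.ofReal_ne_top
  have hUC := hcs.uniformContinuous_of_continuous hcont
  set I₁ : ℝ := ∫ X, Ψ₀ X with hI₁def
  have hI₁0 : 0 ≤ I₁ := integral_nonneg hnn
  set Pot : ℝ := ∫ X, Ψ₀ X ^ 2 * (interaction v X).toReal with hPotdef
  set CV : ℝ := ((N * N : ℕ) : ℝ) * C with hCVdef
  have hCV0 : 0 ≤ CV := by positivity
  -- the margins
  set η : ℝ := (K' - (lam - Pot)) / 3 with hηdef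
  have hη : 0 < η := by rw [hηdef]; linarith
  set ε : ℝ := η / (CV * 3 * I₁ + 1) with hεdef
  have hε : 0 < ε := div_pos hη (by positivity)
  have hε1 : CV * (3 * ε * I₁) ≤ η := by
    have hden : 0 < CV * 3 * I₁ + 1 := by positivity
    have : CV * (3 * ε * I₁) = η * (CV * 3 * I₁ / (CV * 3 * I₁ + 1)) := by
      simp only [hεdef]; field_simp
    rw [this]
    calc η * (CV * 3 * I₁ / (CV * 3 * I₁ + 1)) ≤ η * 1 := by
          refine mul_le_mul_of_nonneg_left ((div_le_one hden).2 (by linarith)) hη.le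
      _ = η := mul_one η
  obtain ⟨δ, hδ, hδUC⟩ := Metric.uniformContinuous_iff.1 hUC ε hε
  have hUC' : ∀ Y h : Config N, ‖h‖ < δ → |Ψ₀ (Y + h) - Ψ₀ Y| ≤ ε := by
    intro Y h hh
    have := hδUC (a := Y + h) (b := Y) (by rwa [dist_eq_norm, add_sub_cancel_left])
    rw [Real.dist_eq] at this
    exact this.le
  -- eventual facts in real time
  have hE1 : ∀ᶠ t : ℝ in 𝓝[>] 0, (1 - Real.exp (-(lam * t))) / t < lam + η :=
    (tendsto_order.1 (tendsto_one_sub_exp_div_gsfk lam)).2 _ (by linarith)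
  have hE2 : ∀ᶠ t : ℝ in 𝓝[>] 0, CV * t < 1 ∧
      CV * ((2 + M * I₁) * (Real.sqrt 2 * ((3 * N : ℕ) * (2 * Real.sqrt t)) / δ)) + CV ^ 2 * t < η := by
    have hc : Continuous fun t : ℝ => (CV * t,
        CV * ((2 + M * I₁) * (Real.sqrt 2 * ((3 * N : ℕ) * (2 * Real.sqrt t)) / δ)) + CV ^ 2 * t) := by
      fun_prop
    have hopen : IsOpen (Set.Iio (1 : ℝ) ×ˢ Set.Iio η) := isOpen_Iio.prod isOpen_Iio
    have hmem : ((0 : ℝ), (0 : ℝ)) ∈ Set.Iio (1 : ℝ) ×ˢ Set.Iio η :=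
      Set.mk_mem_prod (Set.mem_Iio.2 zero_lt_one) (Set.mem_Iio.2 hη)
    have this := hc.tendsto' 0 ((0 : ℝ), (0 : ℝ)) (by simp)
    have hev := this.eventually (hopen.mem_nhds hmem)
    refine (hev.filter_mono nhdsWithin_le_nhds).mono fun t ht => ?_
    exact ⟨ht.1, ht.2⟩
  have hE := (tendsto_coe_nhdsGT_zero_gsfk.eventually hE1).and (tendsto_coe_nhdsGT_zero_gsfk.eventually hE2)
  filter_upwards [hE, self_mem_nhdsWithin] with t ht htpos
  obtain ⟨h1, h2, h3⟩ := ht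
  have ht0 : t ≠ 0 := ne_of_gt htpos
  have ht' : (0 : ℝ) < t := by exact_mod_cast htpos
  have hsmall : ((N * N : ℕ) : ℝ) * C * t ≤ 1 := by rw [← hCVdef] at *; exact h2.le
  have hmaster := eigen_pairing_upper_bound hv hC L hΨm hnn hM hint hΨ2 hnorm hε.le hδ hUC' ht0 hsmall
  have hexp := heig t ht'
  -- `1 - e^{-λt} ≤ t (λ + η)`
  have h1' : 1 - Real.exp (-(lam * t)) ≤ t * (lam + η) := by
    have := (div_lt_iff₀ ht').1 h1
    linarith
  -- the error terms
  set m : ℝ := Real.sqrt 2 * ((3 * N : ℕ) * (2 * Real.sqrt t)) with hm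
  have herr : CV * (3 * ε * I₁ + (2 + M * I₁) * (m / δ)) + CV ^ 2 * t ≤ 2 * η := by
    have := hε1
    nlinarith [h3, hε1]
  -- conclude in `ℝ`
  have hK'eq : K' = lam - Pot + 3 * η := by rw [hηdef]; ring
  rw [← hCVdef] at hmaster
  have key : (sqIncr t Ψ₀).toReal / 2 ≤ t * K' := by
    calc (sqIncr t Ψ₀).toReal / 2 ≤ (1 - Real.exp (-(lam * t))) - t * Pot +
          t * (CV * (3 * ε * I₁ + (2 + M * I₁) * (m / δ))) + (CV * t) ^ 2 := by linarith
      _ ≤ t * (lam + η) - t * Pot + t * (2 * η) := by nlinarith [h1', herr, ht']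
      _ = t * K' := by rw [hK'eq]; ring
  linarith

/-- **The free form of an eigenfunction is asymptotically at most `λ - ∫VΨ₀²`** (`[0, ∞]` form):
under the hypotheses of `sqIncr_toReal_eventually_le`, for every `K' > λ - ∫ Ψ₀² V`, eventually as
`t → 0⁺`, `sqIncr t Ψ₀ / (2t) ≤ K'`. [cite: ChungZhao1995, Thm 3.27 and Prop 3.29 (81)] -/
theorem sqIncr_div_eventually_le {v : ℝ → ℝ≥0∞} (hv : Measurable v) {C : ℝ≥0} (hC : ∀ r, v r ≤ C)
    {L : ℝ} {Ψ₀ : Config N → ℝ} (hcont : Continuous Ψ₀) (h0 : ∀ X, X ∉ boxN N L → Ψ₀ X = 0)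
    (hnn : ∀ X, 0 ≤ Ψ₀ X) (hnorm : ∫ X, Ψ₀ X ^ 2 = 1) {lam : ℝ}
    (heig : ∀ t : ℝ, 0 < t → Real.exp (-(lam * t)) ≤ ∫ X, Ψ₀ X * fkReal v L t Ψ₀ X) {K' : ℝ}
    (hK' : lam - (∫ X, Ψ₀ X ^ 2 * (interaction v X).toReal) < K') :
    ∀ᶠ t : ℝ≥0 in 𝓝[>] 0, (ENNReal.ofReal (2 * t))⁻¹ * sqIncr t Ψ₀ ≤ ENNReal.ofReal K' := by
  have hΨ2 : MemLp Ψ₀ 2 volume := hcont.memLp_of_hasCompactSupport (hasCompactSupport_of_eq_zero_gsfk h0)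
  have hsqfin : ∫⁻ X, ENNReal.ofReal (Ψ₀ X ^ 2) ≠ ⊤ := by
    rw [← ofReal_integral_eq_lintegral_ofReal hΨ2.integrable_sq (Eventually.of_forall fun X => sq_nonneg _)]
    exact ENNReal.ofReal_ne_top
  filter_upwards [sqIncr_toReal_eventually_le hv hC hcont h0 hnn hnorm heig hK', self_mem_nhdsWithin]
    with t ht htpos
  have hfin : sqIncr t Ψ₀ ≠ ⊤ := (sqIncr_lt_top hcont.measurable hsqfin t).ne
  have h2t : ENNReal.ofReal (2 * t) ≠ 0 :=
    (ENNReal.ofReal_pos.2 (mul_pos two_pos (by exact_mod_cast htpos))).ne'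
  rw [ENNReal.inv_mul_le_iff h2t ENNReal.ofReal_ne_top, ← ENNReal.ofReal_toReal hfin,
    ← ENNReal.ofReal_mul (by positivity)]
  exact ENNReal.ofReal_le_ofReal (by linarith)

/-- **The potential energy of an eigenfunction candidate is at most `λ`**: `∫ Ψ₀² V ≤ λ`
(the eventual bound `sqIncr t Ψ₀ ≤ 2tK'` with `sqIncr ≥ 0` forces `K' ≥ 0` for every
`K' > λ - ∫Ψ₀²V`). [folklore] -/
private theorem integral_sq_mul_interaction_le_gsfk {v : ℝ → ℝ≥0∞} (hv : Measurable v) {C : ℝ≥0} (hC : ∀ r, v r ≤ C)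
    {L : ℝ} {Ψ₀ : Config N → ℝ} (hcont : Continuous Ψ₀) (h0 : ∀ X, X ∉ boxN N L → Ψ₀ X = 0)
    (hnn : ∀ X, 0 ≤ Ψ₀ X) (hnorm : ∫ X, Ψ₀ X ^ 2 = 1) {lam : ℝ}
    (heig : ∀ t : ℝ, 0 < t → Real.exp (-(lam * t)) ≤ ∫ X, Ψ₀ X * fkReal v L t Ψ₀ X) :
    ∫ X, Ψ₀ X ^ 2 * (interaction v X).toReal ≤ lam := by
  by_contra hlt
  push Not at hlt
  set K : ℝ := lam - ∫ X, Ψ₀ X ^ 2 * (interaction v X).toReal with hK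
  have hK0 : K < 0 := by rw [hK]; linarith
  have hev := sqIncr_toReal_eventually_le hv hC hcont h0 hnn hnorm heig (K' := K / 2) (by linarith)
  obtain ⟨t, ht, htpos⟩ := (hev.and self_mem_nhdsWithin).exists
  have ht' : (0 : ℝ) < t := by exact_mod_cast htpos
  have h0le : 0 ≤ (sqIncr t Ψ₀).toReal := ENNReal.toReal_nonneg
  nlinarith

end Literature.MathematicalPhysics.QuantumManyBody.BoseGas

end

/-!
# Part III — the variational identification

## Ground-state Feynman–Kac: the variational identification `E₀ = λ₀`

Topic `Literature/MathematicalPhysics/QuantumManyBody`; last support file (assembly of the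
identification) for the proof of the named fact
`Literature.MathematicalPhysics.QuantumManyBody.BoseGas.GroundStateFeynmanKac`. Chung–Zhao (1995),
Thm 3.27 with Prop 3.29 (81): the top of the spectrum of the Feynman–Kac semigroup of the killed,
weighted Brownian motion on a domain is the variational constant
`λ₁ = sup {∫ (-|∇φ|²/2 + qφ²) : φ ∈ C_c^∞(D), ‖φ‖₂ = 1}`. In the tree's variables (speed-`2`
world-lines, `q = -V`, `H_N = -Δ + V ≥ 0`, `T_t = e^{-tH_N}`) this reads
`groundStateEnergy v N L = λ₀ := -log ‖T_1‖`, and it is proved here from two properties of `λ`: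

* the **Rayleigh bound** `⟨f, T_t f⟩ ≤ e^{-λt}‖f‖²` on `C¹` real functions vanishing off the box
  (`⇒ ofReal λ ≤ groundStateEnergy`, `GroundStateFeynmanKacFormBound`);
* an **integrated eigen-relation** `e^{-λt} ≤ ⟨Ψ₀, T_t Ψ₀⟩` for a continuous, nonnegative,
  permutation-symmetric, normalised `Ψ₀` vanishing off the box (`⇒ groundStateEnergy ≤ ofReal λ`,
  this file: `groundStateEnergy_le_ofReal_of_eigen`, by the explicit symmetric `C¹` Dirichlet
  trial states built from `trialFn` (`GroundStateFeynmanKacTrialState`), whose energies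
  tend to at most `λ` by `GroundStateFeynmanKacEigenForm` and uniform convergence).

Main statements: `energy_of_ofReal_mul_gsfk`, `groundStateEnergy_le_ofReal_of_eigen`,
**`groundStateEnergy_eq_ofReal`** (with `0 ≤ λ`, `groundStateEnergy ≠ ⊤`,
`(groundStateEnergy).toReal = λ`). No named fact is introduced.

## References

* K. L. Chung, Z. Zhao, *From Brownian Motion to Schrödinger's Equation* (1995), Thm 3.27,
  Prop 3.29 (81). [ChungZhao1995]
* E. H. Lieb, R. Seiringer, J. P. Solovej, J. Yngvason (2005), §1.2 (1.16)–(1.17), (2.3).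
  [LSSY2005]
-/

noncomputable section

namespace Literature.MathematicalPhysics.QuantumManyBody.BoseGas

open MeasureTheory Filter Set
open scoped ENNReal NNReal Topology

variable {N : ℕ}

/-! ### The trial state -/

/-- `‖(r : ℂ)‖₊² = ofReal (r²)`. [folklore] -/
private theorem ennnorm_sq_ofReal_gsfk (r : ℝ) : ((‖(r : ℂ)‖₊ : ℝ≥0∞)) ^ 2 = ENNReal.ofReal (r ^ 2) := by
  rw [nnnorm_real_complex, ← ENNReal.coe_pow, ← ENNReal.ofReal_coe_nnreal]
  congr 1
  push_cast
  rw [Real.norm_eq_abs, sq_abs]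

section TrialData

variable {L θ : ℝ} {Ψ₀ : Config N → ℝ}

/-- The trial function has compact support (`L > 0`, `θ > 1`). [folklore] -/
private theorem hasCompactSupport_trialFn_gsfk (hL : 0 < L) (hθ : 1 < θ) (h0 : ∀ X, X ∉ boxN N L → Ψ₀ X = 0) :
    HasCompactSupport (trialFn L θ Ψ₀) :=
  hasCompactSupport_of_eq_zero_gsfk (trialFn_eq_zero hL hθ h0)

/-- The square of the trial function is integrable. [folklore] -/
private theorem integrable_trialFn_sq_gsfk (hL : 0 < L) (hθ : 1 < θ) (hcont : Continuous Ψ₀)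
    (h0 : ∀ X, X ∉ boxN N L → Ψ₀ X = 0) : Integrable (fun X => trialFn L θ Ψ₀ X ^ 2) volume :=
  ((contDiff_trialFn hcont).continuous.memLp_of_hasCompactSupport
    (hasCompactSupport_trialFn_gsfk hL hθ h0)).integrable_sq

/-- The squared norm of the trial function is nonnegative. [folklore] -/
private theorem integral_trialFn_sq_nonneg_gsfk : 0 ≤ ∫ X, trialFn L θ Ψ₀ X ^ 2 :=
  integral_nonneg fun _ => sq_nonneg _

end TrialData

/-! ### The energy of the trial state -/

/-- Scaling of the real kinetic density: `|∇(cφ)|² = c² |∇φ|²`. [folklore] -/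
private theorem realKinetic_const_mul_gsfk {φ : Config N → ℝ} (hφ : Differentiable ℝ φ) (c : ℝ) (X : Config N) :
    realKinetic (fun Y => c * φ Y) X = ENNReal.ofReal (c ^ 2) * realKinetic φ X := by
  unfold realKinetic
  have hd : fderiv ℝ (fun Y => c * φ Y) X = c • fderiv ℝ φ X :=
    ((hφ X).hasFDerivAt.const_mul c).fderiv
  rw [hd, Finset.mul_sum]
  refine Finset.sum_congr rfl fun i _ => ?_
  rw [Finset.mul_sum]
  refine Finset.sum_congr rfl fun k _ => ?_
  rw [show (c • fderiv ℝ φ X) (Pi.single i (EuclideanSpace.single k (1 : ℝ))) =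
      c * fderiv ℝ φ X (Pi.single i (EuclideanSpace.single k (1 : ℝ))) from rfl, nnnorm_mul, ENNReal.coe_mul, mul_pow,
    ← ENNReal.coe_pow, ← ENNReal.ofReal_coe_nnreal]
  congr 1
  push_cast
  rw [Real.norm_eq_abs, sq_abs]

/-- **The energy of a real-scaled trial state**: if the wave function of the trial state `Ψ` is
`c · φ` for a real `C¹` function `φ`, then `𝓔[Ψ] = c² · (∫|∇φ|² + ∫ φ² V)`.
[cite: LSSY2005, §1.2 (1.16)] -/
private theorem energy_of_ofReal_mul_gsfk {L : ℝ} (Ψ : TrialState N L) {c : ℝ} {φ : Config N → ℝ}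
    (hφC : ContDiff ℝ 1 φ) (hΨ : Ψ.ψ = fun X => (((c * φ X : ℝ)) : ℂ)) (v : ℝ → ℝ≥0∞) :
    energy v Ψ = ENNReal.ofReal (c ^ 2) *
      ((∫⁻ X, realKinetic φ X) + ∫⁻ X, ENNReal.ofReal (φ X ^ 2) * interaction v X) := by
  have hφd : Differentiable ℝ φ := hφC.differentiable one_ne_zero
  have hcφd : Differentiable ℝ fun Y => c * φ Y := (differentiable_const c).mul hφd
  have hkin : ∀ X, kineticDensity Ψ.ψ X = ENNReal.ofReal (c ^ 2) * realKinetic φ X := by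
    intro X
    rw [hΨ, kineticDensity_ofReal hcφd, realKinetic_const_mul_gsfk hφd]
  have hnorm : ∀ X, ((‖Ψ.ψ X‖₊ : ℝ≥0∞)) ^ 2 = ENNReal.ofReal (c ^ 2) * ENNReal.ofReal (φ X ^ 2) := by
    intro X
    rw [hΨ, ennnorm_sq_ofReal_gsfk, mul_pow, ENNReal.ofReal_mul (sq_nonneg _)]
  unfold energy
  simp_rw [hkin, hnorm]
  have h1 : ∀ X, ENNReal.ofReal (c ^ 2) * realKinetic φ X +
      interaction v X * (ENNReal.ofReal (c ^ 2) * ENNReal.ofReal (φ X ^ 2)) =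
      ENNReal.ofReal (c ^ 2) * (realKinetic φ X + ENNReal.ofReal (φ X ^ 2) * interaction v X) := by
    intro X; ring
  simp_rw [h1]
  rw [lintegral_const_mul' _ _ ENNReal.ofReal_ne_top, lintegral_add_left (measurable_realKinetic hφC)]

/-! ### `groundStateEnergy ≤ λ` from the integrated eigen-relation -/

/-- Real form of the mass of a nonnegative-square with a bounded weight on the box:
`|∫ (φ² - Ψ₀²) w| ≤ B · vol(Λ) · 2M · s` when `sup|φ - Ψ₀| ≤ s`, `|φ|, |Ψ₀| ≤ M`, `|w| ≤ B`, and both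
functions vanish off the box. [folklore] -/
private theorem abs_integral_sq_sub_sq_mul_le_gsfk {L : ℝ} {φ Ψ₀ w : Config N → ℝ}
    {M s B : ℝ} (hM0 : 0 ≤ M) (hs0 : 0 ≤ s) (hφM : ∀ X, |φ X| ≤ M) (hΨM : ∀ X, |Ψ₀ X| ≤ M) (hw : ∀ X, |w X| ≤ B)
    (hφ0 : ∀ X, X ∉ boxN N L → φ X = 0) (hΨ0 : ∀ X, X ∉ boxN N L → Ψ₀ X = 0)
    (hsup : ∀ X, |φ X - Ψ₀ X| ≤ s) :
    |∫ X, (φ X ^ 2 - Ψ₀ X ^ 2) * w X| ≤ B * (volume (boxN N L)).toReal * (2 * M) * s := by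
  have hpt : ∀ X, |(φ X ^ 2 - Ψ₀ X ^ 2) * w X| ≤
      (boxN N L).indicator (fun _ => B * (2 * M) * s) X := by
    intro X
    by_cases hX : X ∈ boxN N L
    · rw [Set.indicator_of_mem hX, abs_mul, show φ X ^ 2 - Ψ₀ X ^ 2 = (φ X - Ψ₀ X) * (φ X + Ψ₀ X) by ring,
        abs_mul]
      calc |φ X - Ψ₀ X| * |φ X + Ψ₀ X| * |w X| ≤ s * (M + M) * B := by
            refine mul_le_mul (mul_le_mul (hsup X) ((abs_add_le _ _).trans (add_le_add (hφM X) (hΨM X)))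
              (abs_nonneg _) hs0) (hw X) (abs_nonneg _) (by positivity)
        _ = B * (2 * M) * s := by ring
    · rw [Set.indicator_of_notMem hX, hφ0 X hX, hΨ0 X hX]; simp
  have hint : Integrable ((boxN N L).indicator fun _ : Config N => B * (2 * M) * s) volume := by
    refine IntegrableOn.integrable_indicator ?_ (measurableSet_boxN N L)
    exact integrableOn_const (volume_boxN_lt_top N L).ne
  calc |∫ X, (φ X ^ 2 - Ψ₀ X ^ 2) * w X| ≤ ∫ X, (boxN N L).indicator (fun _ => B * (2 * M) * s) X := by
        rw [← Real.norm_eq_abs]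
        refine norm_integral_le_of_norm_le hint (Eventually.of_forall fun X => ?_)
        rw [Real.norm_eq_abs]; exact hpt X
    _ = B * (volume (boxN N L)).toReal * (2 * M) * s := by
        rw [integral_indicator_const _ (measurableSet_boxN N L), smul_eq_mul, measureReal_def]
        ring

/-- **`groundStateEnergy v N L ≤ λ` from the integrated eigen-relation.** For `L > 0`, a
measurable pair potential `v ≤ C`, and a continuous, nonnegative, permutation-symmetric `Ψ₀`
vanishing off `Λ_L^N` with `∫Ψ₀² = 1` and `e^{-λt} ≤ ⟨Ψ₀, e^{-tH_N}Ψ₀⟩` for all `t > 0`: the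
symmetric `C¹` Dirichlet trial states built from `trialFn L θ Ψ₀` have energies eventually below
`λ + ε` for every `ε > 0` (Chung–Zhao's Prop 3.29, upper half, in the tree's variational
vocabulary). [cite: ChungZhao1995, Thm 3.27 and Prop 3.29 (81)] -/
theorem groundStateEnergy_le_ofReal_of_eigen {L : ℝ} (hL : 0 < L) {v : ℝ → ℝ≥0∞} (hv : Measurable v)
    {C : ℝ≥0} (hC : ∀ r, v r ≤ C) {Ψ₀ : Config N → ℝ} (hcont : Continuous Ψ₀)
    (h0 : ∀ X, X ∉ boxN N L → Ψ₀ X = 0) (hnn : ∀ X, 0 ≤ Ψ₀ X)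
    (hsymm : ∀ (σ : Equiv.Perm (Fin N)) (X : Config N), Ψ₀ (X ∘ σ) = Ψ₀ X)
    (hnorm : ∫ X, Ψ₀ X ^ 2 = 1) {lam : ℝ}
    (heig : ∀ t : ℝ, 0 < t → Real.exp (-(lam * t)) ≤ ∫ X, Ψ₀ X * fkReal v L t Ψ₀ X) :
    groundStateEnergy v N L ≤ ENNReal.ofReal lam := by
  -- data of `Ψ₀`
  have hcs := hasCompactSupport_of_eq_zero_gsfk h0
  have hΨm : Measurable Ψ₀ := hcont.measurable
  obtain ⟨M0, hM0⟩ := hcs.exists_bound_of_continuous hcont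
  set M : ℝ := max M0 0 with hMdef
  have hMnn : 0 ≤ M := le_max_right _ _
  have hMabs : ∀ X, |Ψ₀ X| ≤ M := fun X => by
    have := hM0 X; rw [Real.norm_eq_abs] at this; exact this.trans (le_max_left _ _)
  have hΨsq : Integrable (fun X => Ψ₀ X ^ 2) volume := (hcont.memLp_of_hasCompactSupport hcs).integrable_sq
  set Pot : ℝ := ∫ X, Ψ₀ X ^ 2 * (interaction v X).toReal with hPotdef
  have hPot0 : 0 ≤ Pot := integral_nonneg fun X => mul_nonneg (sq_nonneg _) ENNReal.toReal_nonneg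
  have hPotle : Pot ≤ lam := integral_sq_mul_interaction_le_gsfk hv hC hcont h0 hnn hnorm heig
  have hlam0 : 0 ≤ lam := hPot0.trans hPotle
  -- the bounded weight `V.toReal ≤ N²C`
  set CV : ℝ := ((N * N : ℕ) : ℝ) * C with hCVdef
  have hCV0 : 0 ≤ CV := by positivity
  have hVreal : ∀ X : Config N, |(interaction v X).toReal| ≤ CV := fun X => by
    rw [abs_of_nonneg ENNReal.toReal_nonneg]
    have h1 := interaction_le_of_le (C := (C : ℝ≥0∞)) (fun r => hC r) X
    have h2 : ((N * N : ℕ) : ℝ≥0∞) * (C : ℝ≥0∞) ≠ ⊤ := ENNReal.mul_ne_top (ENNReal.natCast_ne_top _) ENNReal.coe_ne_top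
    have := ENNReal.toReal_mono h2 h1
    rw [ENNReal.toReal_mul] at this
    simpa [hCVdef] using this
  set vol : ℝ := (volume (boxN N L)).toReal with hvoldef
  have hvol0 : 0 ≤ vol := ENNReal.toReal_nonneg
  -- `ε`-management
  refine ENNReal.le_of_forall_pos_le_add fun ε hε _ => ?_
  set η : ℝ := min ((ε : ℝ) / 4) (1 / 4) with hηdef
  have hε' : (0 : ℝ) < ε := by exact_mod_cast hε
  have hη : 0 < η := lt_min (by linarith) (by norm_num)
  have hη4 : 4 * η ≤ ε := by have := min_le_left ((ε : ℝ) / 4) (1 / 4); linarith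
  have hη1 : η ≤ 1 / 4 := min_le_right _ _
  set K' : ℝ := lam - Pot + η with hK'def
  have hK' : lam - Pot < K' := by rw [hK'def]; linarith
  have hK'0 : 0 ≤ K' := by rw [hK'def]; linarith
  have hev := sqIncr_div_eventually_le hv hC hcont h0 hnn hnorm heig hK'
  set τ : ℝ := η / (lam + 4 * η + 1) with hτdef
  have hτ : 0 < τ := div_pos hη (by linarith)
  have hτη : τ ≤ η := by
    rw [hτdef, div_le_iff₀ (by linarith)]; nlinarith
  have hτlam : τ * (lam + 4 * η) ≤ η := by
    rw [hτdef]
    rw [div_mul_eq_mul_div, div_le_iff₀ (by linarith)]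
    nlinarith
  set s : ℝ := τ / ((CV + 1) * (vol + 1) * (2 * M + 1)) with hsdef
  have hs : 0 < s := div_pos hτ (by positivity)
  have hsB : ∀ B : ℝ, 0 ≤ B → B ≤ CV + 1 → B * vol * (2 * M) * s ≤ τ := by
    intro B hB0 hB1
    have hden : 0 < (CV + 1) * (vol + 1) * (2 * M + 1) := by positivity
    have : B * vol * (2 * M) * s = τ * (B * vol * (2 * M) / ((CV + 1) * (vol + 1) * (2 * M + 1))) := by
      simp only [hsdef]; field_simp
    rw [this]
    calc τ * (B * vol * (2 * M) / ((CV + 1) * (vol + 1) * (2 * M + 1))) ≤ τ * 1 := by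
          refine mul_le_mul_of_nonneg_left ((div_le_one hden).2 ?_) hτ.le
          have h1 : B * vol * (2 * M) ≤ (CV + 1) * (vol + 1) * (2 * M + 1) := by
            calc B * vol * (2 * M) ≤ (CV + 1) * vol * (2 * M) := by gcongr
              _ ≤ (CV + 1) * (vol + 1) * (2 * M + 1) := by
                  gcongr <;> linarith
          exact h1
      _ = τ := mul_one τ
  -- choose `θ`
  have hunif := trialFn_tendsto_uniformly hL hcont h0 hs
  have hsq : ∀ᶠ θ : ℝ in 𝓝[>] 1, θ ^ 2 * K' ≤ K' + η := by
    have hc : Continuous fun θ : ℝ => θ ^ 2 * K' := by fun_prop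
    have h1 : (fun θ : ℝ => θ ^ 2 * K') 1 < K' + η := by simp [hη]
    exact ((hc.tendsto 1).eventually (gt_mem_nhds h1)).filter_mono nhdsWithin_le_nhds |>.mono
      fun θ hθ => hθ.le
  obtain ⟨θ, ⟨hu, hθsq⟩, hθ1⟩ := ((hunif.and hsq).and self_mem_nhdsWithin).exists
  have hθ1' : (1 : ℝ) < θ := hθ1
  -- the trial function at this `θ`
  set φ := trialFn L θ Ψ₀ with hφdef
  have hφC : ContDiff ℝ 1 φ := contDiff_trialFn hcont
  have hφm : Measurable φ := hφC.continuous.measurable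
  have hφM : ∀ X, |φ X| ≤ M := abs_trialFn_le hMabs
  have hφ0 : ∀ X, X ∉ boxN N L → φ X = 0 := trialFn_eq_zero hL hθ1' h0
  have hφsq : Integrable (fun X => φ X ^ 2) volume := integrable_trialFn_sq_gsfk hL hθ1' hcont h0
  -- the norm and the potential energy are close to `1` and `Pot`
  have hn1 : |(∫ X, φ X ^ 2) - 1| ≤ τ := by
    have heq : (∫ X, φ X ^ 2) - 1 = ∫ X, (φ X ^ 2 - Ψ₀ X ^ 2) * (fun _ => (1 : ℝ)) X := by
      simp only [mul_one]
      rw [integral_sub hφsq hΨsq, hnorm]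
    rw [heq]
    refine (abs_integral_sq_sub_sq_mul_le_gsfk (B := 1) hMnn hs.le hφM hMabs (fun _ => by norm_num) hφ0 h0 hu).trans ?_
    exact hsB 1 zero_le_one (by linarith)
  set PotV : ℝ := ∫ X, φ X ^ 2 * (interaction v X).toReal with hPotVdef
  have hPV : |PotV - Pot| ≤ τ := by
    have hint1 : Integrable (fun X => φ X ^ 2 * (interaction v X).toReal) volume := by
      refine (hφsq.mul_const CV).mono' ((hφm.pow_const 2).mul
        (measurable_interaction hv).ennreal_toReal).aestronglyMeasurable (Eventually.of_forall fun X => ?_)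
      rw [Real.norm_eq_abs, abs_mul, abs_of_nonneg (sq_nonneg _)]
      exact mul_le_mul_of_nonneg_left (hVreal X) (sq_nonneg _)
    have hint2 : Integrable (fun X => Ψ₀ X ^ 2 * (interaction v X).toReal) volume := by
      refine (hΨsq.mul_const CV).mono' ((hΨm.pow_const 2).mul
        (measurable_interaction hv).ennreal_toReal).aestronglyMeasurable (Eventually.of_forall fun X => ?_)
      rw [Real.norm_eq_abs, abs_mul, abs_of_nonneg (sq_nonneg _)]
      exact mul_le_mul_of_nonneg_left (hVreal X) (sq_nonneg _)
    have heq : PotV - Pot = ∫ X, (φ X ^ 2 - Ψ₀ X ^ 2) * (interaction v X).toReal := by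
      rw [hPotVdef, hPotdef, ← integral_sub hint1 hint2]
      refine integral_congr_ae (Eventually.of_forall fun X => ?_)
      ring
    rw [heq]
    refine (abs_integral_sq_sub_sq_mul_le_gsfk hMnn hs.le hφM hMabs hVreal hφ0 h0 hu).trans ?_
    exact hsB CV hCV0 (by linarith)
  -- positivity of the norm and the trial state
  have hn0 : 0 < ∫ X, φ X ^ 2 := by
    have := (abs_le.1 hn1).1; linarith
  set c : ℝ := (Real.sqrt (∫ X, φ X ^ 2))⁻¹ with hc
  have hc2 : c ^ 2 = (∫ X, φ X ^ 2)⁻¹ := by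
    rw [hc, inv_pow, Real.sq_sqrt hn0.le]
  have hnormΨ : ∫⁻ X, ((‖((c * φ X : ℝ) : ℂ)‖₊ : ℝ≥0∞)) ^ 2 = 1 := by
    have h1 : ∀ X, ((‖((c * φ X : ℝ) : ℂ)‖₊ : ℝ≥0∞)) ^ 2 =
        ENNReal.ofReal (c ^ 2) * ENNReal.ofReal (φ X ^ 2) := fun X => by
      rw [ennnorm_sq_ofReal_gsfk, mul_pow, ENNReal.ofReal_mul (sq_nonneg _)]
    simp_rw [h1]
    rw [lintegral_const_mul' _ _ ENNReal.ofReal_ne_top,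
      ← ofReal_integral_eq_lintegral_ofReal hφsq (Eventually.of_forall fun X => sq_nonneg _),
      ← ENNReal.ofReal_mul (sq_nonneg _), hc2, inv_mul_cancel₀ hn0.ne', ENNReal.ofReal_one]
  let Ψ : TrialState N L :=
    { ψ := fun X => (((c * φ X : ℝ)) : ℂ)
      contDiff := Complex.ofRealCLM.contDiff.comp (contDiff_const.mul hφC)
      eq_zero := fun X hX => by simp [hφ0 X hX]
      symm := fun σ X => by
        show (((c * φ (X ∘ σ) : ℝ)) : ℂ) = (((c * φ X : ℝ)) : ℂ)
        rw [hφdef, trialFn_comp_perm hsymm σ X]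
      norm_eq := hnormΨ }
  -- the kinetic bound
  have hkin : ∫⁻ X, realKinetic φ X ≤ ENNReal.ofReal (K' + η) :=
    (lintegral_realKinetic_trialFn_le hθ1' hcont hMabs hev).trans (ENNReal.ofReal_le_ofReal hθsq)
  have hpotE : ∫⁻ X, ENNReal.ofReal (φ X ^ 2) * interaction v X = ENNReal.ofReal PotV :=
    lintegral_sq_mul_interaction_eq_ofReal_gsfk hv hC hφm hφsq
  have hPotV0 : 0 ≤ PotV := integral_nonneg fun X => mul_nonneg (sq_nonneg _) ENNReal.toReal_nonneg
  -- the energy bound in `[0, ∞]`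
  have hE : energy v Ψ ≤ ENNReal.ofReal ((∫ X, φ X ^ 2)⁻¹ * (K' + η + PotV)) := by
    rw [energy_of_ofReal_mul_gsfk Ψ hφC rfl v, hpotE, hc2,
      ENNReal.ofReal_mul (inv_nonneg.2 hn0.le), ENNReal.ofReal_add (by linarith) hPotV0]
    gcongr
  -- the real inequality
  have hreal : (∫ X, φ X ^ 2)⁻¹ * (K' + η + PotV) ≤ lam + ε := by
    set n := ∫ X, φ X ^ 2 with hndef
    have hn_low : 1 - τ ≤ n := by have := (abs_le.1 hn1).1; linarith
    have hPVle : PotV ≤ Pot + τ := by have := (abs_le.1 hPV).2; linarith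
    rw [inv_mul_le_iff₀ hn0]
    have h1 : K' + η + PotV ≤ lam + 3 * η := by rw [hK'def]; linarith
    have h2 : lam + 3 * η ≤ n * (lam + 4 * η) := by nlinarith
    nlinarith
  calc groundStateEnergy v N L ≤ energy v Ψ := groundStateEnergy_le_energy v Ψ
    _ ≤ ENNReal.ofReal ((∫ X, φ X ^ 2)⁻¹ * (K' + η + PotV)) := hE
    _ ≤ ENNReal.ofReal (lam + ε) := ENNReal.ofReal_le_ofReal hreal
    _ ≤ ENNReal.ofReal lam + ENNReal.ofReal ε := ENNReal.ofReal_add_le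
    _ = ENNReal.ofReal lam + ε := by rw [ENNReal.ofReal_coe_nnreal]

/-! ### The identification -/

/-- **The variational identification `groundStateEnergy v N L = λ`** (Chung–Zhao (1995) Thm 3.27
with Prop 3.29 (81), in the tree's variables). Let `L > 0`, `v` a measurable pair potential
bounded by `C`, and `λ ∈ ℝ` such that
(i) the Feynman–Kac semigroup obeys the Rayleigh bound `⟨f, e^{-tH_N}f⟩ ≤ e^{-λt}‖f‖²` for all
`t > 0` and all `C¹` real `f` vanishing off `Λ_L^N` (true when `e^{-λ}` is the top of the spectrum
of `e^{-H_N}` on `L²(Λ)`), and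
(ii) some continuous, nonnegative, permutation-symmetric `Ψ₀` vanishing off the box with
`∫Ψ₀² = 1` satisfies `e^{-λt} ≤ ⟨Ψ₀, e^{-tH_N}Ψ₀⟩` for all `t > 0` (true for the normalised
Perron–Frobenius eigenfunction).
Then the variational ground-state energy over the symmetric `C¹` Dirichlet core equals `λ`:
`groundStateEnergy v N L = ENNReal.ofReal λ`, and `0 ≤ λ`.
[cite: ChungZhao1995, Thm 3.27 and Prop 3.29 (81)] -/
theorem groundStateEnergy_eq_ofReal {L : ℝ} (hL : 0 < L) {v : ℝ → ℝ≥0∞} (hv : Measurable v)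
    {C : ℝ≥0} (hC : ∀ r, v r ≤ C) {lam : ℝ}
    (htop : ∀ f : Config N → ℝ, ContDiff ℝ 1 f → (∀ X, X ∉ boxN N L → f X = 0) →
      ∀ t : ℝ, 0 < t → ∫ X, f X * fkReal v L t f X ≤ Real.exp (-(lam * t)) * ∫ X, f X ^ 2)
    {Ψ₀ : Config N → ℝ} (hcont : Continuous Ψ₀) (h0 : ∀ X, X ∉ boxN N L → Ψ₀ X = 0)
    (hnn : ∀ X, 0 ≤ Ψ₀ X) (hsymm : ∀ (σ : Equiv.Perm (Fin N)) (X : Config N), Ψ₀ (X ∘ σ) = Ψ₀ X)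
    (hnorm : ∫ X, Ψ₀ X ^ 2 = 1)
    (heig : ∀ t : ℝ, 0 < t → Real.exp (-(lam * t)) ≤ ∫ X, Ψ₀ X * fkReal v L t Ψ₀ X) :
    groundStateEnergy v N L = ENNReal.ofReal lam ∧ 0 ≤ lam := by
  have hle := groundStateEnergy_le_ofReal_of_eigen hL hv hC hcont h0 hnn hsymm hnorm heig
  have hge := ofReal_le_groundStateEnergy_of_pairing_le hL.le hv hC htop
  have hPot0 : 0 ≤ ∫ X, Ψ₀ X ^ 2 * (interaction v X).toReal :=
    integral_nonneg fun X => mul_nonneg (sq_nonneg _) ENNReal.toReal_nonneg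
  exact ⟨le_antisymm hle hge, hPot0.trans (integral_sq_mul_interaction_le_gsfk hv hC hcont h0 hnn hnorm heig)⟩

/-- Under the hypotheses of `groundStateEnergy_eq_ofReal`: the variational ground-state energy is
finite and `(groundStateEnergy v N L).toReal = λ`. [cite: ChungZhao1995, Prop 3.29 (81)] -/
theorem groundStateEnergy_toReal_eq {L : ℝ} (hL : 0 < L) {v : ℝ → ℝ≥0∞} (hv : Measurable v)
    {C : ℝ≥0} (hC : ∀ r, v r ≤ C) {lam : ℝ}
    (htop : ∀ f : Config N → ℝ, ContDiff ℝ 1 f → (∀ X, X ∉ boxN N L → f X = 0) →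
      ∀ t : ℝ, 0 < t → ∫ X, f X * fkReal v L t f X ≤ Real.exp (-(lam * t)) * ∫ X, f X ^ 2)
    {Ψ₀ : Config N → ℝ} (hcont : Continuous Ψ₀) (h0 : ∀ X, X ∉ boxN N L → Ψ₀ X = 0)
    (hnn : ∀ X, 0 ≤ Ψ₀ X) (hsymm : ∀ (σ : Equiv.Perm (Fin N)) (X : Config N), Ψ₀ (X ∘ σ) = Ψ₀ X)
    (hnorm : ∫ X, Ψ₀ X ^ 2 = 1)
    (heig : ∀ t : ℝ, 0 < t → Real.exp (-(lam * t)) ≤ ∫ X, Ψ₀ X * fkReal v L t Ψ₀ X) :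
    groundStateEnergy v N L ≠ ⊤ ∧ (groundStateEnergy v N L).toReal = lam := by
  obtain ⟨heq, hlam⟩ := groundStateEnergy_eq_ofReal hL hv hC htop hcont h0 hnn hsymm hnorm heig
  rw [heq]
  exact ⟨ENNReal.ofReal_ne_top, ENNReal.toReal_ofReal hlam⟩

end Literature.MathematicalPhysics.QuantumManyBody.BoseGas

end

/-!
# Part IV — the assembly

## Ground-state Feynman–Kac theorem for bounded pair potentials: the proof

Topic `Literature/MathematicalPhysics/QuantumManyBody`; theorems only. This file discharges the
named fact `Literature.MathematicalPhysics.QuantumManyBody.BoseGas.GroundStateFeynmanKac`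
(`GroundStateFeynmanKac.lean`): **`theorem GroundStateFeynmanKac_holds : GroundStateFeynmanKac`**.

The witness is the Perron–Frobenius eigenvector of `T_1 = e^{-H_N}` on `L²(Λ_L^N)`
(`fkL2_perronFrobenius`, `GroundStateFeynmanKacPerronFrobenius.lean`), read pointwise through
the smoothing semigroup, `Ψ₀ = ‖T_1‖⁻¹ · T_1 e` (Chung–Zhao (1995) §8.3 (29): eigenfunctions of
`T_t` are continuous versions of the `L²` eigenvectors). The assembly:

* an abstract **Rayleigh bound `⟪x, S_t x⟫ ≤ ‖S_1‖ᵗ ‖x‖²` for symmetric contraction semigroups**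
  (`inner_semigroup_le_rpow_mul`; midpoint log-convexity `⟪x, S_{(a+b)/2} x⟫² ≤ ⟪x,S_a x⟫⟪x,S_b x⟫`
  on dyadic times, monotonicity in `t`, continuity of `‖S_1‖^·`), giving the hypothesis `htop`
  of the variational identification `groundStateEnergy_eq_ofReal`
  (`GroundStateFeynmanKacVariational.lean`) with `λ = -log ‖T_1‖`;
* the **pointwise eigen-relation** `T_t Ψ₀ = ‖T_1‖ᵗ Ψ₀` at every point (`fkReal_eq_rpow_mul`,
  from the `L²` relation `T_t e = ‖T_1‖ᵗ e` of `GroundStateFeynmanKacSpectral` and the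
  insensitivity of `T_s` to null modifications);
* **continuity up to the boundary** (`continuous_fkReal_gsfk`): interior continuity is the strong
  Feller property `continuousAt_fkReal` (`GroundStateFeynmanKacCompact`), and at the boundary of
  the box `|T_t g(X)| ≤ ‖T_{t/2} g‖_∞ · P_X(τ > t/2) → 0`, the exit probability near a face being
  controlled by the small-ball bound for the one-sided running maximum of a Brownian coordinate
  (`Literature.Probability.Process.measure_forall_brownian_lt_le`) — Chung–Zhao Thm 3.17 with the
  regularity of the box (Prop 1.22: `T_t` maps `L^∞` into `C₀(D)` for regular `D`);
* **Bose symmetry** from nondegeneracy (`fkReal_abs_comp_perm`, with the relabelling lemmas of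
  `GroundStateFeynmanKacWitnessSymm`: the relabelled eigenvector is
  again a nonnegative unit top eigenvector, hence equal to `e`; Reed–Simon IV §XIII.12);
* strict positivity on the open box (`fkReal_pos_of_nonneg`, `GroundStateFeynmanKacPositivity`),
  normalisation, the eigen-relation with `E₀ = groundStateEnergy v N L` (the identification), and
  the **ground-state projection** `e^{E₀T} T_T g (X) → ⟨Ψ₀, g⟩ Ψ₀(X)` at every point from the `L²`
  statement `tendsto_rpow_smul_semigroup` (`GroundStateFeynmanKacSpectral`) composed with the
  bounded evaluation functional `fkEval` of `T_1 : L² → L^∞` (Glimm–Jaffe (3.4.2)).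

## References

* K. L. Chung, Z. Zhao, *From Brownian Motion to Schrödinger's Equation*, Springer (1995),
  Prop 1.22, Thms 2.4, 3.17, 3.27, Prop 3.29, §8.3 (29)–(30) and Thm 8.11.
  [cite: ChungZhao1995, Thms 3.17 and 3.27 with Prop 3.29]
* M. Reed, B. Simon, *Methods of Modern Mathematical Physics IV* (1978), §XIII.12 Thm XIII.44.
  [ReedSimonIV1978]
* J. Glimm, A. Jaffe, *Quantum Physics* (1987), §3.3 Thms 3.3.2–3.3.3, §3.4 (3.4.2).
  [GlimmJaffeQP1987]
-/

noncomputable section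

namespace Literature.MathematicalPhysics.QuantumManyBody.BoseGas

open MeasureTheory ProbabilityTheory Filter Set
open scoped ENNReal NNReal Topology InnerProductSpace
open Literature.Probability.Process

variable {N : ℕ}

/-! ### Rayleigh bound for symmetric contraction semigroups -/

section Semigroup

variable {E : Type*} [NormedAddCommGroup E] [InnerProductSpace ℝ E] {S : ℝ → E →L[ℝ] E}

/-- `⟪x, S t x⟫ = ‖S (t/2) x‖²` for a symmetric semigroup. [folklore] -/
private theorem inner_semigroup_eq_norm_sq_gsfk
    (hadd : ∀ s t : ℝ, 0 < s → 0 < t → S (s + t) = (S s).comp (S t))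
    (hsym : ∀ t, 0 < t → ∀ x y, ⟪S t x, y⟫_ℝ = ⟪x, S t y⟫_ℝ) {t : ℝ} (ht : 0 < t) (x : E) :
    ⟪x, S t x⟫_ℝ = ‖S (t / 2) x‖ ^ 2 := by
  conv_lhs => rw [show t = t / 2 + t / 2 by ring, hadd _ _ (half_pos ht) (half_pos ht),
    ContinuousLinearMap.comp_apply, ← hsym _ (half_pos ht)]
  exact real_inner_self_eq_norm_sq _

/-- **Midpoint log-convexity** of `t ↦ ⟪x, S t x⟫`: `⟪x, S ((a+b)/2) x⟫ ≤ √⟪x,S a x⟫ √⟪x,S b x⟫`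
(Cauchy–Schwarz for `⟪S (a/2) x, S (b/2) x⟫`). [folklore] -/
private theorem inner_semigroup_midpoint_le_gsfk
    (hadd : ∀ s t : ℝ, 0 < s → 0 < t → S (s + t) = (S s).comp (S t))
    (hsym : ∀ t, 0 < t → ∀ x y, ⟪S t x, y⟫_ℝ = ⟪x, S t y⟫_ℝ)
    {a b : ℝ} (ha : 0 < a) (hb : 0 < b) (x : E) :
    ⟪x, S ((a + b) / 2) x⟫_ℝ ≤ Real.sqrt ⟪x, S a x⟫_ℝ * Real.sqrt ⟪x, S b x⟫_ℝ := by
  have h1 : S ((a + b) / 2) = (S (a / 2)).comp (S (b / 2)) := by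
    rw [← hadd _ _ (half_pos ha) (half_pos hb)]; congr 1; ring
  rw [h1, ContinuousLinearMap.comp_apply, ← hsym _ (half_pos ha),
    inner_semigroup_eq_norm_sq_gsfk hadd hsym ha, inner_semigroup_eq_norm_sq_gsfk hadd hsym hb,
    Real.sqrt_sq (norm_nonneg _), Real.sqrt_sq (norm_nonneg _)]
  exact real_inner_le_norm _ _

/-- The endpoint case `a = 0`: `⟪x, S (b/2) x⟫ ≤ ‖x‖ √⟪x, S b x⟫`. [folklore] -/
private theorem inner_semigroup_half_le_gsfk
    (hadd : ∀ s t : ℝ, 0 < s → 0 < t → S (s + t) = (S s).comp (S t))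
    (hsym : ∀ t, 0 < t → ∀ x y, ⟪S t x, y⟫_ℝ = ⟪x, S t y⟫_ℝ) {b : ℝ} (hb : 0 < b) (x : E) :
    ⟪x, S (b / 2) x⟫_ℝ ≤ ‖x‖ * Real.sqrt ⟪x, S b x⟫_ℝ := by
  rw [inner_semigroup_eq_norm_sq_gsfk hadd hsym hb, Real.sqrt_sq (norm_nonneg _)]
  exact real_inner_le_norm _ _

/-- `‖S n‖ ≤ ‖S 1‖ⁿ` for positive integers `n`. [folklore] -/
private theorem opNorm_semigroup_nat_le_gsfk
    (hadd : ∀ s t : ℝ, 0 < s → 0 < t → S (s + t) = (S s).comp (S t)) :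
    ∀ n : ℕ, 0 < n → ‖S n‖ ≤ ‖S 1‖ ^ n := by
  intro n hn
  induction n with
  | zero => exact absurd hn (lt_irrefl 0)
  | succ m ih =>
    rcases Nat.eq_zero_or_pos m with rfl | hm
    · simp
    · rw [Nat.cast_succ, hadd _ _ (by exact_mod_cast hm) one_pos, pow_succ]
      exact (ContinuousLinearMap.opNorm_comp_le _ _).trans
        (mul_le_mul_of_nonneg_right (ih hm) (norm_nonneg _))

/-- **Dyadic Rayleigh bound**: `⟪x, S (k/2^m) x⟫ ≤ ‖S 1‖^{k/2^m}` for unit `x` and `k ≥ 1`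
(induction on `m` by midpoint log-convexity). [folklore] -/
private theorem inner_semigroup_dyadic_le_gsfk
    (hadd : ∀ s t : ℝ, 0 < s → 0 < t → S (s + t) = (S s).comp (S t))
    (hsym : ∀ t, 0 < t → ∀ x y, ⟪S t x, y⟫_ℝ = ⟪x, S t y⟫_ℝ) {x : E} (hx : ‖x‖ = 1) (m : ℕ) :
    ∀ k : ℕ, 0 < k → ⟪x, S ((k : ℝ) / 2 ^ m) x⟫_ℝ ≤ ‖S 1‖ ^ ((k : ℝ) / 2 ^ m) := by
  have hμ : 0 ≤ ‖S 1‖ := norm_nonneg _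
  have hsq : ∀ c : ℝ, Real.sqrt (‖S 1‖ ^ c) = ‖S 1‖ ^ (c / 2) := fun c => by
    rw [Real.sqrt_eq_rpow, ← Real.rpow_mul hμ]; congr 1; ring
  induction m with
  | zero =>
    intro k hk
    rw [pow_zero, div_one, Real.rpow_natCast]
    calc ⟪x, S k x⟫_ℝ ≤ ‖x‖ * ‖S k x‖ := real_inner_le_norm _ _
      _ ≤ ‖x‖ * (‖S k‖ * ‖x‖) := mul_le_mul_of_nonneg_left ((S k).le_opNorm x) (norm_nonneg _)
      _ = ‖S k‖ := by rw [hx, one_mul, mul_one]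
      _ ≤ ‖S 1‖ ^ k := opNorm_semigroup_nat_le_gsfk hadd k hk
  | succ m ih =>
    intro k hk
    obtain ⟨j, rfl | rfl⟩ := Nat.even_or_odd' k
    · have hj : 0 < j := by omega
      have h2 : ((2 * j : ℕ) : ℝ) / 2 ^ (m + 1) = (j : ℝ) / 2 ^ m := by
        rw [pow_succ]; push_cast; field_simp
      rw [h2]
      exact ih j hj
    · set a : ℝ := (j : ℝ) / 2 ^ m with ha_def
      set b : ℝ := ((j + 1 : ℕ) : ℝ) / 2 ^ m with hb_def
      have hmid : ((2 * j + 1 : ℕ) : ℝ) / 2 ^ (m + 1) = (a + b) / 2 := by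
        simp only [ha_def, hb_def]; push_cast; rw [pow_succ]; field_simp; ring
      have hb : 0 < b := by rw [hb_def]; positivity
      have hbb := ih (j + 1) (Nat.succ_pos j)
      rw [hmid]
      rcases Nat.eq_zero_or_pos j with rfl | hj
      · have ha0 : a = 0 := by simp [ha_def]
        rw [ha0, zero_add]
        calc ⟪x, S (b / 2) x⟫_ℝ ≤ ‖x‖ * Real.sqrt ⟪x, S b x⟫_ℝ := inner_semigroup_half_le_gsfk hadd hsym hb x
          _ ≤ 1 * Real.sqrt (‖S 1‖ ^ b) := by
              rw [hx]; exact mul_le_mul_of_nonneg_left (Real.sqrt_le_sqrt hbb) zero_le_one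
          _ = ‖S 1‖ ^ (b / 2) := by rw [one_mul, hsq]
      · have ha : 0 < a := by rw [ha_def]; positivity
        have haa := ih j hj
        calc ⟪x, S ((a + b) / 2) x⟫_ℝ ≤ Real.sqrt ⟪x, S a x⟫_ℝ * Real.sqrt ⟪x, S b x⟫_ℝ :=
              inner_semigroup_midpoint_le_gsfk hadd hsym ha hb x
          _ ≤ Real.sqrt (‖S 1‖ ^ a) * Real.sqrt (‖S 1‖ ^ b) :=
              mul_le_mul (Real.sqrt_le_sqrt haa) (Real.sqrt_le_sqrt hbb) (Real.sqrt_nonneg _)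
                (Real.sqrt_nonneg _)
          _ = ‖S 1‖ ^ ((a + b) / 2) := by
              rw [hsq, hsq, ← Real.rpow_add_of_nonneg hμ (by positivity) (by positivity)]
              congr 1; ring

/-- **`t ↦ ⟪x, S t x⟫` is antitone** for a symmetric contraction semigroup. [folklore] -/
private theorem inner_semigroup_antitone_gsfk
    (hadd : ∀ s t : ℝ, 0 < s → 0 < t → S (s + t) = (S s).comp (S t))
    (hcontr : ∀ t, 0 < t → ‖S t‖ ≤ 1)
    (hsym : ∀ t, 0 < t → ∀ x y, ⟪S t x, y⟫_ℝ = ⟪x, S t y⟫_ℝ) {s t : ℝ} (hs : 0 < s) (hst : s < t)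
    (x : E) : ⟪x, S t x⟫_ℝ ≤ ⟪x, S s x⟫_ℝ := by
  have hts : 0 < t - s := sub_pos.2 hst
  have h1 : S t = (S (s / 2)).comp ((S (t - s)).comp (S (s / 2))) := by
    rw [← hadd _ _ hts (half_pos hs), ← hadd _ _ (half_pos hs) (by linarith)]; congr 1; ring
  rw [h1, ContinuousLinearMap.comp_apply, ContinuousLinearMap.comp_apply, ← hsym _ (half_pos hs),
    inner_semigroup_eq_norm_sq_gsfk hadd hsym hs]
  calc ⟪S (s / 2) x, S (t - s) (S (s / 2) x)⟫_ℝ ≤ ‖S (s / 2) x‖ * ‖S (t - s) (S (s / 2) x)‖ :=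
        real_inner_le_norm _ _
    _ ≤ ‖S (s / 2) x‖ * (1 * ‖S (s / 2) x‖) := by
        refine mul_le_mul_of_nonneg_left ?_ (norm_nonneg _)
        exact ((S (t - s)).le_opNorm _).trans
          (mul_le_mul_of_nonneg_right (hcontr _ hts) (norm_nonneg _))
    _ = ‖S (s / 2) x‖ ^ 2 := by ring

/-- **Rayleigh bound `⟪x, S t x⟫ ≤ ‖S 1‖ᵗ` for unit `x` and every `t > 0`** (symmetric contraction
semigroup with `‖S 1‖ > 0`): dyadic times by log-convexity, then monotonicity in `t` and
continuity of `‖S 1‖^·`. Chung–Zhao (1995), Thm 3.27 (`‖T_t‖₂ = e^{λ₁t}`). [folklore] -/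
theorem inner_semigroup_le_rpow
    (hadd : ∀ s t : ℝ, 0 < s → 0 < t → S (s + t) = (S s).comp (S t))
    (hcontr : ∀ t, 0 < t → ‖S t‖ ≤ 1)
    (hsym : ∀ t, 0 < t → ∀ x y, ⟪S t x, y⟫_ℝ = ⟪x, S t y⟫_ℝ) (hμ₀ : 0 < ‖S 1‖)
    {x : E} (hx : ‖x‖ = 1) {t : ℝ} (ht : 0 < t) : ⟪x, S t x⟫_ℝ ≤ ‖S 1‖ ^ t := by
  set d : ℕ → ℝ := fun m => (⌊t * 2 ^ m⌋₊ : ℝ) / 2 ^ m with hd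
  have hd_le : ∀ m, d m ≤ t := fun m => by
    simp only [hd]
    rw [div_le_iff₀ (by positivity)]
    exact Nat.floor_le (by positivity)
  have hd_gt : ∀ m, t - 1 / 2 ^ m < d m := fun m => by
    simp only [hd]
    have h1 := Nat.lt_floor_add_one (t * 2 ^ m)
    have h2 : (0 : ℝ) < 2 ^ m := by positivity
    rw [sub_lt_iff_lt_add, ← add_div, lt_div_iff₀ h2]
    linarith
  have hd_tend : Tendsto d atTop (𝓝 t) := by
    have h0 : Tendsto (fun m : ℕ => t - 1 / (2 : ℝ) ^ m) atTop (𝓝 t) := by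
      have h1 : Tendsto (fun m : ℕ => 1 / (2 : ℝ) ^ m) atTop (𝓝 0) := by
        simp_rw [one_div, ← inv_pow]
        exact tendsto_pow_atTop_nhds_zero_of_lt_one (by norm_num) (by norm_num)
      simpa using tendsto_const_nhds.sub h1
    exact tendsto_of_tendsto_of_tendsto_of_le_of_le h0 tendsto_const_nhds
      (fun m => (hd_gt m).le) hd_le
  have hev : ∀ᶠ m in atTop, 0 < d m := hd_tend.eventually (lt_mem_nhds ht)
  have hR : ∀ᶠ m in atTop, ⟪x, S t x⟫_ℝ ≤ ‖S 1‖ ^ d m := by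
    filter_upwards [hev] with m hm
    have hk : 0 < ⌊t * 2 ^ m⌋₊ := by
      by_contra h
      have h0 : ⌊t * 2 ^ m⌋₊ = 0 := by omega
      simp [hd, h0] at hm
    have hdy := inner_semigroup_dyadic_le_gsfk hadd hsym hx m _ hk
    rcases (hd_le m).lt_or_eq with hlt | heq
    · exact (inner_semigroup_antitone_gsfk hadd hcontr hsym hm hlt x).trans hdy
    · calc ⟪x, S t x⟫_ℝ = ⟪x, S (d m) x⟫_ℝ := by rw [heq]
        _ ≤ _ := hdy
  have hcont : Tendsto (fun m => ‖S 1‖ ^ d m) atTop (𝓝 (‖S 1‖ ^ t)) :=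
    ((Real.continuousAt_const_rpow hμ₀.ne').tendsto).comp hd_tend
  exact ge_of_tendsto hcont hR

/-- Homogeneous form: `⟪x, S t x⟫ ≤ ‖S 1‖ᵗ ‖x‖²` for every `x`. [folklore] -/
theorem inner_semigroup_le_rpow_mul
    (hadd : ∀ s t : ℝ, 0 < s → 0 < t → S (s + t) = (S s).comp (S t))
    (hcontr : ∀ t, 0 < t → ‖S t‖ ≤ 1)
    (hsym : ∀ t, 0 < t → ∀ x y, ⟪S t x, y⟫_ℝ = ⟪x, S t y⟫_ℝ) (hμ₀ : 0 < ‖S 1‖)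
    (x : E) {t : ℝ} (ht : 0 < t) : ⟪x, S t x⟫_ℝ ≤ ‖S 1‖ ^ t * ‖x‖ ^ 2 := by
  by_cases hx0 : x = 0
  · simp [hx0]
  · have hn : 0 < ‖x‖ := norm_pos_iff.2 hx0
    set u : E := ‖x‖⁻¹ • x with hu
    have hu1 : ‖u‖ = 1 := by rw [hu, norm_smul, norm_inv, norm_norm, inv_mul_cancel₀ hn.ne']
    have hxu : x = ‖x‖ • u := by rw [hu, smul_smul, mul_inv_cancel₀ hn.ne', one_smul]
    have h1 := inner_semigroup_le_rpow hadd hcontr hsym hμ₀ hu1 ht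
    have h2 : ⟪x, S t x⟫_ℝ = ‖x‖ ^ 2 * ⟪u, S t u⟫_ℝ := by
      conv_lhs => rw [hxu]
      rw [map_smul, inner_smul_left, inner_smul_right]
      simp only [conj_trivial]
      ring
    rw [h2, mul_comm]
    exact mul_le_mul_of_nonneg_right h1 (sq_nonneg _)

end Semigroup

/-! ### Exit near the faces of the box and continuity up to the boundary -/

/-- A coordinate is bounded by the sup-norm (local copy, outside the import cone of the tree's
`abs_apply_le_norm`). [folklore] -/
private theorem abs_coord_le_norm_gsfk (Y : Config N) (i : Fin N) (k : Fin 3) : |Y i k| ≤ ‖Y‖ := by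
  have h1 : |Y i k| ≤ ‖Y i‖ := by
    have := PiLp.norm_apply_le (Y i) k
    simpa using this
  exact h1.trans (norm_le_pi_norm Y i)

/-- The coordinate of a world-line: `(B_r)_{ik} = X_{ik} + √2 b_r(ω i k)`. [folklore] -/
private theorem worldLine_coord_aux_gsfk (X : Config N) (ω : PathSpace N) (r : ℝ≥0) (i : Fin N) (k : Fin 3) :
    worldLine X ω r i k = X i k + Real.sqrt 2 * brownian r (ω i k) := by
  rw [worldLine_eq_add_displacement]
  simp [Pi.add_apply]

/-- **Exit through an upper face**: if `L - X_{ik} ≤ √2 m` with `0 < m ≤ √s`, the world-lines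
started at `X` survive in the box up to time `s` with probability at most `2 √(m/√s)` (the
coordinate `b(ω i k)` must stay below `m`; small-ball bound for the running maximum,
`measure_forall_brownian_lt_le`). [folklore] -/
private theorem measure_survives_le_of_upper_gsfk (L : ℝ) {s : ℝ≥0} (hs : 0 < s) {m : ℝ} (hm : 0 < m)
    (hms : m ≤ Real.sqrt s) {X : Config N} {i : Fin N} {k : Fin 3}
    (hX : L - X i k ≤ Real.sqrt 2 * m) :
    wienerPaths N (survives L s X) ≤ ENNReal.ofReal (2 * Real.sqrt (m / Real.sqrt s)) := by
  have hsub : survives L s X ⊆ (fun ω : PathSpace N => ω i k) ⁻¹' {η | ∀ r ≤ s, brownian r η < m} := by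
    intro ω hω r hr
    have h1 := hω r ⟨r.2, by exact_mod_cast hr⟩
    simp only [Real.toNNReal_coe] at h1
    have h2 : worldLine X ω r i k < L := (h1 i k).2
    rw [worldLine_coord_aux_gsfk] at h2
    have h3 : Real.sqrt 2 * brownian r (ω i k) < Real.sqrt 2 * m := by linarith
    exact lt_of_mul_lt_mul_left h3 (Real.sqrt_nonneg _)
  calc wienerPaths N (survives L s X)
      ≤ wienerPaths N ((fun ω : PathSpace N => ω i k) ⁻¹' {η | ∀ r ≤ s, brownian r η < m}) :=
        measure_mono hsub
    _ ≤ (wienerPaths N).map (fun ω : PathSpace N => ω i k) {η | ∀ r ≤ s, brownian r η < m} :=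
        Measure.le_map_apply (measurePreserving_apply₂ i k).measurable.aemeasurable _
    _ = preWienerMeasure {η | ∀ r ≤ s, brownian r η < m} := by
        rw [(measurePreserving_apply₂ (N := N) i k).map_eq]
    _ ≤ _ := measure_forall_brownian_lt_le hs hm hms

/-- **Exit through a lower face**: if `X_{ik} ≤ √2 m` with `0 < m ≤ √s`, the survival probability
up to time `s` is at most `2 √(m/√s)` (`-b(ω i k)` is again a Brownian motion,
`IsPreBrownianReal.neg`). [folklore] -/
private theorem measure_survives_le_of_lower_gsfk (L : ℝ) {s : ℝ≥0} (hs : 0 < s) {m : ℝ} (hm : 0 < m)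
    (hms : m ≤ Real.sqrt s) {X : Config N} {i : Fin N} {k : Fin 3}
    (hX : X i k ≤ Real.sqrt 2 * m) :
    wienerPaths N (survives L s X) ≤ ENNReal.ofReal (2 * Real.sqrt (m / Real.sqrt s)) := by
  have hsub : survives L s X ⊆
      (fun ω : PathSpace N => ω i k) ⁻¹' {η | ∀ r ≤ s, (-brownian) r η < m} := by
    intro ω hω r hr
    have h1 := hω r ⟨r.2, by exact_mod_cast hr⟩
    simp only [Real.toNNReal_coe] at h1
    have h2 : 0 < worldLine X ω r i k := (h1 i k).1
    rw [worldLine_coord_aux_gsfk] at h2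
    simp only [Pi.neg_apply]
    have h3 : Real.sqrt 2 * (-brownian r (ω i k)) < Real.sqrt 2 * m := by linarith
    exact lt_of_mul_lt_mul_left h3 (Real.sqrt_nonneg _)
  have hneg : IsPreBrownianReal (-brownian) preWienerMeasure :=
    Literature.Probability.RandomPlanarGeometry.isPreBrownianReal_brownian.neg
  calc wienerPaths N (survives L s X)
      ≤ wienerPaths N ((fun ω : PathSpace N => ω i k) ⁻¹' {η | ∀ r ≤ s, (-brownian) r η < m}) :=
        measure_mono hsub
    _ ≤ (wienerPaths N).map (fun ω : PathSpace N => ω i k) {η | ∀ r ≤ s, (-brownian) r η < m} :=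
        Measure.le_map_apply (measurePreserving_apply₂ i k).measurable.aemeasurable _
    _ = preWienerMeasure {η | ∀ r ≤ s, (-brownian) r η < m} := by
        rw [(measurePreserving_apply₂ (N := N) i k).map_eq]
    _ ≤ _ := measure_forall_lt_le_of_isPreBrownianReal hneg
        (fun t => (measurable_brownian t).neg) (fun η => (continuous_brownian η).neg) hs hm hms

/-- **Uniform bound by the survival probability**: `|(e^{-sH} h)(X)| ≤ M · P_X(τ > s)` for
`|h| ≤ M`. [folklore] -/
private theorem abs_fkReal_le_mul_measure_survives_gsfk (v : ℝ → ℝ≥0∞) (L s : ℝ) {h : Config N → ℝ} {M : ℝ}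
    (hM : ∀ Y, |h Y| ≤ M) (X : Config N) :
    |fkReal v L s h X| ≤ M * (wienerPaths N (survives L s X)).toReal := by
  have hM0 : 0 ≤ M := (abs_nonneg _).trans (hM X)
  unfold fkReal
  have hbound : ∀ ω, ‖(fkWeight v L s X ω).toReal * h (worldLine X ω s.toNNReal)‖ ≤
      (survives L s X).indicator (fun _ => M) ω := by
    intro ω
    rw [Real.norm_eq_abs, abs_mul, abs_of_nonneg ENNReal.toReal_nonneg]
    by_cases hω : ω ∈ survives L s X
    · rw [Set.indicator_of_mem hω]
      calc (fkWeight v L s X ω).toReal * |h _| ≤ 1 * M :=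
            mul_le_mul (toReal_fkWeight_le_one_aux' v L s X ω) (hM _) (abs_nonneg _) zero_le_one
        _ = M := one_mul M
    · rw [Set.indicator_of_notMem hω]
      simp [fkWeight, Set.indicator_of_notMem hω]
  calc |∫ ω, (fkWeight v L s X ω).toReal * h (worldLine X ω s.toNNReal) ∂wienerPaths N|
      ≤ ∫ ω, (survives L s X).indicator (fun _ => M) ω ∂wienerPaths N := by
        rw [← Real.norm_eq_abs]
        exact norm_integral_le_of_norm_le ((integrable_const M).indicator
          (measurableSet_survives L s X)) (Eventually.of_forall hbound)
    _ = M * (wienerPaths N (survives L s X)).toReal := by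
        rw [integral_indicator_const _ (measurableSet_survives L s X), smul_eq_mul, mul_comm]
        rfl
where
  /-- `w.toReal ≤ 1` (local copy). [folklore] -/
  toReal_fkWeight_le_one_aux' (v : ℝ → ℝ≥0∞) (L s : ℝ) (X : Config N) (ω : PathSpace N) :
      (fkWeight v L s X ω).toReal ≤ 1 :=
    ENNReal.toReal_le_of_le_ofReal zero_le_one (by
      rw [ENNReal.ofReal_one]; exact fkWeight_le_one v L s X ω)

/-- **Continuity of `e^{-tH_N} g` on all of `(ℝ³)^N`** for `g ∈ L²(Λ)`, `t > 0` and a bounded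
pair potential: the strong Feller property inside the box (`continuousAt_fkReal`), and decay to
`0` at the boundary — `e^{-tH} g = e^{-(t/2)H}(e^{-(t/2)H} g)` with `e^{-(t/2)H} g` bounded and the
survival probability up to time `t/2` small near a face (`measure_survives_le_of_upper_gsfk/lower`).
Chung–Zhao (1995), Thm 3.17 with Prop 1.22 (`T_t(L^∞) ⊂ C₀(D)` for the regular domain `D = Λ_L^N`).
[cite: ChungZhao1995, Thm 3.17] -/
private theorem continuous_fkReal_gsfk {v : ℝ → ℝ≥0∞} (hv : Measurable v) {C : ℝ≥0} (hC : ∀ r, v r ≤ C)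
    (L : ℝ) {t : ℝ} (ht : 0 < t) {g : Config N → ℝ} (hg : Measurable g)
    (hg2 : ∫⁻ Y in boxN N L, ‖g Y‖ₑ ^ (2 : ℝ) ≠ ⊤) : Continuous (fkReal v L t g) := by
  rw [continuous_iff_continuousAt]
  intro X₀
  by_cases hX₀ : X₀ ∈ boxN N L
  · exact continuousAt_fkReal hv hC L ht hg hg2 hX₀
  -- boundary / exterior point: the value is `0`
  have hval : fkReal v L t g X₀ = 0 := fkReal_of_notMem v ht.le g hX₀
  rw [Metric.continuousAt_iff]
  intro ε hε
  -- the bounded inner function `h = e^{-(t/2)H} g`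
  set s : ℝ := t / 2 with hs
  have hs0 : 0 < s := half_pos ht
  set Mg : ℝ := ((∫⁻ Y in boxN N L, ‖g Y‖ₑ ^ (2 : ℝ)) ^ (1 / 2 : ℝ)).toReal with hMg
  have hMg0 : 0 ≤ Mg := ENNReal.toReal_nonneg
  have hgM : (∫⁻ Y in boxN N L, ‖g Y‖ₑ ^ (2 : ℝ)) ^ (1 / 2 : ℝ) ≤ ENNReal.ofReal Mg := by
    rw [hMg, ENNReal.ofReal_toReal (ENNReal.rpow_ne_top_of_nonneg (by norm_num) hg2)]
  set K : ℝ := ((∏ _i : Fin N, ∏ _k : Fin 3,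
      ENNReal.ofReal (Real.sqrt (2 * Real.pi * (2 * s.toNNReal)))⁻¹) ^ (1 / 2 : ℝ)).toReal * Mg
    with hK
  have hK0 : 0 ≤ K := mul_nonneg ENNReal.toReal_nonneg hMg0
  have hhK : ∀ Y, |fkReal v L s g Y| ≤ K := fun Y =>
    abs_fkReal_le_heatConst v L hs0 le_rfl hg hMg0 hgM Y
  -- choice of the margin `m` and of `δ = √2 m`
  have hsq : 0 < Real.sqrt s := Real.sqrt_pos.2 hs0
  set m : ℝ := min (Real.sqrt s) (Real.sqrt s * (ε / (2 * (K + 1))) ^ 2) with hm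
  have hm0 : 0 < m := lt_min hsq (by positivity)
  have hms : m ≤ Real.sqrt s := min_le_left _ _
  have hbound : K * (2 * Real.sqrt (m / Real.sqrt s)) < ε := by
    have h1 : m / Real.sqrt s ≤ (ε / (2 * (K + 1))) ^ 2 := by
      rw [div_le_iff₀ hsq]
      calc m ≤ Real.sqrt s * (ε / (2 * (K + 1))) ^ 2 := min_le_right _ _
        _ = (ε / (2 * (K + 1))) ^ 2 * Real.sqrt s := mul_comm _ _
    have h2 : Real.sqrt (m / Real.sqrt s) ≤ ε / (2 * (K + 1)) := by
      rw [← Real.sqrt_sq (by positivity : (0 : ℝ) ≤ ε / (2 * (K + 1)))]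
      exact Real.sqrt_le_sqrt h1
    calc K * (2 * Real.sqrt (m / Real.sqrt s)) ≤ K * (2 * (ε / (2 * (K + 1)))) := by gcongr
      _ = ε * (K / (K + 1)) := by field_simp
      _ < ε * 1 := by
          refine mul_lt_mul_of_pos_left ?_ hε
          rw [div_lt_one (by linarith)]; linarith
      _ = ε := mul_one ε
  refine ⟨Real.sqrt 2 * m, by positivity, fun X hX => ?_⟩
  rw [hval, dist_zero_right, Real.norm_eq_abs]
  by_cases hXb : X ∈ boxN N L
  swap
  · rw [fkReal_of_notMem v ht.le g hXb, abs_zero]; exact hε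
  -- a coordinate of `X₀` outside `(0, L)`
  obtain ⟨i, k, hik⟩ : ∃ i k, X₀ i k ∉ Set.Ioo 0 L := by
    simpa only [boxN, box, Set.mem_setOf_eq, not_forall] using hX₀
  have hcoord : |X i k - X₀ i k| < Real.sqrt 2 * m := by
    calc |X i k - X₀ i k| = |(X - X₀) i k| := by simp
      _ ≤ ‖X - X₀‖ := abs_coord_le_norm_gsfk _ i k
      _ < _ := by rwa [← dist_eq_norm]
  -- the semigroup split and the exit bound
  have hsplit : fkReal v L t g X = fkReal v L s (fkReal v L s g) X := by
    rw [show t = s + s by rw [hs]; ring]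
    exact fkReal_add_time hv L hs0 hs0 hg hg2 X
  have hs' : (0 : ℝ≥0) < s.toNNReal := by simpa using hs0
  have hms' : m ≤ Real.sqrt (s.toNNReal : ℝ≥0) := by
    rwa [Real.coe_toNNReal _ hs0.le]
  have hexit : wienerPaths N (survives L s X) ≤ ENNReal.ofReal (2 * Real.sqrt (m / Real.sqrt s)) := by
    rw [Set.mem_Ioo, not_and_or, not_lt, not_lt] at hik
    rcases hik with hlow | hup
    · have hXik : X i k ≤ Real.sqrt 2 * m := by
        have := (abs_lt.1 hcoord).2; linarith
      have := measure_survives_le_of_lower_gsfk L hs' hm0 hms' (X := X) hXik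
      rwa [Real.coe_toNNReal _ hs0.le] at this
    · have hXik : L - X i k ≤ Real.sqrt 2 * m := by
        have := (abs_lt.1 hcoord).1; linarith
      have := measure_survives_le_of_upper_gsfk L hs' hm0 hms' (X := X) hXik
      rwa [Real.coe_toNNReal _ hs0.le] at this
  have hexit' : (wienerPaths N (survives L s X)).toReal ≤ 2 * Real.sqrt (m / Real.sqrt s) :=
    ENNReal.toReal_le_of_le_ofReal (by positivity) hexit
  rw [hsplit]
  calc |fkReal v L s (fkReal v L s g) X| ≤ K * (wienerPaths N (survives L s X)).toReal :=
        abs_fkReal_le_mul_measure_survives_gsfk v L s hhK X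
    _ ≤ K * (2 * Real.sqrt (m / Real.sqrt s)) := mul_le_mul_of_nonneg_left hexit' hK0
    _ < ε := hbound

/-! ### The pointwise eigenfunction -/

/-- **Time-independence of `ρ^{-t} T_t g`**: if `T_s g = ρˢ g` a.e. on the box for all `s > 0`
(`g ∈ L²(Λ)`, `ρ > 0`), then `T_t g (X) = ρ^{t-s} T_s g (X)` at EVERY point for `0 < s < t`
(semigroup law and insensitivity of `T_s` to null modifications). Chung–Zhao (1995), §8.3 (29).
[folklore] -/
private theorem fkReal_eq_rpow_mul_fkReal_gsfk {v : ℝ → ℝ≥0∞} (hv : Measurable v) {L : ℝ} {g : Config N → ℝ}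
    (hg : Measurable g) (hg2 : ∫⁻ Y in boxN N L, ‖g Y‖ₑ ^ (2 : ℝ) ≠ ⊤) {ρ : ℝ}
    (heig : ∀ s : ℝ, 0 < s →
      fkReal v L s g =ᵐ[volume.restrict (boxN N L)] fun Y => ρ ^ s * g Y)
    {s t : ℝ} (hs : 0 < s) (hst : s < t) (X : Config N) :
    fkReal v L t g X = ρ ^ (t - s) * fkReal v L s g X := by
  have hts : 0 < t - s := sub_pos.2 hst
  rw [show t = s + (t - s) by ring, fkReal_add_time hv L hs hts hg hg2 X,
    fkReal_congr_ae_restrict v L hs (heig (t - s) hts) X, show s + (t - s) - s = t - s by ring]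
  exact fkReal_smul v L s (ρ ^ (t - s)) g X

/-- **The pointwise eigen-relation `T_T Ψ = ρᵀ Ψ`** for `Ψ = ρ⁻¹ T_1 g` and every `T > 0`, at every
point. [folklore] -/
private theorem fkReal_one_eq_rpow_mul_gsfk {v : ℝ → ℝ≥0∞} (hv : Measurable v) {L : ℝ} {g : Config N → ℝ}
    (hg : Measurable g) (hg2 : ∫⁻ Y in boxN N L, ‖g Y‖ₑ ^ (2 : ℝ) ≠ ⊤) {ρ : ℝ} (hρ : 0 < ρ)
    (heig : ∀ s : ℝ, 0 < s →
      fkReal v L s g =ᵐ[volume.restrict (boxN N L)] fun Y => ρ ^ s * g Y)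
    {T : ℝ} (hT : 0 < T) (X : Config N) :
    fkReal v L T g X = ρ ^ T * (ρ⁻¹ * fkReal v L 1 g X) := by
  rcases lt_trichotomy T 1 with h | rfl | h
  · have h1 := fkReal_eq_rpow_mul_fkReal_gsfk hv hg hg2 heig hT h X
    rw [h1, ← mul_assoc, ← mul_assoc, Real.rpow_sub hρ, Real.rpow_one]
    field_simp
  · rw [Real.rpow_one]; field_simp
  · rw [fkReal_eq_rpow_mul_fkReal_gsfk hv hg hg2 heig one_pos h X, Real.rpow_sub hρ, Real.rpow_one]
    field_simp

/-- The candidate `Ψ = ρ⁻¹ T_1 g` agrees with `g` a.e. on the box. [folklore] -/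
private theorem candidate_ae_eq_gsfk {v : ℝ → ℝ≥0∞} {L : ℝ} {g : Config N → ℝ} {ρ : ℝ} (hρ : 0 < ρ)
    (heig : ∀ s : ℝ, 0 < s →
      fkReal v L s g =ᵐ[volume.restrict (boxN N L)] fun Y => ρ ^ s * g Y) :
    (fun X => ρ⁻¹ * fkReal v L 1 g X) =ᵐ[volume.restrict (boxN N L)] g := by
  filter_upwards [heig 1 one_pos] with Y hY
  rw [hY, Real.rpow_one, ← mul_assoc, inv_mul_cancel₀ hρ.ne', one_mul]

/-- **Pointwise eigen-relation for the candidate**: `T_T Ψ (X) = ρᵀ Ψ(X)` for all `T > 0` and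
all `X`, `Ψ = ρ⁻¹ T_1 g`. [folklore] -/
private theorem fkReal_candidate_gsfk {v : ℝ → ℝ≥0∞} (hv : Measurable v) {L : ℝ} {g : Config N → ℝ}
    (hg : Measurable g) (hg2 : ∫⁻ Y in boxN N L, ‖g Y‖ₑ ^ (2 : ℝ) ≠ ⊤) {ρ : ℝ} (hρ : 0 < ρ)
    (heig : ∀ s : ℝ, 0 < s →
      fkReal v L s g =ᵐ[volume.restrict (boxN N L)] fun Y => ρ ^ s * g Y)
    {T : ℝ} (hT : 0 < T) (X : Config N) :
    fkReal v L T (fun Y => ρ⁻¹ * fkReal v L 1 g Y) X = ρ ^ T * (ρ⁻¹ * fkReal v L 1 g X) := by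
  rw [fkReal_congr_ae_restrict v L hT (candidate_ae_eq_gsfk hρ heig) X]
  exact fkReal_one_eq_rpow_mul_gsfk hv hg hg2 hρ heig hT X

/-! ### From the `L²` eigenvector to the a.e. eigen-relation -/

/-- **The `L²` eigen-relation read on functions**: for the top eigenvector `e ≥ 0` of `T_1`
spanning its eigenspace, `T_s |e| = ‖T_1‖ˢ |e|` a.e. on the box for every `s > 0`
(`semigroup_apply_eigenvector` + `coeff_eq_rpow`). [folklore] -/
private theorem fkReal_abs_ae_eq_gsfk {v : ℝ → ℝ≥0∞} (hv : Measurable v) {C : ℝ≥0} (hC : ∀ r, v r ≤ C) {L : ℝ}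
    (hL : 0 < L) {e : Lp ℝ 2 (volume.restrict (boxN N L))} (he1 : ‖e‖ = 1) (he0 : 0 ≤ e)
    (hSe : fkL2 v L 1 e = ‖fkL2 (N := N) v L 1‖ • e)
    (hsimple : ∀ f : Lp ℝ 2 (volume.restrict (boxN N L)),
      fkL2 v L 1 f = ‖fkL2 (N := N) v L 1‖ • f → ∃ c : ℝ, f = c • e)
    {s : ℝ} (hs : 0 < s) :
    fkReal v L s (fun Y => |e Y|) =ᵐ[volume.restrict (boxN N L)]
      fun Y => ‖fkL2 (N := N) v L 1‖ ^ s * |e Y| := by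
  have hadd : ∀ s t : ℝ, 0 < s → 0 < t →
      fkL2 (N := N) v L (s + t) = (fkL2 v L s).comp (fkL2 v L t) :=
    fun s t hs ht => fkL2_add_time hv L hs ht
  have hcontr : ∀ t : ℝ, 0 < t → ‖fkL2 (N := N) v L t‖ ≤ 1 := fun t _ => norm_fkL2_le_one v L t
  have hpos : ∀ t : ℝ, 0 < t → ∀ x : Lp ℝ 2 (volume.restrict (boxN N L)),
      0 ≤ ⟪fkL2 v L t x, x⟫_ℝ := fun t ht x => inner_fkL2_self_nonneg hv L ht x
  have hμ₀ : 0 < ‖fkL2 (N := N) v L 1‖ :=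
    norm_pos_iff.2 (fkL2_perronFrobenius (N := N) hv hC hL one_pos).1
  have h1 : fkL2 v L s e = ‖fkL2 (N := N) v L 1‖ ^ s • e := by
    rw [semigroup_apply_eigenvector (S := fun t => fkL2 (N := N) v L t) hadd he1 hSe hsimple hs,
      coeff_eq_rpow (S := fun t => fkL2 (N := N) v L t) hadd hcontr hpos he1 hSe hsimple hμ₀ hs]
  have he0' : ∀ᵐ Y ∂volume.restrict (boxN N L), |(e : Config N → ℝ) Y| = e Y := by
    filter_upwards [(Lp.coeFn_nonneg e).2 he0] with Y hY
    exact abs_of_nonneg hY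
  have h2 : ((fkL2 v L s e : Lp ℝ 2 (volume.restrict (boxN N L))) : Config N → ℝ)
      =ᵐ[volume.restrict (boxN N L)] fkReal v L s e := fkL2_coeFn hv L hs e
  have h3 : ((‖fkL2 (N := N) v L 1‖ ^ s • e : Lp ℝ 2 (volume.restrict (boxN N L))) : Config N → ℝ)
      =ᵐ[volume.restrict (boxN N L)] ‖fkL2 (N := N) v L 1‖ ^ s • (e : Config N → ℝ) :=
    Lp.coeFn_smul _ _
  have h4 : fkReal v L s (fun Y => |(e : Config N → ℝ) Y|) = fkReal v L s e :=
    funext fun X => fkReal_congr_ae_restrict v L hs he0' X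
  rw [h4]
  rw [h1] at h2
  filter_upwards [h2, h3, he0'] with Y h2Y h3Y h0Y
  rw [← h2Y, h3Y, Pi.smul_apply, smul_eq_mul, h0Y]

/-! ### Bose symmetry of the top eigenvector -/

/-- **Bose symmetry of the top eigenfunction**: `T_1 |e| (X ∘ σ) = T_1 |e| (X)` for every
permutation `σ` and every `X` — the relabelled class `e ∘ (· ∘ σ)` is again a nonnegative unit
eigenvector of `T_1` for `‖T_1‖`, hence equals `e` by nondegeneracy (Reed–Simon IV §XIII.12,
remark after Thm XIII.46). [cite: ReedSimonIV1978, Thm XIII.44] -/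
theorem fkReal_abs_comp_perm {v : ℝ → ℝ≥0∞} (hv : Measurable v) {L : ℝ}
    {e : Lp ℝ 2 (volume.restrict (boxN N L))} (he1 : ‖e‖ = 1) (he0 : 0 ≤ e)
    (hSe : fkL2 v L 1 e = ‖fkL2 (N := N) v L 1‖ • e)
    (hsimple : ∀ f : Lp ℝ 2 (volume.restrict (boxN N L)),
      fkL2 v L 1 f = ‖fkL2 (N := N) v L 1‖ • f → ∃ c : ℝ, f = c • e)
    (σ : Equiv.Perm (Fin N)) (X : Config N) :
    fkReal v L 1 (fun Y => |e Y|) (X ∘ σ) = fkReal v L 1 (fun Y => |e Y|) X := by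
  have hPm : MeasurePreserving (fun X : Config N => X ∘ σ) (volume.restrict (boxN N L))
      (volume.restrict (boxN N L)) := measurePreserving_relabel_restrict σ L
  have hgm : Measurable fun Y => |(e : Config N → ℝ) Y| := (measurable_coeFn_Lp e).abs
  have hg0 : ∀ Y, 0 ≤ |(e : Config N → ℝ) Y| := fun Y => abs_nonneg _
  have he0' : ∀ᵐ Y ∂volume.restrict (boxN N L), 0 ≤ (e : Config N → ℝ) Y :=
    (Lp.coeFn_nonneg e).2 he0
  have habs : (fun Y => |(e : Config N → ℝ) Y|) =ᵐ[volume.restrict (boxN N L)] e := by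
    filter_upwards [he0'] with Y hY; exact abs_of_nonneg hY
  -- the relabelled class
  obtain ⟨eσ, heσ⟩ : ∃ eσ : Lp ℝ 2 (volume.restrict (boxN N L)),
      eσ = Lp.compMeasurePreserving (fun X : Config N => X ∘ σ) hPm e := ⟨_, rfl⟩
  have heσ_coe : (eσ : Config N → ℝ) =ᵐ[volume.restrict (boxN N L)]
      (e : Config N → ℝ) ∘ (fun X : Config N => X ∘ σ) := by
    rw [heσ]; exact Lp.coeFn_compMeasurePreserving e hPm
  have heσ_norm : ‖eσ‖ = 1 := by rw [heσ, Lp.norm_compMeasurePreserving, he1]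
  -- `T_1 |e| = μ₀ e` a.e.
  have hT1 : fkReal v L 1 (fun Y => |(e : Config N → ℝ) Y|) =ᵐ[volume.restrict (boxN N L)]
      fun Y => ‖fkL2 (N := N) v L 1‖ * (e : Config N → ℝ) Y := by
    have h2 : ((fkL2 v L 1 e : Lp ℝ 2 (volume.restrict (boxN N L))) : Config N → ℝ)
        =ᵐ[volume.restrict (boxN N L)] fkReal v L 1 e := fkL2_coeFn hv L one_pos e
    have h3 : ((‖fkL2 (N := N) v L 1‖ • e : Lp ℝ 2 (volume.restrict (boxN N L))) : Config N → ℝ)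
        =ᵐ[volume.restrict (boxN N L)] ‖fkL2 (N := N) v L 1‖ • (e : Config N → ℝ) :=
      Lp.coeFn_smul _ _
    have h4 : fkReal v L 1 (fun Y => |(e : Config N → ℝ) Y|) = fkReal v L 1 e :=
      funext fun X => fkReal_congr_ae_restrict v L one_pos habs X
    rw [h4]; rw [hSe] at h2
    filter_upwards [h2, h3] with Y h2Y h3Y
    rw [← h2Y, h3Y, Pi.smul_apply, smul_eq_mul]
  -- `T_1 eσ = μ₀ eσ`
  have hSeσ : fkL2 v L 1 eσ = ‖fkL2 (N := N) v L 1‖ • eσ := by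
    apply Lp.ext
    have h1 : ((fkL2 v L 1 eσ : Lp ℝ 2 (volume.restrict (boxN N L))) : Config N → ℝ)
        =ᵐ[volume.restrict (boxN N L)] fkReal v L 1 eσ := fkL2_coeFn hv L one_pos eσ
    have h2 : fkReal v L 1 eσ = fkReal v L 1 (fun Y => |(e : Config N → ℝ) (Y ∘ σ)|) := by
      funext Y
      refine fkReal_congr_ae_restrict v L one_pos (heσ_coe.trans ?_) Y
      exact hPm.quasiMeasurePreserving.ae_eq_comp habs.symm
    have h3 : ∀ Y, fkReal v L 1 (fun Y => |(e : Config N → ℝ) (Y ∘ σ)|) Y =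
        fkReal v L 1 (fun Y => |(e : Config N → ℝ) Y|) (Y ∘ σ) := fun Y =>
      (fkReal_comp_perm σ hv L 1 hgm hg0 Y).symm
    have h4 : (fun Y => fkReal v L 1 (fun Y => |(e : Config N → ℝ) Y|) (Y ∘ σ))
        =ᵐ[volume.restrict (boxN N L)] fun Y => ‖fkL2 (N := N) v L 1‖ * (e : Config N → ℝ) (Y ∘ σ) :=
      hPm.quasiMeasurePreserving.ae_eq_comp hT1
    have h5 : ((‖fkL2 (N := N) v L 1‖ • eσ : Lp ℝ 2 (volume.restrict (boxN N L))) : Config N → ℝ)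
        =ᵐ[volume.restrict (boxN N L)] ‖fkL2 (N := N) v L 1‖ • (eσ : Config N → ℝ) :=
      Lp.coeFn_smul _ _
    filter_upwards [h1, h4, h5, heσ_coe] with Y h1Y h4Y h5Y h6Y
    rw [h1Y, h2, h3 Y, h4Y, h5Y, Pi.smul_apply, smul_eq_mul, h6Y, Function.comp_apply]
  -- nondegeneracy: `eσ = c e` with `c = 1`
  obtain ⟨c, hc⟩ := hsimple eσ hSeσ
  have hc1 : |c| = 1 := by
    have := congrArg norm hc
    rw [heσ_norm, norm_smul, he1, mul_one, Real.norm_eq_abs] at this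
    exact this.symm
  have hcpos : 0 < c := by
    rcases le_or_gt c 0 with hcn | hcp
    · exfalso
      -- then `eσ ≤ 0` and `eσ ≥ 0` a.e., so `eσ = 0`, contradicting `‖eσ‖ = 1`
      have hle : ∀ᵐ Y ∂volume.restrict (boxN N L), (eσ : Config N → ℝ) Y ≤ 0 := by
        have h1 : ((c • e : Lp ℝ 2 (volume.restrict (boxN N L))) : Config N → ℝ)
            =ᵐ[volume.restrict (boxN N L)] c • (e : Config N → ℝ) := Lp.coeFn_smul _ _
        rw [← hc] at h1
        filter_upwards [h1, he0'] with Y h1Y h0Y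
        rw [h1Y, Pi.smul_apply, smul_eq_mul]
        exact mul_nonpos_of_nonpos_of_nonneg hcn h0Y
      have hge : ∀ᵐ Y ∂volume.restrict (boxN N L), 0 ≤ (eσ : Config N → ℝ) Y := by
        have h := hPm.quasiMeasurePreserving.ae he0'
        filter_upwards [heσ_coe, h] with Y h1 h2
        rw [h1]; exact h2
      have hzero : (eσ : Config N → ℝ) =ᵐ[volume.restrict (boxN N L)] 0 := by
        filter_upwards [hle, hge] with Y h1 h2
        exact le_antisymm h1 h2
      have := Lp.eq_zero_iff_ae_eq_zero.2 hzero
      rw [this, norm_zero] at heσ_norm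
      exact zero_ne_one heσ_norm
    · exact hcp
  have hc' : c = 1 := by rw [← abs_of_pos hcpos]; exact hc1
  rw [hc', one_smul] at hc
  -- conclusion: `|e| ∘ P = |e|` a.e., transported through `T_1`
  have hgP : (fun Y => |(e : Config N → ℝ) (Y ∘ σ)|) =ᵐ[volume.restrict (boxN N L)]
      fun Y => |(e : Config N → ℝ) Y| := by
    have h1 := heσ_coe
    rw [hc] at h1
    filter_upwards [h1] with Y hY
    rw [hY, Function.comp_apply]
  rw [fkReal_comp_perm σ hv L 1 hgm hg0 X]
  exact fkReal_congr_ae_restrict v L one_pos hgP X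

/-! ### The Rayleigh bound on the `C¹` Dirichlet core -/

/-- **`⟨f, T_t f⟩ ≤ ‖T_1‖ᵗ ‖f‖²` for `C¹` real `f` vanishing off the box** (`t > 0`): the abstract
Rayleigh bound `inner_semigroup_le_rpow_mul` for the class of `f` in `L²(Λ)`.
Chung–Zhao (1995), Thm 3.27 (`‖T_t‖₂ = e^{λ₁ t}`). [cite: ChungZhao1995, Thm 3.27] -/
private theorem pairing_le_rpow_gsfk {v : ℝ → ℝ≥0∞} (hv : Measurable v) {C : ℝ≥0} (hC : ∀ r, v r ≤ C)
    {L : ℝ} (hL : 0 < L) {f : Config N → ℝ} (hf : ContDiff ℝ 1 f)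
    (hf0 : ∀ X, X ∉ boxN N L → f X = 0) {t : ℝ} (ht : 0 < t) :
    ∫ X, f X * fkReal v L t f X ≤ ‖fkL2 (N := N) v L 1‖ ^ t * ∫ X, f X ^ 2 := by
  obtain ⟨M, -, hM⟩ := exists_bound_of_contDiff_gsfk hf hf0
  have hfm : Measurable f := hf.continuous.measurable
  haveI : IsFiniteMeasure (volume.restrict (boxN N L) : Measure (Config N)) :=
    ⟨by rw [Measure.restrict_apply_univ]; exact volume_boxN_lt_top N L⟩
  have hf2 : MemLp f 2 (volume.restrict (boxN N L)) :=
    MemLp.of_bound hfm.aestronglyMeasurable M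
      (Eventually.of_forall fun X => by rw [Real.norm_eq_abs]; exact hM X)
  obtain ⟨F, hF⟩ : ∃ F : Lp ℝ 2 (volume.restrict (boxN N L)), F = hf2.toLp f := ⟨_, rfl⟩
  have hFf : (F : Config N → ℝ) =ᵐ[volume.restrict (boxN N L)] f := by
    rw [hF]; exact hf2.coeFn_toLp
  have hadd : ∀ s t : ℝ, 0 < s → 0 < t →
      fkL2 (N := N) v L (s + t) = (fkL2 v L s).comp (fkL2 v L t) :=
    fun s t hs ht => fkL2_add_time hv L hs ht
  have hcontr : ∀ t : ℝ, 0 < t → ‖fkL2 (N := N) v L t‖ ≤ 1 := fun t _ => norm_fkL2_le_one v L t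
  have hsym : ∀ t : ℝ, 0 < t → ∀ x y : Lp ℝ 2 (volume.restrict (boxN N L)),
      ⟪fkL2 v L t x, y⟫_ℝ = ⟪x, fkL2 v L t y⟫_ℝ := fun t ht x y => inner_fkL2_comm hv L ht x y
  have hμ₀ : 0 < ‖fkL2 (N := N) v L 1‖ :=
    norm_pos_iff.2 (fkL2_perronFrobenius (N := N) hv hC hL one_pos).1
  have h1 := inner_semigroup_le_rpow_mul (S := fun t => fkL2 (N := N) v L t) hadd hcontr hsym hμ₀ F ht
  have h2 : ∫ X, f X * fkReal v L t f X = ⟪F, fkL2 v L t F⟫_ℝ := by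
    rw [inner_Lp_eq_integral, ← setIntegral_eq_integral_of_forall_compl_eq_zero
      (s := boxN N L) (fun X (hX : X ∉ boxN N L) =>
        show f X * fkReal v L t f X = 0 by rw [hf0 X hX, zero_mul])]
    have h3 : ((fkL2 v L t F : Lp ℝ 2 (volume.restrict (boxN N L))) : Config N → ℝ)
        =ᵐ[volume.restrict (boxN N L)] fkReal v L t F := fkL2_coeFn hv L ht F
    have h4 : fkReal v L t F = fkReal v L t f :=
      funext fun X => fkReal_congr_ae_restrict v L ht hFf X
    refine integral_congr_ae ?_
    filter_upwards [hFf, h3] with X hX h3X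
    rw [hX, h3X, h4]
  have h3 : ∫ X, f X ^ 2 = ‖F‖ ^ 2 := by
    rw [← real_inner_self_eq_norm_sq, inner_Lp_eq_integral,
      ← setIntegral_eq_integral_of_forall_compl_eq_zero (s := boxN N L)
        (fun X (hX : X ∉ boxN N L) => show f X ^ 2 = 0 by rw [hf0 X hX]; ring)]
    refine integral_congr_ae ?_
    filter_upwards [hFf] with X hX
    rw [hX, sq]
  rw [h2, h3]
  exact h1

/-! ### Normalisation -/

/-- `∫ Ψ₀² = 1` in `[0, ∞]` for a nonnegative version `Ψ₀` of the unit vector `e`, vanishing off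
the box. [folklore] -/
private theorem lintegral_ofReal_sq_eq_one_gsfk {L : ℝ} {e : Lp ℝ 2 (volume.restrict (boxN N L))}
    (he1 : ‖e‖ = 1) {Ψ₀ : Config N → ℝ} (hΨe : Ψ₀ =ᵐ[volume.restrict (boxN N L)] e)
    (hΨnn : ∀ X, 0 ≤ Ψ₀ X) (hΨ0 : ∀ X, X ∉ boxN N L → Ψ₀ X = 0) :
    ∫⁻ X, ENNReal.ofReal (Ψ₀ X) ^ 2 = 1 := by
  have h1 : (fun X => ENNReal.ofReal (Ψ₀ X) ^ 2) =
      (boxN N L).indicator (fun X => ENNReal.ofReal (Ψ₀ X) ^ 2) := by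
    funext X
    by_cases hX : X ∈ boxN N L
    · rw [Set.indicator_of_mem hX]
    · rw [Set.indicator_of_notMem hX, hΨ0 X hX, ENNReal.ofReal_zero, zero_pow two_ne_zero]
  rw [h1, lintegral_indicator (measurableSet_boxN N L)]
  have h2 : ∫⁻ X in boxN N L, ENNReal.ofReal (Ψ₀ X) ^ 2 =
      ∫⁻ X in boxN N L, ‖(e : Config N → ℝ) X‖ₑ ^ (2 : ℝ) := by
    refine lintegral_congr_ae ?_
    filter_upwards [hΨe] with X hX
    have h0 : 0 ≤ (e : Config N → ℝ) X := hX ▸ hΨnn X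
    rw [ENNReal.rpow_two, hX, Real.enorm_of_nonneg h0]
  rw [h2]
  have h3 := ofReal_norm_Lp e
  rw [he1, ENNReal.ofReal_one] at h3
  have h4 : (∫⁻ X in boxN N L, ‖(e : Config N → ℝ) X‖ₑ ^ (2 : ℝ)) =
      ((∫⁻ X in boxN N L, ‖(e : Config N → ℝ) X‖ₑ ^ (2 : ℝ)) ^ (1 / 2 : ℝ)) ^ (2 : ℝ) := by
    rw [← ENNReal.rpow_mul]; norm_num
  rw [h4, ← h3, ENNReal.one_rpow]

/-! ### The ground-state projection at every point -/

/-- **`e^{λT} (e^{-TH_N} G)(X) → ⟨Ψ₀, G⟩ Ψ₀(X)` at every point `X`**, `λ = -log ‖T_1‖`, for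
measurable `G ≥ 0` with `∫ G² < ∞`: the `L²` ground-state projection
`‖T_1‖^{-t} T_t G → ⟪e, G⟫ e` (`tendsto_rpow_smul_semigroup`) composed with the bounded evaluation
`fkEval v L 1 X` of `T_1 : L² → L^∞` (`e^{λ(1+t)} T_{1+t} G = e^{λ} T_1 (e^{λt} T_t G)`).
Glimm–Jaffe (1987) (3.4.2); Chung–Zhao (1995) §8.3 (29)–(30). [cite: GlimmJaffeQP1987, §3.4 (3.4.2)] -/
theorem tendsto_exp_mul_fkSemigroup {v : ℝ → ℝ≥0∞} (hv : Measurable v) {C : ℝ≥0}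
    (hC : ∀ r, v r ≤ C) {L : ℝ} (hL : 0 < L) {e : Lp ℝ 2 (volume.restrict (boxN N L))}
    (he1 : ‖e‖ = 1) (hSe : fkL2 v L 1 e = ‖fkL2 (N := N) v L 1‖ • e)
    (hsimple : ∀ f : Lp ℝ 2 (volume.restrict (boxN N L)),
      fkL2 v L 1 f = ‖fkL2 (N := N) v L 1‖ • f → ∃ c : ℝ, f = c • e)
    {Ψ₀ : Config N → ℝ} (hΨe : Ψ₀ =ᵐ[volume.restrict (boxN N L)] e)
    (hΨ0 : ∀ X, X ∉ boxN N L → Ψ₀ X = 0) (hΨnn : ∀ X, 0 ≤ Ψ₀ X) (hΨ2 : MemLp Ψ₀ 2 volume)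
    (hΨ1 : ∀ X, Ψ₀ X = ‖fkL2 (N := N) v L 1‖⁻¹ * fkReal v L 1 e X)
    {lam : ℝ} (hlam : lam = -Real.log ‖fkL2 (N := N) v L 1‖)
    {G : Config N → ℝ≥0∞} (hG : Measurable G) (hG2 : ∫⁻ Y, G Y ^ 2 ≠ ⊤) (X : Config N) :
    Tendsto (fun T : ℝ => ENNReal.ofReal (Real.exp (lam * T)) * fkSemigroup v L T G X) atTop
      (𝓝 ((∫⁻ Y, ENNReal.ofReal (Ψ₀ Y) * G Y) * ENNReal.ofReal (Ψ₀ X))) := by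
  have hμ₀ : 0 < ‖fkL2 (N := N) v L 1‖ :=
    norm_pos_iff.2 (fkL2_perronFrobenius (N := N) hv hC hL one_pos).1
  have hexp : ∀ T : ℝ, Real.exp (lam * T) = ‖fkL2 (N := N) v L 1‖ ^ (-T) := fun T => by
    rw [Real.rpow_def_of_pos hμ₀, hlam]; congr 1; ring
  -- the real observable `gr = G.toReal`
  have hG2' : ∫⁻ Y, G Y ^ (2 : ℝ) ≠ ⊤ := by simpa only [ENNReal.rpow_two] using hG2
  have hGfin : ∀ᵐ Y ∂(volume : Measure (Config N)), G Y < ⊤ := by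
    filter_upwards [ae_lt_top (hG.pow_const 2) hG2] with Y hY
    by_contra h
    rw [not_lt, top_le_iff] at h
    rw [h, ENNReal.top_pow two_ne_zero] at hY
    exact lt_irrefl _ hY
  have hgrm : Measurable fun Y => (G Y).toReal := hG.ennreal_toReal
  have hgr0 : ∀ Y, 0 ≤ (G Y).toReal := fun Y => ENNReal.toReal_nonneg
  have hGgr : G =ᵐ[volume] fun Y => ENNReal.ofReal (G Y).toReal := by
    filter_upwards [hGfin] with Y hY
    exact (ENNReal.ofReal_toReal hY.ne).symm
  have hgr_enorm : ∀ Y, ‖(G Y).toReal‖ₑ ≤ G Y := fun Y => by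
    rw [Real.enorm_of_nonneg (hgr0 Y)]; exact ENNReal.ofReal_toReal_le
  have hgr2vol : ∫⁻ Y, ‖(G Y).toReal‖ₑ ^ (2 : ℝ) ≠ ⊤ :=
    ne_top_of_le_ne_top hG2' (lintegral_mono fun Y => by gcongr; exact hgr_enorm Y)
  have hgr2 : ∫⁻ Y in boxN N L, ‖(G Y).toReal‖ₑ ^ (2 : ℝ) ≠ ⊤ :=
    ne_top_of_le_ne_top hgr2vol (setLIntegral_le_lintegral _ _)
  have hgrMem : MemLp (fun Y => (G Y).toReal) 2 volume := by
    rw [memLp_two_iff_integrable_sq hgrm.aestronglyMeasurable]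
    refine ⟨(hgrm.pow_const 2).aestronglyMeasurable, ?_⟩
    rw [hasFiniteIntegral_iff_enorm]
    calc ∫⁻ Y, ‖(G Y).toReal ^ 2‖ₑ = ∫⁻ Y, ‖(G Y).toReal‖ₑ ^ (2 : ℝ) :=
          lintegral_congr fun Y => by rw [enorm_pow, ENNReal.rpow_two]
      _ < ⊤ := hgr2vol.lt_top
  have hgrMemR : MemLp (fun Y => (G Y).toReal) 2 (volume.restrict (boxN N L)) :=
    hgrMem.restrict _
  obtain ⟨Gl, hGl'⟩ : ∃ Gl : Lp ℝ 2 (volume.restrict (boxN N L)),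
      Gl = hgrMemR.toLp (fun Y => (G Y).toReal) := ⟨_, rfl⟩
  have hGl : (Gl : Config N → ℝ) =ᵐ[volume.restrict (boxN N L)] fun Y => (G Y).toReal := by
    rw [hGl']; exact hgrMemR.coeFn_toLp
  -- `L²` convergence
  have hadd : ∀ s t : ℝ, 0 < s → 0 < t →
      fkL2 (N := N) v L (s + t) = (fkL2 v L s).comp (fkL2 v L t) :=
    fun s t hs ht => fkL2_add_time hv L hs ht
  have hcontr : ∀ t : ℝ, 0 < t → ‖fkL2 (N := N) v L t‖ ≤ 1 := fun t _ => norm_fkL2_le_one v L t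
  have hsym : ∀ t : ℝ, 0 < t → ∀ x y : Lp ℝ 2 (volume.restrict (boxN N L)),
      ⟪fkL2 v L t x, y⟫_ℝ = ⟪x, fkL2 v L t y⟫_ℝ := fun t ht x y => inner_fkL2_comm hv L ht x y
  have hpos : ∀ t : ℝ, 0 < t → ∀ x : Lp ℝ 2 (volume.restrict (boxN N L)),
      0 ≤ ⟪fkL2 v L t x, x⟫_ℝ := fun t ht x => inner_fkL2_self_nonneg hv L ht x
  have hc1 : IsCompactOperator (fkL2 (N := N) v L 1) := isCompactOperator_fkL2 hv hC hL one_pos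
  have hS1 : fkL2 (N := N) v L 1 ≠ 0 := (fkL2_perronFrobenius (N := N) hv hC hL one_pos).1
  have hL2 := tendsto_rpow_smul_semigroup (S := fun t => fkL2 (N := N) v L t) hadd hcontr hsym hpos
    hc1 hS1 he1 hSe hsimple Gl
  have hΦ := ((fkEval v L 1 X).continuous.tendsto _).comp hL2
  -- identify the values
  have hval : ∀ t : ℝ, 0 < t → fkEval v L 1 X ((‖fkL2 (N := N) v L 1‖ ^ (-t)) • fkL2 v L t Gl) =
      ‖fkL2 (N := N) v L 1‖ ^ (-t) * fkReal v L (1 + t) (fun Y => (G Y).toReal) X := by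
    intro t ht
    rw [map_smul, smul_eq_mul, fkEval_apply hv L one_pos, fkReal_add_time hv L one_pos ht hgrm hgr2 X]
    congr 1
    refine fkReal_congr_ae_restrict v L one_pos ?_ X
    filter_upwards [fkL2_coeFn hv L ht Gl] with Y hY
    rw [hY]
    exact fkReal_congr_ae_restrict v L ht hGl Y
  have hlim : fkEval v L 1 X (⟪e, Gl⟫_ℝ • e) = ⟪e, Gl⟫_ℝ * (‖fkL2 (N := N) v L 1‖ * Ψ₀ X) := by
    rw [map_smul, smul_eq_mul, fkEval_apply hv L one_pos, hΨ1 X, ← mul_assoc _ _⁻¹,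
      mul_inv_cancel₀ hμ₀.ne', one_mul]
  have hinner : ⟪e, Gl⟫_ℝ = ∫ Y, Ψ₀ Y * (G Y).toReal := by
    symm
    rw [inner_Lp_eq_integral, ← setIntegral_eq_integral_of_forall_compl_eq_zero (s := boxN N L)
      (fun Y (hY : Y ∉ boxN N L) => show Ψ₀ Y * (G Y).toReal = 0 by rw [hΨ0 Y hY, zero_mul])]
    refine integral_congr_ae ?_
    filter_upwards [hΨe, hGl] with Y h1 h2
    rw [h1, h2]
  -- real-valued convergence
  have hR : Tendsto (fun T : ℝ => ‖fkL2 (N := N) v L 1‖ ^ (-T) * fkReal v L T (fun Y => (G Y).toReal) X)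
      atTop (𝓝 ((∫ Y, Ψ₀ Y * (G Y).toReal) * Ψ₀ X)) := by
    have h1 : Tendsto (fun t : ℝ => ‖fkL2 (N := N) v L 1‖ ^ (-(1 + t)) *
        fkReal v L (1 + t) (fun Y => (G Y).toReal) X) atTop (𝓝 ((∫ Y, Ψ₀ Y * (G Y).toReal) * Ψ₀ X)) := by
      have h2 : (fun t : ℝ => ‖fkL2 (N := N) v L 1‖⁻¹ *
          fkEval v L 1 X ((‖fkL2 (N := N) v L 1‖ ^ (-t)) • fkL2 v L t Gl)) =ᶠ[atTop]
          fun t : ℝ => ‖fkL2 (N := N) v L 1‖ ^ (-(1 + t)) *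
            fkReal v L (1 + t) (fun Y => (G Y).toReal) X := by
        filter_upwards [eventually_gt_atTop 0] with t ht
        rw [hval t ht, ← mul_assoc, neg_add, Real.rpow_add hμ₀, Real.rpow_neg_one]
      refine Tendsto.congr' h2 ?_
      have h3 := hΦ.const_mul ‖fkL2 (N := N) v L 1‖⁻¹
      rw [hlim, hinner, mul_left_comm (∫ Y, Ψ₀ Y * (G Y).toReal) ‖fkL2 (N := N) v L 1‖ (Ψ₀ X),
        inv_mul_cancel_left₀ hμ₀.ne'] at h3
      exact h3
    have h4 := h1.comp (tendsto_atTop_add_const_right atTop (-1) tendsto_id)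
    refine h4.congr fun T => ?_
    simp only [Function.comp_apply, id_eq]
    rw [show (1 : ℝ) + (T + -1) = T by ring]
  have hR' := ENNReal.tendsto_ofReal hR
  -- rewrite everything in `[0, ∞]`
  have hprod : (∫⁻ Y, ENNReal.ofReal (Ψ₀ Y) * G Y) * ENNReal.ofReal (Ψ₀ X) =
      ENNReal.ofReal ((∫ Y, Ψ₀ Y * (G Y).toReal) * Ψ₀ X) := by
    rw [ENNReal.ofReal_mul (integral_nonneg fun Y => mul_nonneg (hΨnn Y) (hgr0 Y))]
    congr 1
    have hint : Integrable (fun Y => Ψ₀ Y * (G Y).toReal) volume := hΨ2.integrable_mul hgrMem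
    rw [ofReal_integral_eq_lintegral_ofReal hint
      (Eventually.of_forall fun Y => mul_nonneg (hΨnn Y) (hgr0 Y))]
    refine lintegral_congr_ae ?_
    filter_upwards [hGgr] with Y hY
    rw [ENNReal.ofReal_mul (hΨnn Y), ← hY]
  rw [hprod]
  refine hR'.congr' ?_
  filter_upwards [eventually_gt_atTop 0] with T hT
  have hfin : fkSemigroup v L T (fun Y => ENNReal.ofReal (G Y).toReal) X < ⊤ := by
    refine fkSemigroup_lt_top v L hT hgrm.ennreal_ofReal ?_ X
    refine ne_top_of_le_ne_top hgr2vol (lintegral_mono fun Y => ?_)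
    rw [Real.enorm_of_nonneg (hgr0 Y)]
  rw [hexp, ENNReal.ofReal_mul (Real.rpow_nonneg hμ₀.le _), fkSemigroup_congr_ae v L hT hGgr X,
    fkReal_eq_toReal_fkSemigroup hv L T hgrm hgr0 X, ENNReal.ofReal_toReal hfin.ne]

/-! ### The theorem -/

/-- **Ground-state Feynman–Kac theorem for bounded pair potentials** — discharge of the named fact
`GroundStateFeynmanKac`: for `N ≥ 1`, `L > 0` and a measurable bounded pair potential `v`, the
Dirichlet Hamiltonian `H_N` on `Λ_L^N` has a normalised, nonnegative, continuous, strictly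
positive, permutation-symmetric ground state `Ψ₀` in Feynman–Kac form (`IsGroundStateFK`), with
`E₀ = groundStateEnergy v N L`. The witness is `Ψ₀ = ‖T_1‖⁻¹ T_1 |e|` for the Perron–Frobenius
eigenvector `e` of `T_1 = e^{-H_N}` on `L²(Λ_L^N)`; `E₀ = -log ‖T_1‖` by the variational
identification `groundStateEnergy_eq_ofReal`. Chung–Zhao (1995), Thms 3.17, 3.27, Prop 3.29,
§8.3; Reed–Simon IV Thm XIII.44; Glimm–Jaffe Thms 3.3.2–3.3.3, (3.4.2).
[cite: ChungZhao1995, Thms 3.17 and 3.27 with Prop 3.29] -/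
theorem GroundStateFeynmanKac_holds : GroundStateFeynmanKac := by
  intro N L v _hN hL hv hbdd
  obtain ⟨C, hC⟩ := hbdd
  -- Perron–Frobenius data at time one
  obtain ⟨hT0, e, he1, he0, hSe, -, hsimple⟩ := fkL2_perronFrobenius (N := N) hv hC hL one_pos
  have hμ₀ : 0 < ‖fkL2 (N := N) v L 1‖ := norm_pos_iff.2 hT0
  -- the nonnegative version `g = |e|` of the eigenvector
  have hgm : Measurable fun Y => |(e : Config N → ℝ) Y| := (measurable_coeFn_Lp e).abs
  have hg0 : ∀ Y, 0 ≤ |(e : Config N → ℝ) Y| := fun Y => abs_nonneg _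
  have he0' : ∀ᵐ Y ∂volume.restrict (boxN N L), 0 ≤ (e : Config N → ℝ) Y :=
    (Lp.coeFn_nonneg e).2 he0
  have habs : (fun Y => |(e : Config N → ℝ) Y|) =ᵐ[volume.restrict (boxN N L)] e := by
    filter_upwards [he0'] with Y hY; exact abs_of_nonneg hY
  have hg2 : ∫⁻ Y in boxN N L, ‖|(e : Config N → ℝ) Y|‖ₑ ^ (2 : ℝ) ≠ ⊤ := by
    have : (fun Y => ‖|(e : Config N → ℝ) Y|‖ₑ ^ (2 : ℝ)) = fun Y => ‖(e : Config N → ℝ) Y‖ₑ ^ (2 : ℝ) := by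
      funext Y; rw [Real.enorm_abs]
    rw [this]; exact setLIntegral_enorm_sq_ne_top e
  have hne : ¬ (fun Y => |(e : Config N → ℝ) Y|) =ᵐ[volume.restrict (boxN N L)] 0 := by
    intro h
    have h1 : (e : Config N → ℝ) =ᵐ[volume.restrict (boxN N L)] 0 := by
      filter_upwards [h] with Y hY
      simpa using hY
    have := Lp.eq_zero_iff_ae_eq_zero.2 h1
    rw [this, norm_zero] at he1
    exact zero_ne_one he1
  have heig : ∀ s : ℝ, 0 < s → fkReal v L s (fun Y => |(e : Config N → ℝ) Y|)
      =ᵐ[volume.restrict (boxN N L)] fun Y => ‖fkL2 (N := N) v L 1‖ ^ s * |(e : Config N → ℝ) Y| :=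
    fun s hs => fkReal_abs_ae_eq_gsfk hv hC hL he1 he0 hSe hsimple hs
  -- the witness
  obtain ⟨Ψ₀, hΨ⟩ : ∃ Ψ₀ : Config N → ℝ,
      Ψ₀ = fun X => ‖fkL2 (N := N) v L 1‖⁻¹ * fkReal v L 1 (fun Y => |(e : Config N → ℝ) Y|) X :=
    ⟨_, rfl⟩
  have hΨm : Measurable Ψ₀ := by
    rw [hΨ]; exact (measurable_fkReal hv L 1 hgm).const_mul _
  have hΨnn : ∀ X, 0 ≤ Ψ₀ X := fun X => by
    rw [hΨ]; exact mul_nonneg (inv_nonneg.2 hμ₀.le) (fkReal_nonneg v L 1 hg0 X)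
  have hΨ0 : ∀ X, X ∉ boxN N L → Ψ₀ X = 0 := fun X hX => by
    rw [hΨ]; simp only [fkReal_of_notMem v zero_le_one _ hX, mul_zero]
  have hΨae : Ψ₀ =ᵐ[volume.restrict (boxN N L)] fun Y => |(e : Config N → ℝ) Y| := by
    rw [hΨ]; exact candidate_ae_eq_gsfk hμ₀ heig
  have hΨe : Ψ₀ =ᵐ[volume.restrict (boxN N L)] e := hΨae.trans habs
  have hΨeig : ∀ T : ℝ, 0 < T → ∀ X, fkReal v L T Ψ₀ X = ‖fkL2 (N := N) v L 1‖ ^ T * Ψ₀ X := by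
    intro T hT X
    rw [hΨ]
    exact fkReal_candidate_gsfk hv hgm hg2 hμ₀ heig hT X
  have hΨcont : Continuous Ψ₀ := by
    rw [hΨ]; exact continuous_const.mul (continuous_fkReal_gsfk hv hC L one_pos hgm hg2)
  have hΨpos : ∀ X ∈ boxN N L, 0 < Ψ₀ X := fun X hX => by
    rw [hΨ]; exact mul_pos (inv_pos.2 hμ₀) (fkReal_pos_of_nonneg hv hC one_pos hgm hg0 hg2 hne hX)
  have hΨsymm : ∀ (σ : Equiv.Perm (Fin N)) (X : Config N), Ψ₀ (X ∘ σ) = Ψ₀ X := by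
    intro σ X
    rw [hΨ]
    simp only [fkReal_abs_comp_perm hv he1 he0 hSe hsimple σ X]
  have hΨ1 : ∀ X, Ψ₀ X = ‖fkL2 (N := N) v L 1‖⁻¹ * fkReal v L 1 e X := fun X => by
    rw [hΨ]
    exact congrArg (fun r => ‖fkL2 (N := N) v L 1‖⁻¹ * r) (fkReal_congr_ae_restrict v L one_pos habs X)
  -- norms
  have hcs : HasCompactSupport Ψ₀ := hasCompactSupport_of_eq_zero_gsfk hΨ0
  have hΨ2 : MemLp Ψ₀ 2 volume := hΨcont.memLp_of_hasCompactSupport hcs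
  have hΨsq : Integrable (fun X => Ψ₀ X ^ 2) volume := hΨ2.integrable_sq
  have hnormL : ∫⁻ X, ENNReal.ofReal (Ψ₀ X) ^ 2 = 1 := lintegral_ofReal_sq_eq_one_gsfk he1 hΨe hΨnn hΨ0
  have hnormR : ∫ X, Ψ₀ X ^ 2 = 1 := by
    rw [← toReal_lintegral_sq hΨsq]
    have : (fun X => ENNReal.ofReal (Ψ₀ X ^ 2)) = fun X => ENNReal.ofReal (Ψ₀ X) ^ 2 := by
      funext X; rw [ENNReal.ofReal_pow (hΨnn X)]
    rw [this, hnormL, ENNReal.toReal_one]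
  -- the identification `E₀ = λ = -log ‖T_1‖`
  obtain ⟨lam, hlam⟩ : ∃ lam : ℝ, lam = -Real.log ‖fkL2 (N := N) v L 1‖ := ⟨_, rfl⟩
  have hexp : ∀ t : ℝ, Real.exp (-(lam * t)) = ‖fkL2 (N := N) v L 1‖ ^ t := fun t => by
    rw [Real.rpow_def_of_pos hμ₀, hlam]; congr 1; ring
  have htop : ∀ f : Config N → ℝ, ContDiff ℝ 1 f → (∀ X, X ∉ boxN N L → f X = 0) →
      ∀ t : ℝ, 0 < t → ∫ X, f X * fkReal v L t f X ≤ Real.exp (-(lam * t)) * ∫ X, f X ^ 2 := by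
    intro f hf hf0 t ht
    rw [hexp]
    exact pairing_le_rpow_gsfk hv hC hL hf hf0 ht
  have heig' : ∀ t : ℝ, 0 < t → Real.exp (-(lam * t)) ≤ ∫ X, Ψ₀ X * fkReal v L t Ψ₀ X := by
    intro t ht
    have : (fun X => Ψ₀ X * fkReal v L t Ψ₀ X) = fun X => ‖fkL2 (N := N) v L 1‖ ^ t * Ψ₀ X ^ 2 := by
      funext X; rw [hΨeig t ht X]; ring
    rw [hexp, this, integral_const_mul, hnormR, mul_one]
  obtain ⟨hEtop, hElam⟩ :=
    groundStateEnergy_toReal_eq hL hv hC htop hΨcont hΨ0 hΨnn hΨsymm hnormR heig'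
  -- assembly
  refine ⟨Ψ₀, ⟨hΨm, hΨnn, hΨ0, hΨsymm, hnormL, hEtop, ?_, ?_⟩, hΨcont, hΨpos⟩
  · -- the eigen-relation, pointwise
    intro T hT X
    rw [hElam]
    rcases hT.eq_or_lt with h | h
    · rw [← h, fkSemigroup_zero, mul_zero, neg_zero, Real.exp_zero, one_mul]
      by_cases hX : X ∈ boxN N L
      · rw [Set.indicator_of_mem hX]
      · rw [Set.indicator_of_notMem hX, hΨ0 X hX, ENNReal.ofReal_zero]
    · have hfin : fkSemigroup v L T (fun Y => ENNReal.ofReal (Ψ₀ Y)) X < ⊤ := by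
        refine fkSemigroup_lt_top v L h hΨm.ennreal_ofReal ?_ X
        have h2 : ∫⁻ Y, ENNReal.ofReal (Ψ₀ Y) ^ (2 : ℝ) = ∫⁻ Y, ENNReal.ofReal (Ψ₀ Y) ^ 2 :=
          lintegral_congr fun Y => ENNReal.rpow_two _
        rw [h2, hnormL]; exact ENNReal.one_ne_top
      rw [← ENNReal.ofReal_toReal hfin.ne, ← fkReal_eq_toReal_fkSemigroup hv L T hΨm hΨnn X,
        hΨeig T h X, hexp]
  · -- the ground-state projection
    intro G hG hG2 X
    rw [hElam]
    exact tendsto_exp_mul_fkSemigroup hv hC hL he1 hSe hsimple hΨe hΨ0 hΨnn hΨ2 hΨ1 hlam hG hG2 X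

end Literature.MathematicalPhysics.QuantumManyBody.BoseGas

end

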